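import Mathlib.MeasureTheory.Measure.Lebesgue.EqHaar
import Mathlib.MeasureTheory.Integral.Bochner.Set
import Mathlib.Order.Filter.AtTopBot.Basic
import Mathlib.Topology.MetricSpace.Basic
import Mathlib.MeasureTheory.Constructions.BorelSpace.Basic
import Literature.Analysis.PDE.HarmonicMapMinimisers
import Literature.Analysis.FunctionSpaces.WeakDerivInner
import Literature.Analysis.FunctionSpaces.SobolevTraceDensityProofs
import Mathlib.Analysis.InnerProductSpace.PiL2
import Mathlib.MeasureTheory.Function.L2Space
import Literature.Analysis.Calculus.RadialCutoff
import Mathlib.Analysis.Calculus.LocalExtr.Basic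
import Mathlib.Analysis.SpecialFunctions.Pow.Integral
import Mathlib.MeasureTheory.Integral.Average
import Mathlib.MeasureTheory.Measure.Lebesgue.VolumeOfBalls
import Mathlib.MeasureTheory.Integral.Prod
import Mathlib.Analysis.InnerProductSpace.Basic
import Mathlib.Analysis.SpecialFunctions.Pow.Real
import Literature.Analysis.PDE.MinimisingMapsCubeExtraction
import HarnessLib

/-!
# Energy minimising maps `Q → S³`, II: competitor transfer, energy convergence and minimality of the limit modulo the HKL shell competitor, shell interpolants, HKL averaging, the sphere ray projection (re-homed proofs)

**Compactness of energy minimising maps `Q → S³` (Luckhaus 1988; Simon, *Theorems on Regularity and Singularity of Energy Minimizing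
Maps* (1996), §2.9 Lemma 1 with Remarks (1)–(2)), proved along Hardt–Kinderlehrer–Lin (Comm. Math. Phys. 105 (1986), §2) — the named fact
`Literature.Analysis.PDE.MinimisingMapCompactness` (`HarmonicMapMinimisers.lean`) HOLDS, EXACT name `Literature.Analysis.PDE.MinimisingMapCompactness_holds`
(file 3; this is file 2 of 3).**  Every sequence of finite-energy unit `W^{1,2}` maps on the open unit cube `Q ⊂ ℝ³`, each minimising the Dirichlet energy on every
ball `B̄_ρ(y) ⊆ Q` against unit competitors agreeing with it off a smaller concentric ball, with bounded energies, has a subsequence converging in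
`L²` on every such ball to a minimiser of the same class, with convergence of the energies [Simon1996] [Luckhaus1988] [HardtKinderlehrerLin1986].
Contents of the three files: (I) interior Rellich–Kondrachov in net form and strong `L²` compactness for sequences bounded in `L^∞ ∩ W^{1,2}`
[Evans2010], dyadic cells / dyadic means and weak limits, the everywhere-unit representative and locality of weak gradients, extraction on the
cube; (II) competitor transfer (the ball-splitting inequality), the radial pigeonhole, energy convergence and ball-minimality of the limit modulo
the Hardt–Kinderlehrer–Lin shell-competitor hypothesis, the compactness theorem modulo that hypothesis, the Sobolev shell interpolant, HKL averaging,
the sphere ray projection; (III) the nonlinear Sobolev chain rule [Ziemer1989] [EvansGariepy1992], the ray-projection calculus, the HKL shell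
competitor, and `MinimisingMapCompactness_holds`.
RE-HOMED into `Literature/` by the Hodge foundations lane (`lit-hodgefound`, seat p20, generation 40): verbatim DECLARATION-LEVEL ports (the 149
theorems needed, in dependency order; each Part is one Summits module) of 30 theorem-only modules
`Summits/QuantumFields/YangMills/Theorems/PoincareLipschitz{SobolevLocalL2Net,SobolevL2Compactness,BlowDownCells,SamplingCells,BlowDownModulus,
BlowDownL2Compactness,DyadicMeansWeakLimit(Cube),LatticeToContinuumSobolevLetters,BlowDownWeakGradientLetters,SobolevCubeExtraction(Letters),
CompetitorTransfer,ShellPigeonhole,MinimisingMapCompactness{Letters,Energy,Minimality,∅,Holds},SobolevShellInterpolation(Balls),ProjectionAveraging(Continuum),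
SphereRayProjection(Calculus),WeakChainRuleShear,SobolevChainRule(ByApproximation),SobolevRayProjectionComp,HKLCompetitor}.lean`; the thirty module
namespaces `Summit.QuantumFields.YangMills.Theorems.PoincareLipschitz*` are COLLAPSED into the single namespace `Literature.Analysis.PDE.MinimisingMaps`
(short names are pairwise distinct; the intra-cone `open … (…)` lines are dropped).  Theorem-only files: no definition, no new named fact (D-0026);
imports Mathlib/Literature only (`Literature/Analysis/FunctionSpaces/{MeyersSerrin,SobolevDomain*,SobolevDifferenceQuotients,SobolevTraceDensity,
WeakDerivInner,DiagonalWeakLimits}`, `Literature/Analysis/Calculus/RadialCutoff`, `Literature/MathematicalPhysics/QuantumFieldTheory/Balaban1983to89/B4Eq19LatticeOperators`);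
every declaration carries the citation of the printed statement it formalises or serves.  The Summits originals stay in place (transitional
duplication).  WHAT THIS IS NOT: nothing here bears on Yang–Mills existence or the mass gap or any summit statement; it is the variational
compactness theory of harmonic maps into `S³` on the unit cube of `ℝ³` (the companion fact `MinimisingMapSmoothness`, Schoen–Uhlenbeck 1984,
remains a named fact).
-/

noncomputable section

/-!
## Part 1 — port of `Summits/QuantumFields/YangMills/Theorems/PoincareLipschitzCompetitorTransfer.lean` (6 declarations kept)

# Energy minimising maps into `S³` (Hardt–Kinderlehrer–Lin / Luckhaus / Simon §2.9): Competitor Transfer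

Declarations of this Part (verbatim port; each keeps its own docstring and citation): `dens_ae_eq_on_ball`, `dens_ae_eq_off_closedBall`, `dens_ae_eq_off_ball`, `setIntegral_ball_eq_add_sdiff`, `competitor_transfer`, `competitor_transfer_of_ballMinimiser`.

Reference keys (see `references.bib` and the declarations' citations): [Simon1996], [HardtKinderlehrerLin1986], [Evans2010].
-/

section Part1

open scoped _root_.BigOperators
open _root_.MeasureTheory _root_.Set _root_.Filter _root_.Topology _root_.TopologicalSpace _root_.Metric

namespace Literature.Analysis.PDE.MinimisingMaps

open Literature.Analysis.FunctionSpaces (HasWeakFDerivOn)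

/-! ## §1 Locality of the Dirichlet density on balls and off closed balls -/

/-- **INNER LOCALITY.**  If `w = v` on the open ball `ball y ρ₁ ⊆ Ω`, the Dirichlet densities of their weak gradients agree a.e.
on that ball. [cite: Evans2010, §5.2.1] -/
theorem dens_ae_eq_on_ball {Ω : Opens (EuclideanSpace ℝ (Fin 3))}
    {v w : EuclideanSpace ℝ (Fin 3) → EuclideanSpace ℝ (Fin 4)}
    {Gv Gw : EuclideanSpace ℝ (Fin 3) → (EuclideanSpace ℝ (Fin 3) →L[ℝ] EuclideanSpace ℝ (Fin 4))}
    (hv : HasWeakFDerivOn Ω volume v Gv) (hw : HasWeakFDerivOn Ω volume w Gw)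
    {y : EuclideanSpace ℝ (Fin 3)} {ρ₁ : ℝ} (hsub : ball y ρ₁ ⊆ (Ω : Set _))
    (hin : ∀ x ∈ ball y ρ₁, w x = v x) :
    ∀ᵐ x ∂(volume.restrict (ball y ρ₁)),
      (∑ i : Fin 3, ‖Gw x (EuclideanSpace.single i (1:ℝ))‖ ^ 2) = ∑ i : Fin 3, ‖Gv x (EuclideanSpace.single i (1:ℝ))‖ ^ 2 := by
  set Ω' : Opens (EuclideanSpace ℝ (Fin 3)) := ⟨ball y ρ₁, isOpen_ball⟩ with hΩ'
  have hle : Ω' ≤ Ω := fun x hx => hsub hx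
  have hae := weakFDeriv_ae_eq_of_eqOn hv hw hle fun x hx => hin x hx
  filter_upwards [hae] with x hx
  simp only [hx]

/-- **OUTER LOCALITY.**  If `w = u` on `Ω` off the open ball `ball y ρ₂`, the Dirichlet densities of their weak gradients agree a.e.
on `Ω ∖ closedBall y ρ₂` (an open set on which `w = u`). [cite: Evans2010, §5.2.1] -/
theorem dens_ae_eq_off_closedBall {Ω : Opens (EuclideanSpace ℝ (Fin 3))}
    {u w : EuclideanSpace ℝ (Fin 3) → EuclideanSpace ℝ (Fin 4)}
    {Gu Gw : EuclideanSpace ℝ (Fin 3) → (EuclideanSpace ℝ (Fin 3) →L[ℝ] EuclideanSpace ℝ (Fin 4))}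
    (hu : HasWeakFDerivOn Ω volume u Gu) (hw : HasWeakFDerivOn Ω volume w Gw)
    {y : EuclideanSpace ℝ (Fin 3)} {ρ₂ : ℝ}
    (hout : ∀ x ∈ (Ω : Set _), x ∉ ball y ρ₂ → w x = u x) :
    ∀ᵐ x ∂(volume.restrict ((Ω : Set _) \ closedBall y ρ₂)),
      (∑ i : Fin 3, ‖Gw x (EuclideanSpace.single i (1:ℝ))‖ ^ 2) = ∑ i : Fin 3, ‖Gu x (EuclideanSpace.single i (1:ℝ))‖ ^ 2 := by
  set Ω' : Opens (EuclideanSpace ℝ (Fin 3)) := ⟨(Ω : Set _) \ closedBall y ρ₂, Ω.isOpen.sdiff isClosed_closedBall⟩ with hΩ'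
  have hle : Ω' ≤ Ω := fun x hx => hx.1
  have hae := weakFDeriv_ae_eq_of_eqOn hu hw hle fun x hx => hout x hx.1 fun hb => hx.2 (ball_subset_closedBall hb)
  filter_upwards [hae] with x hx
  simp only [hx]

/-- **OUTER LOCALITY UP TO THE NULL SPHERE.**  Same, a.e. on `Ω ∖ ball y ρ₂`: the two sets differ by the sphere `sphere y ρ₂`, which is
Lebesgue-null (Mathlib `Measure.addHaar_sphere`). [cite: Evans2010, §5.2.1] -/
theorem dens_ae_eq_off_ball {Ω : Opens (EuclideanSpace ℝ (Fin 3))}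
    {u w : EuclideanSpace ℝ (Fin 3) → EuclideanSpace ℝ (Fin 4)}
    {Gu Gw : EuclideanSpace ℝ (Fin 3) → (EuclideanSpace ℝ (Fin 3) →L[ℝ] EuclideanSpace ℝ (Fin 4))}
    (hu : HasWeakFDerivOn Ω volume u Gu) (hw : HasWeakFDerivOn Ω volume w Gw)
    {y : EuclideanSpace ℝ (Fin 3)} {ρ₂ : ℝ}
    (hout : ∀ x ∈ (Ω : Set _), x ∉ ball y ρ₂ → w x = u x) :
    ∀ᵐ x ∂(volume.restrict ((Ω : Set _) \ ball y ρ₂)),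
      (∑ i : Fin 3, ‖Gw x (EuclideanSpace.single i (1:ℝ))‖ ^ 2) = ∑ i : Fin 3, ‖Gu x (EuclideanSpace.single i (1:ℝ))‖ ^ 2 := by
  have h1 := dens_ae_eq_off_closedBall hu hw hout
  have hS : volume (sphere y ρ₂) = 0 := Measure.addHaar_sphere volume y ρ₂
  have hS' : ∀ᵐ x ∂(volume : Measure (EuclideanSpace ℝ (Fin 3))), x ∉ sphere y ρ₂ := measure_eq_zero_iff_ae_notMem.1 hS
  have hmeas1 : MeasurableSet ((Ω : Set (EuclideanSpace ℝ (Fin 3))) \ closedBall y ρ₂) :=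
    Ω.isOpen.measurableSet.diff isClosed_closedBall.measurableSet
  have hmeas2 : MeasurableSet ((Ω : Set (EuclideanSpace ℝ (Fin 3))) \ ball y ρ₂) :=
    Ω.isOpen.measurableSet.diff isOpen_ball.measurableSet
  rw [ae_restrict_iff' hmeas1] at h1
  rw [ae_restrict_iff' hmeas2]
  filter_upwards [h1, hS'] with x hx hxS hx2
  refine hx ⟨hx2.1, fun hc => ?_⟩
  -- `x ∈ closedBall ∖ ball = sphere`, contradiction
  exact hxS (mem_sphere.2 (le_antisymm (mem_closedBall.1 hc) (not_lt.1 fun h => hx2.2 (mem_ball.2 h))))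

/-! ## §2 Splitting a set integral over nested balls -/

/-- Splitting the integral over `ball y ρ` at an inner concentric ball `ball y ρ₂`, `ρ₂ ≤ ρ`. [cite: Evans2010, §5.2.1] -/
theorem setIntegral_ball_eq_add_sdiff {f : EuclideanSpace ℝ (Fin 3) → ℝ} {y : EuclideanSpace ℝ (Fin 3)} {ρ₂ ρ : ℝ}
    (hρ : ρ₂ ≤ ρ) (hf : IntegrableOn f (ball y ρ) volume) :
    ∫ x in ball y ρ, f x = (∫ x in ball y ρ₂, f x) + ∫ x in ball y ρ \ ball y ρ₂, f x := by
  have hinter : ball y ρ ∩ ball y ρ₂ = ball y ρ₂ := inter_eq_right.2 (ball_subset_ball hρ)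
  rw [← integral_inter_add_sdiff (isOpen_ball (x := y) (ε := ρ₂)).measurableSet hf, hinter]

/-! ## §3 The ball-splitting competitor inequality -/

/-- **COMPETITOR TRANSFER — THE BALL-SPLITTING INEQUALITY** (Simon 1996 §2.9, proof of Lemma 1, comparison step; HKL 1986 §2 for
sphere targets).  Let `u, v, w` have weak gradients `Gu, Gv, Gw` on the open `Ω ⊆ ℝ³` with integrable Dirichlet densities, let
`ρ₁ ≤ ρ₂ ≤ ρ` with `ball y ρ ⊆ Ω`, and suppose the glued map `w` equals `v` on `ball y ρ₁` and equals `u` on `Ω` off `ball y ρ₂`.  If `u`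
minimises against `w` on `ball y ρ` — `∫_{B_ρ} dens Gu ≤ ∫_{B_ρ} dens Gw` — then
`∫_{B_{ρ₂}} dens Gu ≤ ∫_{B_{ρ₁}} dens Gv + ∫_{B_{ρ₂} ∖ B_{ρ₁}} dens Gw`. [cite: Simon1996, §2.9 Lemma 1 (proof, comparison step)] -/
theorem competitor_transfer {Ω : Opens (EuclideanSpace ℝ (Fin 3))}
    {u v w : EuclideanSpace ℝ (Fin 3) → EuclideanSpace ℝ (Fin 4)}
    {Gu Gv Gw : EuclideanSpace ℝ (Fin 3) → (EuclideanSpace ℝ (Fin 3) →L[ℝ] EuclideanSpace ℝ (Fin 4))}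
    (hu : HasWeakFDerivOn Ω volume u Gu) (hv : HasWeakFDerivOn Ω volume v Gv) (hw : HasWeakFDerivOn Ω volume w Gw)
    (hui : IntegrableOn (fun x => ∑ i : Fin 3, ‖Gu x (EuclideanSpace.single i (1:ℝ))‖ ^ 2) (Ω : Set _) volume)
    (hwi : IntegrableOn (fun x => ∑ i : Fin 3, ‖Gw x (EuclideanSpace.single i (1:ℝ))‖ ^ 2) (Ω : Set _) volume)
    {y : EuclideanSpace ℝ (Fin 3)} {ρ₁ ρ₂ ρ : ℝ} (h₁₂ : ρ₁ ≤ ρ₂) (h₂ : ρ₂ ≤ ρ) (hρΩ : ball y ρ ⊆ (Ω : Set _))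
    (hin : ∀ x ∈ ball y ρ₁, w x = v x)
    (hout : ∀ x ∈ (Ω : Set _), x ∉ ball y ρ₂ → w x = u x)
    (hmin : ∫ x in ball y ρ, ∑ i : Fin 3, ‖Gu x (EuclideanSpace.single i (1:ℝ))‖ ^ 2
      ≤ ∫ x in ball y ρ, ∑ i : Fin 3, ‖Gw x (EuclideanSpace.single i (1:ℝ))‖ ^ 2) :
    ∫ x in ball y ρ₂, ∑ i : Fin 3, ‖Gu x (EuclideanSpace.single i (1:ℝ))‖ ^ 2
      ≤ (∫ x in ball y ρ₁, ∑ i : Fin 3, ‖Gv x (EuclideanSpace.single i (1:ℝ))‖ ^ 2)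
        + ∫ x in ball y ρ₂ \ ball y ρ₁, ∑ i : Fin 3, ‖Gw x (EuclideanSpace.single i (1:ℝ))‖ ^ 2 := by
  -- abbreviations for the three densities
  set du : EuclideanSpace ℝ (Fin 3) → ℝ := fun x => ∑ i : Fin 3, ‖Gu x (EuclideanSpace.single i (1:ℝ))‖ ^ 2 with hdu
  set dv : EuclideanSpace ℝ (Fin 3) → ℝ := fun x => ∑ i : Fin 3, ‖Gv x (EuclideanSpace.single i (1:ℝ))‖ ^ 2 with hdv
  set dw : EuclideanSpace ℝ (Fin 3) → ℝ := fun x => ∑ i : Fin 3, ‖Gw x (EuclideanSpace.single i (1:ℝ))‖ ^ 2 with hdw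
  have hρ₂Ω : ball y ρ₂ ⊆ (Ω : Set _) := (ball_subset_ball h₂).trans hρΩ
  have hρ₁Ω : ball y ρ₁ ⊆ (Ω : Set _) := (ball_subset_ball h₁₂).trans hρ₂Ω
  -- integrability on the balls
  have huρ : IntegrableOn du (ball y ρ) volume := hui.mono_set hρΩ
  have hwρ : IntegrableOn dw (ball y ρ) volume := hwi.mono_set hρΩ
  have hwρ₂ : IntegrableOn dw (ball y ρ₂) volume := hwi.mono_set hρ₂Ω
  -- (1) split both sides of `hmin` at `ρ₂`
  have hsu := setIntegral_ball_eq_add_sdiff (f := du) h₂ huρ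
  have hsw := setIntegral_ball_eq_add_sdiff (f := dw) h₂ hwρ
  -- (2) outer identity: `dw = du` a.e. on `ball y ρ ∖ ball y ρ₂ ⊆ Ω ∖ ball y ρ₂`
  have hsub : ball y ρ \ ball y ρ₂ ⊆ (Ω : Set _) \ ball y ρ₂ := fun x hx => ⟨hρΩ hx.1, hx.2⟩
  have hout_ae : ∀ᵐ x ∂(volume.restrict (ball y ρ \ ball y ρ₂)), dw x = du x :=
    ae_restrict_of_ae_restrict_of_subset hsub (dens_ae_eq_off_ball hu hw hout)
  have hout_int : ∫ x in ball y ρ \ ball y ρ₂, dw x = ∫ x in ball y ρ \ ball y ρ₂, du x := integral_congr_ae hout_ae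
  -- hence `∫_{B_{ρ₂}} du ≤ ∫_{B_{ρ₂}} dw`
  have hmid : ∫ x in ball y ρ₂, du x ≤ ∫ x in ball y ρ₂, dw x := by
    have h := hmin
    rw [hsu, hsw, hout_int] at h
    linarith
  -- (3) split `∫_{B_{ρ₂}} dw` at `ρ₁` and use the inner identity `dw = dv` a.e. on `ball y ρ₁`
  have hsw₂ := setIntegral_ball_eq_add_sdiff (f := dw) h₁₂ hwρ₂
  have hin_int : ∫ x in ball y ρ₁, dw x = ∫ x in ball y ρ₁, dv x :=
    integral_congr_ae (dens_ae_eq_on_ball hv hw hρ₁Ω hin)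
  rw [hsw₂, hin_int] at hmid
  exact hmid

/-- **COMPETITOR TRANSFER FOR A BALL-MINIMISER OF THE (C) CLASS.**  On the open unit cube `Q ⊂ ℝ³`: let `u` have weak gradient `Gu` with
integrable density and satisfy, at the ball `ball y ρ` (`closedBall y ρ ⊆ Q`), the minimality clause of
lit `Literature.Analysis.PDE.MinimisingMapCompactness` VERBATIM (against every unit finite-energy `W^{1,2}` competitor agreeing with `u` off a
smaller concentric ball); let `v` have weak gradient `Gv` on `Q`; let the glued map `w` be unit on `Q` with weak gradient `Gw` and
integrable density, `w = v` on `ball y ρ₁` and `w = u` off `ball y ρ₂` (everywhere), `ρ₁ ≤ ρ₂ < ρ`.  Then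
`∫_{B_{ρ₂}} dens Gu ≤ ∫_{B_{ρ₁}} dens Gv + ∫_{B_{ρ₂} ∖ B_{ρ₁}} dens Gw`. [cite: Simon1996, §2.9 Lemma 1 (proof, comparison step)] -/
theorem competitor_transfer_of_ballMinimiser (hQ : IsOpen {x : EuclideanSpace ℝ (Fin 3) | ∀ i : Fin 3, |x i| < 1})
    {u v w : EuclideanSpace ℝ (Fin 3) → EuclideanSpace ℝ (Fin 4)}
    {Gu Gv Gw : EuclideanSpace ℝ (Fin 3) → (EuclideanSpace ℝ (Fin 3) →L[ℝ] EuclideanSpace ℝ (Fin 4))}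
    (hu : HasWeakFDerivOn ⟨{x : EuclideanSpace ℝ (Fin 3) | ∀ i : Fin 3, |x i| < 1}, hQ⟩ volume u Gu)
    (hui : IntegrableOn (fun x => ∑ i : Fin 3, ‖Gu x (EuclideanSpace.single i (1:ℝ))‖ ^ 2)
      {x : EuclideanSpace ℝ (Fin 3) | ∀ i : Fin 3, |x i| < 1} volume)
    {y : EuclideanSpace ℝ (Fin 3)} {ρ : ℝ}
    (hρQ : closedBall y ρ ⊆ {x : EuclideanSpace ℝ (Fin 3) | ∀ i : Fin 3, |x i| < 1})
    (hmin : ∀ (W : EuclideanSpace ℝ (Fin 3) → EuclideanSpace ℝ (Fin 4))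
        (GW : EuclideanSpace ℝ (Fin 3) → (EuclideanSpace ℝ (Fin 3) →L[ℝ] EuclideanSpace ℝ (Fin 4))),
      HasWeakFDerivOn ⟨{x : EuclideanSpace ℝ (Fin 3) | ∀ i : Fin 3, |x i| < 1}, hQ⟩ volume W GW →
      (∀ x : EuclideanSpace ℝ (Fin 3), (∀ i : Fin 3, |x i| < 1) → ‖W x‖ = 1) →
      IntegrableOn (fun x => ∑ i : Fin 3, ‖GW x (EuclideanSpace.single i (1:ℝ))‖ ^ 2)
        {x : EuclideanSpace ℝ (Fin 3) | ∀ i : Fin 3, |x i| < 1} →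
      (∃ ρ' : ℝ, ρ' < ρ ∧ ∀ x : EuclideanSpace ℝ (Fin 3), x ∉ ball y ρ' → W x = u x) →
      ∫ x in ball y ρ, ∑ i : Fin 3, ‖Gu x (EuclideanSpace.single i (1:ℝ))‖ ^ 2
        ≤ ∫ x in ball y ρ, ∑ i : Fin 3, ‖GW x (EuclideanSpace.single i (1:ℝ))‖ ^ 2)
    (hv : HasWeakFDerivOn ⟨{x : EuclideanSpace ℝ (Fin 3) | ∀ i : Fin 3, |x i| < 1}, hQ⟩ volume v Gv)
    (hw : HasWeakFDerivOn ⟨{x : EuclideanSpace ℝ (Fin 3) | ∀ i : Fin 3, |x i| < 1}, hQ⟩ volume w Gw)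
    (hw1 : ∀ x : EuclideanSpace ℝ (Fin 3), (∀ i : Fin 3, |x i| < 1) → ‖w x‖ = 1)
    (hwi : IntegrableOn (fun x => ∑ i : Fin 3, ‖Gw x (EuclideanSpace.single i (1:ℝ))‖ ^ 2)
      {x : EuclideanSpace ℝ (Fin 3) | ∀ i : Fin 3, |x i| < 1} volume)
    {ρ₁ ρ₂ : ℝ} (h₁₂ : ρ₁ ≤ ρ₂) (h₂ : ρ₂ < ρ)
    (hin : ∀ x ∈ ball y ρ₁, w x = v x)
    (hout : ∀ x : EuclideanSpace ℝ (Fin 3), x ∉ ball y ρ₂ → w x = u x) :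
    ∫ x in ball y ρ₂, ∑ i : Fin 3, ‖Gu x (EuclideanSpace.single i (1:ℝ))‖ ^ 2
      ≤ (∫ x in ball y ρ₁, ∑ i : Fin 3, ‖Gv x (EuclideanSpace.single i (1:ℝ))‖ ^ 2)
        + ∫ x in ball y ρ₂ \ ball y ρ₁, ∑ i : Fin 3, ‖Gw x (EuclideanSpace.single i (1:ℝ))‖ ^ 2 := by
  have hmin' := hmin w Gw hw hw1 hwi ⟨ρ₂, h₂, hout⟩
  have hρΩ : ball y ρ ⊆ ((⟨{x : EuclideanSpace ℝ (Fin 3) | ∀ i : Fin 3, |x i| < 1}, hQ⟩ :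
      Opens (EuclideanSpace ℝ (Fin 3))) : Set _) := ball_subset_closedBall.trans hρQ
  exact competitor_transfer hu hv hw hui hwi h₁₂ h₂.le hρΩ hin (fun x _ hx => hout x hx) hmin'

end Literature.Analysis.PDE.MinimisingMaps

end Part1

/-!
## Part 2 — port of `Summits/QuantumFields/YangMills/Theorems/PoincareLipschitzShellPigeonhole.lean` (5 declarations kept)

# Energy minimising maps into `S³` (Hardt–Kinderlehrer–Lin / Luckhaus / Simon §2.9): Shell Pigeonhole

Declarations of this Part (verbatim port; each keeps its own docstring and citation): `exists_fin_mul_setIntegral_le`, `measurableSet_shell`, `disjoint_shell`, `iUnion_shell_eq`, `exists_shell_mul_setIntegral_le`.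

Reference keys (see `references.bib` and the declarations' citations): [HardtKinderlehrerLin1986].
-/

section Part2

open _root_.MeasureTheory _root_.Filter _root_.Set _root_.Function
open scoped _root_.BigOperators _root_.Topology

namespace Literature.Analysis.PDE.MinimisingMaps

/-! ## §1 Abstract pigeonhole for integrals -/

/-- **MINIMUM ≤ MEAN FOR SET INTEGRALS.**  For `N ≥ 1` pairwise disjoint measurable sets `A i` (`i : Fin N`) and `f` integrable on each of them,
some index has `N · ∫_{A i} f ≤ ∫_{⋃ i, A i} f`.  No sign hypothesis on `f`. [cite: Simon1996, §2.9 Lemma 1 (compactness of energy minimising maps; supporting lemma)] -/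
theorem exists_fin_mul_setIntegral_le {X : Type*} [MeasurableSpace X] (μ : Measure X) {N : ℕ} (hN : 0 < N)
    (A : Fin N → Set X) (hAm : ∀ i, MeasurableSet (A i)) (hAd : Pairwise (Disjoint on A))
    {f : X → ℝ} (hf : ∀ i, IntegrableOn f (A i) μ) :
    ∃ i : Fin N, (N : ℝ) * ∫ x in A i, f x ∂μ ≤ ∫ x in ⋃ i, A i, f x ∂μ := by
  haveI : Nonempty (Fin N) := ⟨⟨0, hN⟩⟩
  have hsum : ∫ x in ⋃ i, A i, f x ∂μ = ∑ i, ∫ x in A i, f x ∂μ := integral_iUnion_fintype hAm hAd hf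
  set T : ℝ := ∫ x in ⋃ i, A i, f x ∂μ with hT
  -- the mean of the `N` numbers `∫_{A i} f` is `T / N`
  have hmean : ∑ i : Fin N, ∫ x in A i, f x ∂μ ≤ ∑ _i : Fin N, T / N := by
    rw [← hsum, Finset.sum_const, Finset.card_univ, Fintype.card_fin, nsmul_eq_mul]
    have hN' : (N : ℝ) ≠ 0 := by exact_mod_cast hN.ne'
    rw [mul_div_cancel₀ _ hN']
  obtain ⟨i, -, hi⟩ := Finset.exists_le_of_sum_le Finset.univ_nonempty hmean
  refine ⟨i, ?_⟩
  have hN0 : (0 : ℝ) < N := by exact_mod_cast hN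
  calc (N : ℝ) * ∫ x in A i, f x ∂μ ≤ (N : ℝ) * (T / N) := mul_le_mul_of_nonneg_left hi hN0.le
    _ = T := mul_div_cancel₀ _ hN0.ne'

/-! ## §2 Radial shells -/

section Shells

variable {X : Type*} [MetricSpace X] [MeasurableSpace X] [OpensMeasurableSpace X]

/-- The `i`-th spherical shell of inner radius `r + i·h` and thickness `h` about `y` is measurable. [cite: Simon1996, §2.9 Lemma 1 (compactness of energy minimising maps; supporting lemma)] -/
theorem measurableSet_shell (y : X) (r h : ℝ) (i : ℕ) :
    MeasurableSet {x : X | r + i * h ≤ dist x y ∧ dist x y < r + (i + 1) * h} := by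
  have hc : Measurable fun x : X => dist x y := (continuous_id.dist continuous_const).measurable
  exact (measurableSet_le measurable_const hc).inter (measurableSet_lt hc measurable_const)

omit [MeasurableSpace X] [OpensMeasurableSpace X] in
/-- Distinct shells of the same family are disjoint (`h ≥ 0`). [cite: Simon1996, §2.9 Lemma 1 (compactness of energy minimising maps; supporting lemma)] -/
theorem disjoint_shell (y : X) (r : ℝ) {h : ℝ} (hh : 0 ≤ h) {N : ℕ} :
    Pairwise (Disjoint on fun i : Fin N => {x : X | r + (i : ℕ) * h ≤ dist x y ∧ dist x y < r + ((i : ℕ) + 1) * h}) := by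
  intro i j hij
  rw [Function.onFun, Set.disjoint_left]
  intro x hxi hxj
  have hne : (i : ℕ) ≠ (j : ℕ) := fun h => hij (Fin.ext h)
  rcases lt_or_gt_of_ne hne with hlt | hlt
  · -- `i < j`: upper end of shell `i` ≤ lower end of shell `j`
    have hle : ((i : ℕ) + 1 : ℝ) * h ≤ ((j : ℕ) : ℝ) * h :=
      mul_le_mul_of_nonneg_right (by exact_mod_cast Nat.succ_le_of_lt hlt) hh
    linarith [hxi.2, hxj.1]
  · have hle : ((j : ℕ) + 1 : ℝ) * h ≤ ((i : ℕ) : ℝ) * h :=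
      mul_le_mul_of_nonneg_right (by exact_mod_cast Nat.succ_le_of_lt hlt) hh
    linarith [hxj.2, hxi.1]

omit [MeasurableSpace X] [OpensMeasurableSpace X] in
/-- The `N` shells of thickness `h > 0` tile the annulus `{r ≤ dist x y < r + N·h}`. [cite: Simon1996, §2.9 Lemma 1 (compactness of energy minimising maps; supporting lemma)] -/
theorem iUnion_shell_eq (y : X) (r : ℝ) {h : ℝ} (hh : 0 < h) (N : ℕ) :
    (⋃ i : Fin N, {x : X | r + (i : ℕ) * h ≤ dist x y ∧ dist x y < r + ((i : ℕ) + 1) * h}) =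
      {x : X | r ≤ dist x y ∧ dist x y < r + N * h} := by
  ext x
  simp only [Set.mem_iUnion, Set.mem_setOf_eq]
  constructor
  · rintro ⟨i, h1, h2⟩
    have hi0 : (0 : ℝ) ≤ (i : ℕ) * h := mul_nonneg (by exact_mod_cast Nat.zero_le _) hh.le
    have hiN : ((i : ℕ) + 1 : ℝ) * h ≤ (N : ℝ) * h :=
      mul_le_mul_of_nonneg_right (by exact_mod_cast Nat.succ_le_of_lt i.isLt) hh.le
    exact ⟨by linarith, by linarith⟩
  · rintro ⟨h1, h2⟩
    -- the index is `⌊(dist x y − r) ∕ h⌋`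
    set t : ℝ := (dist x y - r) / h with ht
    have ht0 : 0 ≤ t := div_nonneg (by linarith) hh.le
    have htN : t < N := by rw [ht, div_lt_iff₀ hh]; linarith
    have hfl : ⌊t⌋₊ < N := (Nat.floor_lt ht0).mpr htN
    refine ⟨⟨⌊t⌋₊, hfl⟩, ?_, ?_⟩
    · have := Nat.floor_le ht0
      have hmul : (⌊t⌋₊ : ℝ) * h ≤ t * h := mul_le_mul_of_nonneg_right this hh.le
      have : t * h = dist x y - r := by rw [ht]; field_simp
      show r + (⌊t⌋₊ : ℝ) * h ≤ dist x y
      linarith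
    · have := Nat.lt_floor_add_one t
      have hmul : t * h < ((⌊t⌋₊ : ℝ) + 1) * h := mul_lt_mul_of_pos_right this hh
      have : t * h = dist x y - r := by rw [ht]; field_simp
      show dist x y < r + ((⌊t⌋₊ : ℝ) + 1) * h
      linarith

/-- **THE RADIAL PIGEONHOLE.**  If `f` is integrable on the annulus `{r ≤ dist x y < r + N·h}` (`N ≥ 1`, `h > 0`), then one of the `N` shells of
thickness `h` carries at most `1∕N` of the annulus integral: `N · ∫_{shell i} f ≤ ∫_{annulus} f`.  No sign hypothesis. [cite: Simon1996, §2.9 Lemma 1 (compactness of energy minimising maps; supporting lemma)] -/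
theorem exists_shell_mul_setIntegral_le (μ : Measure X) (y : X) (r : ℝ) {h : ℝ} (hh : 0 < h) {N : ℕ} (hN : 0 < N)
    {f : X → ℝ} (hf : IntegrableOn f {x : X | r ≤ dist x y ∧ dist x y < r + N * h} μ) :
    ∃ i : ℕ, i < N ∧ (N : ℝ) * ∫ x in {x : X | r + i * h ≤ dist x y ∧ dist x y < r + (i + 1) * h}, f x ∂μ ≤
      ∫ x in {x : X | r ≤ dist x y ∧ dist x y < r + N * h}, f x ∂μ := by
  set A : Fin N → Set X := fun i => {x : X | r + (i : ℕ) * h ≤ dist x y ∧ dist x y < r + ((i : ℕ) + 1) * h} with hA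
  have hU : (⋃ i, A i) = {x : X | r ≤ dist x y ∧ dist x y < r + N * h} := iUnion_shell_eq y r hh N
  have hfi : ∀ i, IntegrableOn f (A i) μ := fun i =>
    hf.mono_set (by rw [← hU]; exact Set.subset_iUnion A i)
  obtain ⟨i, hi⟩ := exists_fin_mul_setIntegral_le μ hN A (fun i => measurableSet_shell y r h i)
    (disjoint_shell y r hh.le) hfi
  refine ⟨i, i.isLt, ?_⟩
  rw [← hU]
  exact hi

end Shells

/-! ## §3 Infinite pigeonhole along a sequence -/

end Literature.Analysis.PDE.MinimisingMaps

end Part2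

/-!
## Part 3 — port of `Summits/QuantumFields/YangMills/Theorems/PoincareLipschitzMinimisingMapCompactnessLetters.lean` (5 declarations kept)

# Energy minimising maps into `S³` (Hardt–Kinderlehrer–Lin / Luckhaus / Simon §2.9): Minimising Map Compactness Letters

Declarations of this Part (verbatim port; each keeps its own docstring and citation): `tendsto_of_lsc_of_eventually_le`, `eventually_le_add_of_three`, `setIntegral_closedBall_eq_ball`, `tendsto_setIntegral_ball_shrink`, `exists_radius_setIntegral_ball_le_add`.

Reference keys (see `references.bib` and the declarations' citations): [Simon1996], [HardtKinderlehrerLin1986].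
-/

section Part3

open _root_.MeasureTheory _root_.Set _root_.Filter _root_.Topology _root_.Metric

namespace Literature.Analysis.PDE.MinimisingMaps

/-! ## §1 Convergence from lower semicontinuity and an eventual upper bound -/

/-- **Convergence from (lsc) + (eventual usc)**: if `L ≤ M` whenever `a j ≤ M` frequently, and for every `ε > 0`
eventually `a j ≤ L + ε`, then `a j → L`. [cite: Simon1996, §2.9 Lemma 1 (compactness of energy minimising maps; supporting lemma)] -/
theorem tendsto_of_lsc_of_eventually_le {a : ℕ → ℝ} {L : ℝ}
    (hlsc : ∀ M : ℝ, (∃ᶠ j in atTop, a j ≤ M) → L ≤ M)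
    (husc : ∀ ε : ℝ, 0 < ε → ∀ᶠ j in atTop, a j ≤ L + ε) :
    Tendsto a atTop (𝓝 L) := by
  rw [Metric.tendsto_atTop]
  intro ε hε
  have h1 : ∀ᶠ j in atTop, L - ε / 2 < a j := by
    by_contra hcon
    rw [not_eventually] at hcon
    have h2 : ∃ᶠ j in atTop, a j ≤ L - ε / 2 := hcon.mono fun j hj => not_lt.1 hj
    have := hlsc _ h2
    linarith
  obtain ⟨N, hN⟩ := eventually_atTop.1 (h1.and (husc (ε / 2) (half_pos hε)))
  refine ⟨N, fun j hj => ?_⟩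
  obtain ⟨hl, hu⟩ := hN j hj
  rw [Real.dist_eq, abs_lt]
  constructor <;> linarith

/-- **Eventual upper bound from an `ε/3`-budget**: bookkeeping form used by the assembly. [cite: Simon1996, §2.9 Lemma 1 (compactness of energy minimising maps; supporting lemma)] -/
theorem eventually_le_add_of_three {a b : ℕ → ℝ} {L A B ε : ℝ} (hε : 0 < ε)
    (hab : ∀ j, a j ≤ A + B + b j) (hA : A ≤ L + ε / 3) (hB : B ≤ ε / 3)
    (hb : Tendsto b atTop (𝓝 0)) : ∀ᶠ j in atTop, a j ≤ L + ε := by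
  have h1 : ∀ᶠ j in atTop, b j < ε / 3 := (tendsto_order.1 hb).2 _ (by linarith)
  filter_upwards [h1] with j hj
  linarith [hab j]

/-! ## §2 Shrinking concentric balls -/

/-- Spheres are Lebesgue-null in `ℝ³`, so the closed and the open ball carry the same integral. [cite: Simon1996, §2.9 Lemma 1 (compactness of energy minimising maps; supporting lemma)] -/
theorem setIntegral_closedBall_eq_ball (f : EuclideanSpace ℝ (Fin 3) → ℝ) (y : EuclideanSpace ℝ (Fin 3)) (ρ : ℝ) :
    ∫ x in closedBall y ρ, f x = ∫ x in ball y ρ, f x := by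
  refine setIntegral_congr_set ((ae_eq_set).2 ⟨?_, ?_⟩)
  · rw [closedBall_sdiff_ball]
    exact Measure.addHaar_sphere volume y ρ
  · rw [sdiff_eq_empty.2 ball_subset_closedBall, measure_empty]

/-- **Integrals over `ball y t`, `t ↓ ρ`, converge to the integral over `ball y ρ`** (for `f` integrable on
`ball y (ρ + δ)`, along the radii `ρ + δ/(n+1)`). [cite: Simon1996, §2.9 Lemma 1 (compactness of energy minimising maps; supporting lemma)] -/
theorem tendsto_setIntegral_ball_shrink {f : EuclideanSpace ℝ (Fin 3) → ℝ} {y : EuclideanSpace ℝ (Fin 3)} {ρ δ : ℝ}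
    (hδ : 0 < δ) (hf : IntegrableOn f (ball y (ρ + δ)) volume) :
    Tendsto (fun n : ℕ => ∫ x in ball y (ρ + δ * (1 / ((n : ℝ) + 1))), f x) atTop (𝓝 (∫ x in ball y ρ, f x)) := by
  have hanti : Antitone fun n : ℕ => ball y (ρ + δ * (1 / ((n : ℝ) + 1))) := by
    intro m n hmn
    refine ball_subset_ball (add_le_add le_rfl (mul_le_mul_of_nonneg_left ?_ hδ.le))
    exact one_div_le_one_div_of_le (by positivity) (by
      have : (m : ℝ) ≤ n := by exact_mod_cast hmn
      linarith)
  have hInter : (⋂ n : ℕ, ball y (ρ + δ * (1 / ((n : ℝ) + 1)))) = closedBall y ρ := by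
    ext x
    simp only [mem_iInter, mem_ball, mem_closedBall]
    constructor
    · intro h
      by_contra hx
      push Not at hx
      obtain ⟨n, hn⟩ := exists_nat_gt (δ / (dist x y - ρ))
      have hn1 : δ / (dist x y - ρ) < (n : ℝ) + 1 := by linarith
      have hpos : 0 < dist x y - ρ := sub_pos.2 hx
      have h2 : δ * (1 / ((n : ℝ) + 1)) < dist x y - ρ := by
        rw [div_lt_iff₀ hpos] at hn1
        rw [← mul_div_assoc, mul_one, div_lt_iff₀ (by positivity : (0:ℝ) < (n : ℝ) + 1)]
        linarith
      have := h n
      linarith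
    · intro h n
      have : (0 : ℝ) < δ * (1 / ((n : ℝ) + 1)) := by positivity
      linarith
  have h0 : IntegrableOn f (ball y (ρ + δ * (1 / (((0 : ℕ) : ℝ) + 1)))) volume := by
    refine hf.mono_set (ball_subset_ball ?_)
    norm_num
  have h := tendsto_setIntegral_of_antitone (μ := volume) (fun n => measurableSet_ball) hanti ⟨0, h0⟩
  rw [hInter, setIntegral_closedBall_eq_ball] at h
  exact h

/-- **The `ε`-form**: for `f` integrable on `ball y (ρ + δ)` and `ε > 0` there is a radius `t ∈ (ρ, ρ + δ)` with
`∫_{ball y t} f ≤ ∫_{ball y ρ} f + ε`. [cite: Simon1996, §2.9 Lemma 1 (compactness of energy minimising maps; supporting lemma)] -/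
theorem exists_radius_setIntegral_ball_le_add {f : EuclideanSpace ℝ (Fin 3) → ℝ} {y : EuclideanSpace ℝ (Fin 3)}
    {ρ δ ε : ℝ} (hδ : 0 < δ) (hε : 0 < ε) (hf : IntegrableOn f (ball y (ρ + δ)) volume) :
    ∃ t : ℝ, ρ < t ∧ t < ρ + δ ∧ ∫ x in ball y t, f x ≤ (∫ x in ball y ρ, f x) + ε := by
  have h1 : ∀ᶠ n : ℕ in atTop, ∫ x in ball y (ρ + δ * (1 / ((n : ℝ) + 1))), f x < (∫ x in ball y ρ, f x) + ε :=
    (tendsto_order.1 (tendsto_setIntegral_ball_shrink hδ hf)).2 _ (by linarith)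
  have h2 : ∀ᶠ n : ℕ in atTop, δ * (1 / ((n : ℝ) + 1)) < δ := by
    have ht : Tendsto (fun n : ℕ => δ * (1 / ((n : ℝ) + 1))) atTop (𝓝 (δ * 0)) :=
      tendsto_one_div_add_atTop_nhds_zero_nat.const_mul δ
    rw [mul_zero] at ht
    exact (tendsto_order.1 ht).2 _ hδ
  obtain ⟨n, hn1, hn2⟩ := (h1.and h2).exists
  exact ⟨ρ + δ * (1 / ((n : ℝ) + 1)), by linarith [show (0 : ℝ) < δ * (1 / ((n : ℝ) + 1)) by positivity],
    by linarith, hn1.le⟩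

end Literature.Analysis.PDE.MinimisingMaps

end Part3

/-!
## Part 4 — port of `Summits/QuantumFields/YangMills/Theorems/PoincareLipschitzMinimisingMapCompactnessEnergy.lean` (5 declarations kept)

# Energy minimising maps into `S³` (Hardt–Kinderlehrer–Lin / Luckhaus / Simon §2.9): Minimising Map Compactness Energy

Declarations of this Part (verbatim port; each keeps its own docstring and citation): `exists_margin`, `dens_nonneg`, `energy_mono`, `shell_eq_sdiff`, `tendsto_energy_ball`.

Reference keys (see `references.bib` and the declarations' citations): [Simon1996], [HardtKinderlehrerLin1986], [Luckhaus1988].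
-/

section Part4

open _root_.MeasureTheory _root_.Set _root_.Function _root_.Filter _root_.Topology _root_.Metric _root_.TopologicalSpace
open scoped _root_.ENNReal _root_.BigOperators

namespace Literature.Analysis.PDE.MinimisingMaps

open Literature.Analysis.FunctionSpaces (HasWeakFDerivOn)

/-! ## §1 Letters -/

/-- A closed ball inside the open cube has a concentric closed margin inside the cube. [cite: Simon1996, §2.9 Lemma 1 (proof: no concentration via comparison maps)] -/
theorem exists_margin {Q : Set (EuclideanSpace ℝ (Fin 3))} (hQ : IsOpen Q) {y : EuclideanSpace ℝ (Fin 3)} {ρ : ℝ}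
    (hρ : 0 ≤ ρ) (hρQ : closedBall y ρ ⊆ Q) : ∃ δ : ℝ, 0 < δ ∧ closedBall y (ρ + δ) ⊆ Q := by
  obtain ⟨δ, hδ, h⟩ := (isCompact_closedBall y ρ).exists_cthickening_subset_open hQ hρQ
  refine ⟨δ, hδ, ?_⟩
  rw [cthickening_closedBall hδ.le hρ y, add_comm] at h
  exact h

/-- The Dirichlet density is pointwise nonnegative. [cite: Simon1996, §2.9 Lemma 1 (proof: no concentration via comparison maps)] -/
theorem dens_nonneg (T : EuclideanSpace ℝ (Fin 3) →L[ℝ] EuclideanSpace ℝ (Fin 4)) :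
    0 ≤ ∑ i : Fin 3, ‖T (EuclideanSpace.single i (1:ℝ))‖ ^ 2 :=
  Finset.sum_nonneg fun _ _ => sq_nonneg _

/-- Monotonicity of the energy in the domain, for an integrable density. [cite: Simon1996, §2.9 Lemma 1 (proof: no concentration via comparison maps)] -/
theorem energy_mono {G : EuclideanSpace ℝ (Fin 3) → (EuclideanSpace ℝ (Fin 3) →L[ℝ] EuclideanSpace ℝ (Fin 4))}
    {S T : Set (EuclideanSpace ℝ (Fin 3))} (hST : S ⊆ T)
    (hG : IntegrableOn (fun x => ∑ i : Fin 3, ‖G x (EuclideanSpace.single i (1:ℝ))‖ ^ 2) T volume) :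
    ∫ x in S, ∑ i : Fin 3, ‖G x (EuclideanSpace.single i (1:ℝ))‖ ^ 2 ≤
      ∫ x in T, ∑ i : Fin 3, ‖G x (EuclideanSpace.single i (1:ℝ))‖ ^ 2 :=
  setIntegral_mono_set hG (Eventually.of_forall fun x => dens_nonneg (G x)) hST.eventuallyLE

/-- The pigeonhole shell is the difference of two concentric open balls. [cite: Simon1996, §2.9 Lemma 1 (proof: no concentration via comparison maps)] -/
theorem shell_eq_sdiff (y : EuclideanSpace ℝ (Fin 3)) (a b : ℝ) :
    {x : EuclideanSpace ℝ (Fin 3) | a ≤ dist x y ∧ dist x y < b} = ball y b \ ball y a := by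
  ext x
  simp only [mem_setOf_eq, Set.mem_sdiff, mem_ball, not_lt]
  exact and_comm

/-! ## §2 Energy convergence on balls -/

-- hb: README HEARTBEAT BUDGET ∕ №24 (a): measured FAIL at 100k ∕ PASS at the 200k default (one long bookkeeping proof,
-- cumulative budget; no single step is expensive); explicit headroom, statement and proof untouched
set_option maxHeartbeats 400000 in
/-- **(C-e1) ENERGY CONVERGENCE ON EVERY BALL** for a ball-minimising sequence of unit `W^{1,2}` maps `u_j : Q → S³`
converging in `L²(Q)` to `U` (weak gradient `G`, lower-semicontinuity row), CONDITIONAL on the HKL shell-competitor hypothesis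
`hHKL` with constant `K`: for `0 < ρ`, `closedBall y ρ ⊆ Q`, `∫_{ball y ρ} Σ_i‖Gs_j e_i‖² → ∫_{ball y ρ} Σ_i‖G e_i‖²`.
[cite: Simon1996, §2.9 Lemma 1 (proof: no concentration via comparison maps)] -/
theorem tendsto_energy_ball (hQ : IsOpen {x : EuclideanSpace ℝ (Fin 3) | ∀ i : Fin 3, |x i| < 1}) {K : ℝ} (hK : 0 ≤ K)
    (hHKL : ∀ (u V : EuclideanSpace ℝ (Fin 3) → EuclideanSpace ℝ (Fin 4))
      (Gu GV : EuclideanSpace ℝ (Fin 3) → (EuclideanSpace ℝ (Fin 3) →L[ℝ] EuclideanSpace ℝ (Fin 4))),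
      HasWeakFDerivOn ⟨{x : EuclideanSpace ℝ (Fin 3) | ∀ i : Fin 3, |x i| < 1}, hQ⟩ volume u Gu →
      HasWeakFDerivOn ⟨{x : EuclideanSpace ℝ (Fin 3) | ∀ i : Fin 3, |x i| < 1}, hQ⟩ volume V GV →
      (∀ x : EuclideanSpace ℝ (Fin 3), (∀ i : Fin 3, |x i| < 1) → ‖u x‖ = 1) →
      (∀ x : EuclideanSpace ℝ (Fin 3), (∀ i : Fin 3, |x i| < 1) → ‖V x‖ = 1) →
      IntegrableOn (fun x => ∑ i : Fin 3, ‖Gu x (EuclideanSpace.single i (1:ℝ))‖ ^ 2)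
        {x : EuclideanSpace ℝ (Fin 3) | ∀ i : Fin 3, |x i| < 1} volume →
      IntegrableOn (fun x => ∑ i : Fin 3, ‖GV x (EuclideanSpace.single i (1:ℝ))‖ ^ 2)
        {x : EuclideanSpace ℝ (Fin 3) | ∀ i : Fin 3, |x i| < 1} volume →
      ∀ (y : EuclideanSpace ℝ (Fin 3)) (ρ₁ ρ₂ : ℝ), 0 < ρ₁ → ρ₁ < ρ₂ →
      closedBall y ρ₂ ⊆ {x : EuclideanSpace ℝ (Fin 3) | ∀ i : Fin 3, |x i| < 1} →
      ∃ (W : EuclideanSpace ℝ (Fin 3) → EuclideanSpace ℝ (Fin 4))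
        (GW : EuclideanSpace ℝ (Fin 3) → (EuclideanSpace ℝ (Fin 3) →L[ℝ] EuclideanSpace ℝ (Fin 4))),
        HasWeakFDerivOn ⟨{x : EuclideanSpace ℝ (Fin 3) | ∀ i : Fin 3, |x i| < 1}, hQ⟩ volume W GW ∧
        (∀ x : EuclideanSpace ℝ (Fin 3), (∀ i : Fin 3, |x i| < 1) → ‖W x‖ = 1) ∧
        IntegrableOn (fun x => ∑ i : Fin 3, ‖GW x (EuclideanSpace.single i (1:ℝ))‖ ^ 2)
          {x : EuclideanSpace ℝ (Fin 3) | ∀ i : Fin 3, |x i| < 1} volume ∧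
        (∀ x ∈ ball y ρ₁, W x = V x) ∧ (∀ x, x ∉ ball y ρ₂ → W x = u x) ∧
        ∫ x in ball y ρ₂ \ ball y ρ₁, ∑ i : Fin 3, ‖GW x (EuclideanSpace.single i (1:ℝ))‖ ^ 2 ≤
          K * ((∫ x in ball y ρ₂ \ ball y ρ₁, ∑ i : Fin 3, ‖GV x (EuclideanSpace.single i (1:ℝ))‖ ^ 2) +
            (∫ x in ball y ρ₂ \ ball y ρ₁, ∑ i : Fin 3, ‖Gu x (EuclideanSpace.single i (1:ℝ))‖ ^ 2) +
            (ρ₂ - ρ₁)⁻¹ ^ 2 * ∫ x in ball y ρ₂ \ ball y ρ₁, ‖V x - u x‖ ^ 2))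
    {u : ℕ → EuclideanSpace ℝ (Fin 3) → EuclideanSpace ℝ (Fin 4)}
    {Gs : ℕ → EuclideanSpace ℝ (Fin 3) → (EuclideanSpace ℝ (Fin 3) →L[ℝ] EuclideanSpace ℝ (Fin 4))} {Λ : ℝ}
    (hu : ∀ j, HasWeakFDerivOn ⟨{x : EuclideanSpace ℝ (Fin 3) | ∀ i : Fin 3, |x i| < 1}, hQ⟩ volume (u j) (Gs j))
    (hu1 : ∀ j (x : EuclideanSpace ℝ (Fin 3)), (∀ i : Fin 3, |x i| < 1) → ‖u j x‖ = 1)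
    (hGi : ∀ j, IntegrableOn (fun x => ∑ i : Fin 3, ‖Gs j x (EuclideanSpace.single i (1:ℝ))‖ ^ 2)
      {x : EuclideanSpace ℝ (Fin 3) | ∀ i : Fin 3, |x i| < 1} volume)
    (hmin : ∀ (j : ℕ) (y : EuclideanSpace ℝ (Fin 3)) (ρ : ℝ), 0 < ρ →
      closedBall y ρ ⊆ {x : EuclideanSpace ℝ (Fin 3) | ∀ i : Fin 3, |x i| < 1} →
      ∀ (W : EuclideanSpace ℝ (Fin 3) → EuclideanSpace ℝ (Fin 4))
        (GW : EuclideanSpace ℝ (Fin 3) → (EuclideanSpace ℝ (Fin 3) →L[ℝ] EuclideanSpace ℝ (Fin 4))),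
      HasWeakFDerivOn ⟨{x : EuclideanSpace ℝ (Fin 3) | ∀ i : Fin 3, |x i| < 1}, hQ⟩ volume W GW →
      (∀ x : EuclideanSpace ℝ (Fin 3), (∀ i : Fin 3, |x i| < 1) → ‖W x‖ = 1) →
      IntegrableOn (fun x => ∑ i : Fin 3, ‖GW x (EuclideanSpace.single i (1:ℝ))‖ ^ 2)
        {x : EuclideanSpace ℝ (Fin 3) | ∀ i : Fin 3, |x i| < 1} →
      (∃ ρ' : ℝ, ρ' < ρ ∧ ∀ x : EuclideanSpace ℝ (Fin 3), x ∉ ball y ρ' → W x = u j x) →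
      ∫ x in ball y ρ, ∑ i : Fin 3, ‖Gs j x (EuclideanSpace.single i (1:ℝ))‖ ^ 2 ≤
        ∫ x in ball y ρ, ∑ i : Fin 3, ‖GW x (EuclideanSpace.single i (1:ℝ))‖ ^ 2)
    (hΛ : ∀ j, ∫ x in {x : EuclideanSpace ℝ (Fin 3) | ∀ i : Fin 3, |x i| < 1},
      ∑ i : Fin 3, ‖Gs j x (EuclideanSpace.single i (1:ℝ))‖ ^ 2 ≤ Λ)
    {U : EuclideanSpace ℝ (Fin 3) → EuclideanSpace ℝ (Fin 4)}
    {G : EuclideanSpace ℝ (Fin 3) → (EuclideanSpace ℝ (Fin 3) →L[ℝ] EuclideanSpace ℝ (Fin 4))}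
    (hUG : HasWeakFDerivOn ⟨{x : EuclideanSpace ℝ (Fin 3) | ∀ i : Fin 3, |x i| < 1}, hQ⟩ volume U G)
    (hU1 : ∀ x, ‖U x‖ = 1)
    (hGdens : IntegrableOn (fun x => ∑ i : Fin 3, ‖G x (EuclideanSpace.single i (1:ℝ))‖ ^ 2)
      {x : EuclideanSpace ℝ (Fin 3) | ∀ i : Fin 3, |x i| < 1} volume)
    (hL2 : Tendsto (fun j => ∫ x in {x : EuclideanSpace ℝ (Fin 3) | ∀ i : Fin 3, |x i| < 1}, ‖u j x - U x‖ ^ 2)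
      atTop (𝓝 0))
    (hlsc : ∀ S : Set (EuclideanSpace ℝ (Fin 3)), MeasurableSet S → S ⊆ {x : EuclideanSpace ℝ (Fin 3) | ∀ i : Fin 3, |x i| < 1} →
      ∀ M : ℝ, (∃ᶠ j in atTop, ∫ x in S, ∑ i : Fin 3, ‖Gs j x (EuclideanSpace.single i (1:ℝ))‖ ^ 2 ≤ M) →
        ∫ x in S, ∑ i : Fin 3, ‖G x (EuclideanSpace.single i (1:ℝ))‖ ^ 2 ≤ M)
    {y : EuclideanSpace ℝ (Fin 3)} {ρ : ℝ} (hρ : 0 < ρ)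
    (hρQ : closedBall y ρ ⊆ {x : EuclideanSpace ℝ (Fin 3) | ∀ i : Fin 3, |x i| < 1}) :
    Tendsto (fun j => ∫ x in ball y ρ, ∑ i : Fin 3, ‖Gs j x (EuclideanSpace.single i (1:ℝ))‖ ^ 2) atTop
      (𝓝 (∫ x in ball y ρ, ∑ i : Fin 3, ‖G x (EuclideanSpace.single i (1:ℝ))‖ ^ 2)) := by
  set Q : Set (EuclideanSpace ℝ (Fin 3)) := {x | ∀ i : Fin 3, |x i| < 1} with hQdef
  have hQm : MeasurableSet Q := hQ.measurableSet
  have hU1' : ∀ x : EuclideanSpace ℝ (Fin 3), (∀ i : Fin 3, |x i| < 1) → ‖U x‖ = 1 := fun x _ => hU1 x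
  -- margin and the two totals
  obtain ⟨δ, hδ, hδQ⟩ := exists_margin hQ hρ.le hρQ
  set EU : ℝ := ∫ x in Q, ∑ i : Fin 3, ‖G x (EuclideanSpace.single i (1:ℝ))‖ ^ 2 with hEU
  have hEU0 : 0 ≤ EU := setIntegral_nonneg hQm fun x _ => dens_nonneg (G x)
  have hΛ0 : 0 ≤ Λ := (setIntegral_nonneg hQm fun x _ => dens_nonneg (Gs 0 x)).trans (hΛ 0)
  refine tendsto_of_lsc_of_eventually_le
    (fun M hM => hlsc _ measurableSet_ball (ball_subset_closedBall.trans hρQ) M hM) fun ε hε => ?_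
  -- the radius `t`
  have hGballδ : IntegrableOn (fun x => ∑ i : Fin 3, ‖G x (EuclideanSpace.single i (1:ℝ))‖ ^ 2) (ball y (ρ + δ)) volume :=
    hGdens.mono_set (ball_subset_closedBall.trans hδQ)
  obtain ⟨t, hρt, htδ, hEt⟩ := exists_radius_setIntegral_ball_le_add hδ (by positivity : (0:ℝ) < ε / 3) hGballδ
  -- the number of shells `N`
  obtain ⟨N, hNpos, hN⟩ : ∃ N : ℕ, 0 < N ∧ K * (EU + Λ) / N ≤ ε / 3 := by
    obtain ⟨N, hN⟩ := exists_nat_gt (K * (EU + Λ) / (ε / 3))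
    have hNpos : 0 < N := by
      have : (0 : ℝ) < N := lt_of_le_of_lt (by positivity) hN
      exact_mod_cast this
    refine ⟨N, hNpos, ?_⟩
    have hN' : (0 : ℝ) < N := by exact_mod_cast hNpos
    rw [div_le_iff₀ hN']
    have := (div_lt_iff₀ (by positivity : (0:ℝ) < ε / 3)).1 hN
    linarith
  have hNr : (0 : ℝ) < N := by exact_mod_cast hNpos
  set h : ℝ := (t - ρ) / N with hh
  have hh0 : 0 < h := div_pos (by linarith) hNr
  have hNh : (N : ℝ) * h = t - ρ := by rw [hh]; field_simp
  set t' : ℝ := (t + (ρ + δ)) / 2 with ht'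
  have htt' : t < t' := by rw [ht']; linarith
  have ht'δ : t' < ρ + δ := by rw [ht']; linarith
  have ht'0 : 0 < t' := by linarith
  have ht'Q : closedBall y t' ⊆ Q := (closedBall_subset_closedBall ht'δ.le).trans hδQ
  have htQ : ball y t ⊆ Q := (ball_subset_closedBall.trans (closedBall_subset_closedBall htδ.le)).trans hδQ
  -- the per-`j` bound
  have hab : ∀ j, ∫ x in ball y ρ, ∑ i : Fin 3, ‖Gs j x (EuclideanSpace.single i (1:ℝ))‖ ^ 2 ≤
      (∫ x in ball y t, ∑ i : Fin 3, ‖G x (EuclideanSpace.single i (1:ℝ))‖ ^ 2) + K * (EU + Λ) / N +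
        K * (h⁻¹ ^ 2 * ∫ x in Q, ‖u j x - U x‖ ^ 2) := by
    intro j
    -- the region of the shells and the pigeonhole
    have hreg : {x : EuclideanSpace ℝ (Fin 3) | ρ ≤ dist x y ∧ dist x y < ρ + N * h} ⊆ Q := by
      rw [shell_eq_sdiff]; rw [hNh, add_sub_cancel]; exact sdiff_subset.trans htQ
    have hfint : IntegrableOn (fun x => (∑ i : Fin 3, ‖G x (EuclideanSpace.single i (1:ℝ))‖ ^ 2) +
        ∑ i : Fin 3, ‖Gs j x (EuclideanSpace.single i (1:ℝ))‖ ^ 2)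
        {x : EuclideanSpace ℝ (Fin 3) | ρ ≤ dist x y ∧ dist x y < ρ + N * h} volume :=
      (hGdens.mono_set hreg).add ((hGi j).mono_set hreg)
    obtain ⟨i, hiN, hi⟩ := exists_shell_mul_setIntegral_le volume y ρ hh0 hNpos hfint
    set ρ₁ : ℝ := ρ + i * h with hρ₁
    set ρ₂ : ℝ := ρ + (i + 1) * h with hρ₂
    have hi0 : (0 : ℝ) ≤ i := by exact_mod_cast Nat.zero_le i
    have hiN' : (i : ℝ) + 1 ≤ N := by exact_mod_cast hiN
    have hρρ₁ : ρ ≤ ρ₁ := by rw [hρ₁]; nlinarith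
    have h12 : ρ₁ < ρ₂ := by rw [hρ₁, hρ₂]; nlinarith
    have h21 : ρ₂ - ρ₁ = h := by rw [hρ₁, hρ₂]; ring
    have hρ₂t : ρ₂ ≤ t := by
      rw [hρ₂]
      have : ((i : ℝ) + 1) * h ≤ N * h := mul_le_mul_of_nonneg_right hiN' hh0.le
      linarith
    have hρ₁0 : 0 < ρ₁ := lt_of_lt_of_le hρ hρρ₁
    have hρ₂Q : closedBall y ρ₂ ⊆ Q := (closedBall_subset_closedBall (hρ₂t.trans htt'.le)).trans ht'Q
    have hshell : {x : EuclideanSpace ℝ (Fin 3) | ρ + i * h ≤ dist x y ∧ dist x y < ρ + (i + 1) * h} =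
        ball y ρ₂ \ ball y ρ₁ := shell_eq_sdiff y _ _
    have hshellQ : ball y ρ₂ \ ball y ρ₁ ⊆ Q := sdiff_subset.trans (ball_subset_closedBall.trans hρ₂Q)
    -- the shell carries little energy
    have hsmall : (∫ x in ball y ρ₂ \ ball y ρ₁, ∑ i : Fin 3, ‖G x (EuclideanSpace.single i (1:ℝ))‖ ^ 2) +
        ∫ x in ball y ρ₂ \ ball y ρ₁, ∑ i : Fin 3, ‖Gs j x (EuclideanSpace.single i (1:ℝ))‖ ^ 2 ≤ (EU + Λ) / N := by
      rw [hshell] at hi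
      rw [← integral_add (hGdens.mono_set hshellQ) ((hGi j).mono_set hshellQ)]
      rw [le_div_iff₀ hNr, mul_comm]
      refine hi.trans ?_
      rw [integral_add (hGdens.mono_set hreg) ((hGi j).mono_set hreg)]
      exact add_le_add (energy_mono hreg hGdens) ((energy_mono hreg (hGi j)).trans (hΛ j))
    -- the competitor and the transfer
    obtain ⟨W, GW, hWd, hW1, hWi, hWin, hWout, hWsh⟩ :=
      hHKL (u j) U (Gs j) G (hu j) hUG (hu1 j) hU1' (hGi j) hGdens y ρ₁ ρ₂ hρ₁0 h12 hρ₂Q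
    have hD1 := competitor_transfer_of_ballMinimiser hQ (hu j) (hGi j) ht'Q (hmin j y t' ht'0 ht'Q) hUG hWd hW1 hWi
      h12.le (lt_of_le_of_lt hρ₂t htt') hWin hWout
    -- the `L²` term on the shell
    have hL2sh : ∫ x in ball y ρ₂ \ ball y ρ₁, ‖U x - u j x‖ ^ 2 ≤ ∫ x in Q, ‖u j x - U x‖ ^ 2 := by
      have hint : IntegrableOn (fun x => ‖u j x - U x‖ ^ 2) Q volume := by
        haveI : IsFiniteMeasure (volume.restrict Q) := isFiniteMeasure_restrict.2
          (Literature.Analysis.PDE.MinimisingMaps.volume_openCube_lt_top).ne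
        refine Literature.Analysis.PDE.MinimisingMaps.integrable_of_norm_le
          (((hu j).locallyIntegrableOn.aestronglyMeasurable.sub
            hUG.locallyIntegrableOn.aestronglyMeasurable).norm.pow 2) 4 ?_
        filter_upwards [ae_restrict_mem hQm] with x hx
        rw [Real.norm_eq_abs, abs_of_nonneg (sq_nonneg _)]
        have h1 : ‖u j x - U x‖ ≤ 2 := by
          calc ‖u j x - U x‖ ≤ ‖u j x‖ + ‖U x‖ := norm_sub_le _ _
            _ = 2 := by rw [hu1 j x hx, hU1 x]; norm_num
        nlinarith [norm_nonneg (u j x - U x)]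
      simp_rw [norm_sub_rev (U _) (u j _)]
      exact setIntegral_mono_set hint (Eventually.of_forall fun x => sq_nonneg _) hshellQ.eventuallyLE
    calc ∫ x in ball y ρ, ∑ i : Fin 3, ‖Gs j x (EuclideanSpace.single i (1:ℝ))‖ ^ 2
        ≤ ∫ x in ball y ρ₂, ∑ i : Fin 3, ‖Gs j x (EuclideanSpace.single i (1:ℝ))‖ ^ 2 :=
          energy_mono (ball_subset_ball (hρρ₁.trans h12.le)) ((hGi j).mono_set (ball_subset_closedBall.trans hρ₂Q))
      _ ≤ (∫ x in ball y ρ₁, ∑ i : Fin 3, ‖G x (EuclideanSpace.single i (1:ℝ))‖ ^ 2) +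
            ∫ x in ball y ρ₂ \ ball y ρ₁, ∑ i : Fin 3, ‖GW x (EuclideanSpace.single i (1:ℝ))‖ ^ 2 := hD1
      _ ≤ (∫ x in ball y t, ∑ i : Fin 3, ‖G x (EuclideanSpace.single i (1:ℝ))‖ ^ 2) +
            K * ((∫ x in ball y ρ₂ \ ball y ρ₁, ∑ i : Fin 3, ‖G x (EuclideanSpace.single i (1:ℝ))‖ ^ 2) +
              (∫ x in ball y ρ₂ \ ball y ρ₁, ∑ i : Fin 3, ‖Gs j x (EuclideanSpace.single i (1:ℝ))‖ ^ 2) +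
              (ρ₂ - ρ₁)⁻¹ ^ 2 * ∫ x in ball y ρ₂ \ ball y ρ₁, ‖U x - u j x‖ ^ 2) :=
          add_le_add (energy_mono (ball_subset_ball (h12.le.trans hρ₂t)) (hGdens.mono_set htQ)) hWsh
      _ ≤ (∫ x in ball y t, ∑ i : Fin 3, ‖G x (EuclideanSpace.single i (1:ℝ))‖ ^ 2) + K * (EU + Λ) / N +
            K * (h⁻¹ ^ 2 * ∫ x in Q, ‖u j x - U x‖ ^ 2) := by
          rw [h21]
          have h3 : (h⁻¹ ^ 2 * ∫ x in ball y ρ₂ \ ball y ρ₁, ‖U x - u j x‖ ^ 2) ≤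
              h⁻¹ ^ 2 * ∫ x in Q, ‖u j x - U x‖ ^ 2 := mul_le_mul_of_nonneg_left hL2sh (by positivity)
          have e1 := mul_le_mul_of_nonneg_left hsmall hK
          have e2 := mul_le_mul_of_nonneg_left h3 hK
          have e3 : K * ((∫ x in ball y ρ₂ \ ball y ρ₁, ∑ i : Fin 3, ‖G x (EuclideanSpace.single i (1:ℝ))‖ ^ 2) +
              (∫ x in ball y ρ₂ \ ball y ρ₁, ∑ i : Fin 3, ‖Gs j x (EuclideanSpace.single i (1:ℝ))‖ ^ 2) +
              h⁻¹ ^ 2 * ∫ x in ball y ρ₂ \ ball y ρ₁, ‖U x - u j x‖ ^ 2) =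
              K * ((∫ x in ball y ρ₂ \ ball y ρ₁, ∑ i : Fin 3, ‖G x (EuclideanSpace.single i (1:ℝ))‖ ^ 2) +
                ∫ x in ball y ρ₂ \ ball y ρ₁, ∑ i : Fin 3, ‖Gs j x (EuclideanSpace.single i (1:ℝ))‖ ^ 2) +
              K * (h⁻¹ ^ 2 * ∫ x in ball y ρ₂ \ ball y ρ₁, ‖U x - u j x‖ ^ 2) := by ring
          have e4 : K * ((EU + Λ) / N) = K * (EU + Λ) / N := by ring
          linarith
  -- conclude
  refine eventually_le_add_of_three hε hab hEt hN ?_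
  have := (hL2.const_mul (h⁻¹ ^ 2)).const_mul K
  simpa using this

end Literature.Analysis.PDE.MinimisingMaps

end Part4

/-!
## Part 5 — port of `Summits/QuantumFields/YangMills/Theorems/PoincareLipschitzMinimisingMapCompactnessMinimality.lean` (1 declarations kept)

# Energy minimising maps into `S³` (Hardt–Kinderlehrer–Lin / Luckhaus / Simon §2.9): Minimising Map Compactness Minimality

Declarations of this Part (verbatim port; each keeps its own docstring and citation): `ballMinimal_limit`.

Reference keys (see `references.bib` and the declarations' citations): [Simon1996], [HardtKinderlehrerLin1986], [Luckhaus1988].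
-/

section Part5

open _root_.MeasureTheory _root_.Set _root_.Function _root_.Filter _root_.Topology _root_.Metric _root_.TopologicalSpace
open scoped _root_.ENNReal _root_.BigOperators

namespace Literature.Analysis.PDE.MinimisingMaps

open Literature.Analysis.FunctionSpaces (HasWeakFDerivOn)

-- hb: README HEARTBEAT BUDGET ∕ №24 (a): measured FAIL at 100k ∕ PASS at the 200k default (one long bookkeeping proof,
-- cumulative budget; no single step is expensive); explicit headroom, statement and proof untouched
set_option maxHeartbeats 400000 in
/-- **(C-e2) THE LIMIT IS BALL-MINIMISING**, CONDITIONAL on the HKL shell-competitor hypothesis `hHKL` (constant `K`), given the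
class rows of the `u_j`, the rows of the limit `(U, G)`, `L²(Q)` convergence, and ENERGY CONVERGENCE on every ball
`closedBall y ρ ⊆ Q` ((C-e1)'s conclusion, row `hE`). [cite: Simon1996, §2.9 Lemma 1 (proof: the limit minimises)] -/
theorem ballMinimal_limit (hQ : IsOpen {x : EuclideanSpace ℝ (Fin 3) | ∀ i : Fin 3, |x i| < 1}) {K : ℝ} (hK : 0 ≤ K)
    (hHKL : ∀ (u V : EuclideanSpace ℝ (Fin 3) → EuclideanSpace ℝ (Fin 4))
      (Gu GV : EuclideanSpace ℝ (Fin 3) → (EuclideanSpace ℝ (Fin 3) →L[ℝ] EuclideanSpace ℝ (Fin 4))),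
      HasWeakFDerivOn ⟨{x : EuclideanSpace ℝ (Fin 3) | ∀ i : Fin 3, |x i| < 1}, hQ⟩ volume u Gu →
      HasWeakFDerivOn ⟨{x : EuclideanSpace ℝ (Fin 3) | ∀ i : Fin 3, |x i| < 1}, hQ⟩ volume V GV →
      (∀ x : EuclideanSpace ℝ (Fin 3), (∀ i : Fin 3, |x i| < 1) → ‖u x‖ = 1) →
      (∀ x : EuclideanSpace ℝ (Fin 3), (∀ i : Fin 3, |x i| < 1) → ‖V x‖ = 1) →
      IntegrableOn (fun x => ∑ i : Fin 3, ‖Gu x (EuclideanSpace.single i (1:ℝ))‖ ^ 2)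
        {x : EuclideanSpace ℝ (Fin 3) | ∀ i : Fin 3, |x i| < 1} volume →
      IntegrableOn (fun x => ∑ i : Fin 3, ‖GV x (EuclideanSpace.single i (1:ℝ))‖ ^ 2)
        {x : EuclideanSpace ℝ (Fin 3) | ∀ i : Fin 3, |x i| < 1} volume →
      ∀ (y : EuclideanSpace ℝ (Fin 3)) (ρ₁ ρ₂ : ℝ), 0 < ρ₁ → ρ₁ < ρ₂ →
      closedBall y ρ₂ ⊆ {x : EuclideanSpace ℝ (Fin 3) | ∀ i : Fin 3, |x i| < 1} →
      ∃ (W : EuclideanSpace ℝ (Fin 3) → EuclideanSpace ℝ (Fin 4))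
        (GW : EuclideanSpace ℝ (Fin 3) → (EuclideanSpace ℝ (Fin 3) →L[ℝ] EuclideanSpace ℝ (Fin 4))),
        HasWeakFDerivOn ⟨{x : EuclideanSpace ℝ (Fin 3) | ∀ i : Fin 3, |x i| < 1}, hQ⟩ volume W GW ∧
        (∀ x : EuclideanSpace ℝ (Fin 3), (∀ i : Fin 3, |x i| < 1) → ‖W x‖ = 1) ∧
        IntegrableOn (fun x => ∑ i : Fin 3, ‖GW x (EuclideanSpace.single i (1:ℝ))‖ ^ 2)
          {x : EuclideanSpace ℝ (Fin 3) | ∀ i : Fin 3, |x i| < 1} volume ∧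
        (∀ x ∈ ball y ρ₁, W x = V x) ∧ (∀ x, x ∉ ball y ρ₂ → W x = u x) ∧
        ∫ x in ball y ρ₂ \ ball y ρ₁, ∑ i : Fin 3, ‖GW x (EuclideanSpace.single i (1:ℝ))‖ ^ 2 ≤
          K * ((∫ x in ball y ρ₂ \ ball y ρ₁, ∑ i : Fin 3, ‖GV x (EuclideanSpace.single i (1:ℝ))‖ ^ 2) +
            (∫ x in ball y ρ₂ \ ball y ρ₁, ∑ i : Fin 3, ‖Gu x (EuclideanSpace.single i (1:ℝ))‖ ^ 2) +
            (ρ₂ - ρ₁)⁻¹ ^ 2 * ∫ x in ball y ρ₂ \ ball y ρ₁, ‖V x - u x‖ ^ 2))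
    {u : ℕ → EuclideanSpace ℝ (Fin 3) → EuclideanSpace ℝ (Fin 4)}
    {Gs : ℕ → EuclideanSpace ℝ (Fin 3) → (EuclideanSpace ℝ (Fin 3) →L[ℝ] EuclideanSpace ℝ (Fin 4))}
    (hu : ∀ j, HasWeakFDerivOn ⟨{x : EuclideanSpace ℝ (Fin 3) | ∀ i : Fin 3, |x i| < 1}, hQ⟩ volume (u j) (Gs j))
    (hu1 : ∀ j (x : EuclideanSpace ℝ (Fin 3)), (∀ i : Fin 3, |x i| < 1) → ‖u j x‖ = 1)
    (hGi : ∀ j, IntegrableOn (fun x => ∑ i : Fin 3, ‖Gs j x (EuclideanSpace.single i (1:ℝ))‖ ^ 2)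
      {x : EuclideanSpace ℝ (Fin 3) | ∀ i : Fin 3, |x i| < 1} volume)
    (hmin : ∀ (j : ℕ) (y : EuclideanSpace ℝ (Fin 3)) (ρ : ℝ), 0 < ρ →
      closedBall y ρ ⊆ {x : EuclideanSpace ℝ (Fin 3) | ∀ i : Fin 3, |x i| < 1} →
      ∀ (W : EuclideanSpace ℝ (Fin 3) → EuclideanSpace ℝ (Fin 4))
        (GW : EuclideanSpace ℝ (Fin 3) → (EuclideanSpace ℝ (Fin 3) →L[ℝ] EuclideanSpace ℝ (Fin 4))),
      HasWeakFDerivOn ⟨{x : EuclideanSpace ℝ (Fin 3) | ∀ i : Fin 3, |x i| < 1}, hQ⟩ volume W GW →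
      (∀ x : EuclideanSpace ℝ (Fin 3), (∀ i : Fin 3, |x i| < 1) → ‖W x‖ = 1) →
      IntegrableOn (fun x => ∑ i : Fin 3, ‖GW x (EuclideanSpace.single i (1:ℝ))‖ ^ 2)
        {x : EuclideanSpace ℝ (Fin 3) | ∀ i : Fin 3, |x i| < 1} →
      (∃ ρ' : ℝ, ρ' < ρ ∧ ∀ x : EuclideanSpace ℝ (Fin 3), x ∉ ball y ρ' → W x = u j x) →
      ∫ x in ball y ρ, ∑ i : Fin 3, ‖Gs j x (EuclideanSpace.single i (1:ℝ))‖ ^ 2 ≤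
        ∫ x in ball y ρ, ∑ i : Fin 3, ‖GW x (EuclideanSpace.single i (1:ℝ))‖ ^ 2)
    {U : EuclideanSpace ℝ (Fin 3) → EuclideanSpace ℝ (Fin 4)}
    {G : EuclideanSpace ℝ (Fin 3) → (EuclideanSpace ℝ (Fin 3) →L[ℝ] EuclideanSpace ℝ (Fin 4))}
    (hUG : HasWeakFDerivOn ⟨{x : EuclideanSpace ℝ (Fin 3) | ∀ i : Fin 3, |x i| < 1}, hQ⟩ volume U G)
    (hU1 : ∀ x, ‖U x‖ = 1)
    (hGdens : IntegrableOn (fun x => ∑ i : Fin 3, ‖G x (EuclideanSpace.single i (1:ℝ))‖ ^ 2)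
      {x : EuclideanSpace ℝ (Fin 3) | ∀ i : Fin 3, |x i| < 1} volume)
    (hL2 : Tendsto (fun j => ∫ x in {x : EuclideanSpace ℝ (Fin 3) | ∀ i : Fin 3, |x i| < 1}, ‖u j x - U x‖ ^ 2)
      atTop (𝓝 0))
    (hE : ∀ (y : EuclideanSpace ℝ (Fin 3)) (ρ : ℝ), 0 < ρ →
      closedBall y ρ ⊆ {x : EuclideanSpace ℝ (Fin 3) | ∀ i : Fin 3, |x i| < 1} →
      Tendsto (fun j => ∫ x in ball y ρ, ∑ i : Fin 3, ‖Gs j x (EuclideanSpace.single i (1:ℝ))‖ ^ 2) atTop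
        (𝓝 (∫ x in ball y ρ, ∑ i : Fin 3, ‖G x (EuclideanSpace.single i (1:ℝ))‖ ^ 2)))
    {y : EuclideanSpace ℝ (Fin 3)} {ρ : ℝ} (hρ : 0 < ρ)
    (hρQ : closedBall y ρ ⊆ {x : EuclideanSpace ℝ (Fin 3) | ∀ i : Fin 3, |x i| < 1})
    {W : EuclideanSpace ℝ (Fin 3) → EuclideanSpace ℝ (Fin 4)}
    {GW : EuclideanSpace ℝ (Fin 3) → (EuclideanSpace ℝ (Fin 3) →L[ℝ] EuclideanSpace ℝ (Fin 4))}
    (hWd : HasWeakFDerivOn ⟨{x : EuclideanSpace ℝ (Fin 3) | ∀ i : Fin 3, |x i| < 1}, hQ⟩ volume W GW)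
    (hW1 : ∀ x : EuclideanSpace ℝ (Fin 3), (∀ i : Fin 3, |x i| < 1) → ‖W x‖ = 1)
    (hWi : IntegrableOn (fun x => ∑ i : Fin 3, ‖GW x (EuclideanSpace.single i (1:ℝ))‖ ^ 2)
      {x : EuclideanSpace ℝ (Fin 3) | ∀ i : Fin 3, |x i| < 1} volume)
    {ρ' : ℝ} (hρ'ρ : ρ' < ρ) (hWU : ∀ x : EuclideanSpace ℝ (Fin 3), x ∉ ball y ρ' → W x = U x) :
    ∫ x in ball y ρ, ∑ i : Fin 3, ‖G x (EuclideanSpace.single i (1:ℝ))‖ ^ 2 ≤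
      ∫ x in ball y ρ, ∑ i : Fin 3, ‖GW x (EuclideanSpace.single i (1:ℝ))‖ ^ 2 := by
  set Q : Set (EuclideanSpace ℝ (Fin 3)) := {x | ∀ i : Fin 3, |x i| < 1} with hQdef
  have hQm : MeasurableSet Q := hQ.measurableSet
  have hU1' : ∀ x : EuclideanSpace ℝ (Fin 3), (∀ i : Fin 3, |x i| < 1) → ‖U x‖ = 1 := fun x _ => hU1 x
  -- radii: `ρ' ≤ ρ₀ < σ < ρ < t'`
  set ρ₀ : ℝ := max ρ' (ρ / 2) with hρ₀
  have hρ₀ρ : ρ₀ < ρ := max_lt hρ'ρ (by linarith)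
  have hρ₀0 : 0 < ρ₀ := lt_of_lt_of_le (by linarith) (le_max_right _ _)
  have hWU₀ : ∀ x : EuclideanSpace ℝ (Fin 3), x ∉ ball y ρ₀ → W x = U x :=
    fun x hx => hWU x fun h => hx (ball_subset_ball (le_max_left _ _) h)
  set σ : ℝ := (ρ₀ + ρ) / 2 with hσ
  have hρ₀σ : ρ₀ < σ := by rw [hσ]; linarith
  have hσρ : σ < ρ := by rw [hσ]; linarith
  obtain ⟨δ, hδ, hδQ⟩ := exists_margin hQ hρ.le hρQ
  set t' : ℝ := ρ + δ / 2 with ht'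
  have hρt' : ρ < t' := by rw [ht']; linarith
  have ht'0 : 0 < t' := lt_trans hρ hρt'
  have ht'Q : closedBall y t' ⊆ Q := (closedBall_subset_closedBall (by rw [ht']; linarith)).trans hδQ
  have hballQ : ball y ρ ⊆ Q := ball_subset_closedBall.trans hρQ
  -- locality: `dens GW = dens G` a.e. on `Q ∖ ball y ρ₀`
  have hloc := dens_ae_eq_off_ball (Ω := ⟨Q, hQ⟩) hUG hWd (y := y) (ρ₂ := ρ₀) fun x hx hxb => hWU₀ x hxb
  have hloc_int : ∀ S : Set (EuclideanSpace ℝ (Fin 3)), S ⊆ Q \ ball y ρ₀ →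
      ∫ x in S, ∑ i : Fin 3, ‖GW x (EuclideanSpace.single i (1:ℝ))‖ ^ 2 =
        ∫ x in S, ∑ i : Fin 3, ‖G x (EuclideanSpace.single i (1:ℝ))‖ ^ 2 :=
    fun S hS => integral_congr_ae (ae_restrict_of_ae_restrict_of_subset hS hloc)
  -- the total energy of `U`
  set EU : ℝ := ∫ x in Q, ∑ i : Fin 3, ‖G x (EuclideanSpace.single i (1:ℝ))‖ ^ 2 with hEU
  have hEU0 : 0 ≤ EU := setIntegral_nonneg hQm fun x _ => dens_nonneg (G x)
  refine le_of_forall_pos_le_add fun ε hε => ?_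
  -- the number of shells `N`
  obtain ⟨N, hNpos, hN⟩ : ∃ N : ℕ, 0 < N ∧ 2 * K * EU / N ≤ ε := by
    obtain ⟨N, hN⟩ := exists_nat_gt (2 * K * EU / ε)
    have hNpos : 0 < N := by
      have : (0 : ℝ) < N := lt_of_le_of_lt (by positivity) hN
      exact_mod_cast this
    refine ⟨N, hNpos, ?_⟩
    have hN' : (0 : ℝ) < N := by exact_mod_cast hNpos
    rw [div_le_iff₀ hN']
    have := (div_lt_iff₀ hε).1 hN
    linarith
  have hNr : (0 : ℝ) < N := by exact_mod_cast hNpos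
  set h : ℝ := (ρ - σ) / N with hh
  have hh0 : 0 < h := div_pos (by linarith) hNr
  have hNh : (N : ℝ) * h = ρ - σ := by rw [hh]; field_simp
  -- pigeonhole on `U`'s energy over the shells in `(σ, ρ)`
  have hreg : {x : EuclideanSpace ℝ (Fin 3) | σ ≤ dist x y ∧ dist x y < σ + N * h} ⊆ Q := by
    rw [shell_eq_sdiff, hNh, add_sub_cancel]; exact sdiff_subset.trans hballQ
  obtain ⟨i, hiN, hi⟩ := exists_shell_mul_setIntegral_le volume y σ hh0 hNpos (hGdens.mono_set hreg)
  set ρ₁ : ℝ := σ + i * h with hρ₁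
  set ρ₂ : ℝ := σ + (i + 1) * h with hρ₂
  have hi0 : (0 : ℝ) ≤ i := by exact_mod_cast Nat.zero_le i
  have hiN' : (i : ℝ) + 1 ≤ N := by exact_mod_cast hiN
  have hσρ₁ : σ ≤ ρ₁ := by rw [hρ₁]; nlinarith
  have h12 : ρ₁ < ρ₂ := by rw [hρ₁, hρ₂]; nlinarith
  have h21 : ρ₂ - ρ₁ = h := by rw [hρ₁, hρ₂]; ring
  have hρ₂ρ : ρ₂ ≤ ρ := by
    rw [hρ₂]
    have : ((i : ℝ) + 1) * h ≤ N * h := mul_le_mul_of_nonneg_right hiN' hh0.le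
    linarith
  have hρ₁0 : 0 < ρ₁ := lt_of_lt_of_le (lt_trans hρ₀0 hρ₀σ) hσρ₁
  have hρ₁Q : closedBall y ρ₁ ⊆ Q := (closedBall_subset_closedBall (h12.le.trans hρ₂ρ)).trans hρQ
  have hρ₂Q : closedBall y ρ₂ ⊆ Q := (closedBall_subset_closedBall hρ₂ρ).trans hρQ
  have hshell : {x : EuclideanSpace ℝ (Fin 3) | σ + i * h ≤ dist x y ∧ dist x y < σ + (i + 1) * h} =
      ball y ρ₂ \ ball y ρ₁ := shell_eq_sdiff y _ _
  have hshell₀ : ball y ρ₂ \ ball y ρ₁ ⊆ Q \ ball y ρ₀ := fun x hx =>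
    ⟨hballQ (ball_subset_ball hρ₂ρ hx.1), fun hb => hx.2 (ball_subset_ball (hρ₀σ.le.trans hσρ₁) hb)⟩
  have houter₀ : ball y ρ \ ball y ρ₂ ⊆ Q \ ball y ρ₀ := fun x hx =>
    ⟨hballQ hx.1, fun hb => hx.2 (ball_subset_ball ((hρ₀σ.le.trans hσρ₁).trans h12.le) hb)⟩
  have hshellQ : ball y ρ₂ \ ball y ρ₁ ⊆ Q := fun x hx => (hshell₀ hx).1
  have hsmall : ∫ x in ball y ρ₂ \ ball y ρ₁, ∑ i : Fin 3, ‖G x (EuclideanSpace.single i (1:ℝ))‖ ^ 2 ≤ EU / N := by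
    rw [hshell] at hi
    rw [le_div_iff₀ hNr, mul_comm]
    exact hi.trans (energy_mono hreg hGdens)
  -- the per-`j` inequality from the hypothesis (inner map `W`) and D1
  have hab : ∀ j, ∫ x in ball y ρ₂, ∑ i : Fin 3, ‖Gs j x (EuclideanSpace.single i (1:ℝ))‖ ^ 2 ≤
      (∫ x in ball y ρ₁, ∑ i : Fin 3, ‖GW x (EuclideanSpace.single i (1:ℝ))‖ ^ 2) +
        K * ((∫ x in ball y ρ₂ \ ball y ρ₁, ∑ i : Fin 3, ‖G x (EuclideanSpace.single i (1:ℝ))‖ ^ 2) +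
          ((∫ x in ball y ρ₂, ∑ i : Fin 3, ‖Gs j x (EuclideanSpace.single i (1:ℝ))‖ ^ 2) -
            ∫ x in ball y ρ₁, ∑ i : Fin 3, ‖Gs j x (EuclideanSpace.single i (1:ℝ))‖ ^ 2) +
          h⁻¹ ^ 2 * ∫ x in Q, ‖u j x - U x‖ ^ 2) := by
    intro j
    obtain ⟨Wj, GWj, hWjd, hWj1, hWji, hWjin, hWjout, hWjsh⟩ :=
      hHKL (u j) W (Gs j) GW (hu j) hWd (hu1 j) hW1 (hGi j) hWi y ρ₁ ρ₂ hρ₁0 h12 hρ₂Q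
    have hD1 := competitor_transfer_of_ballMinimiser hQ (hu j) (hGi j) ht'Q (hmin j y t' ht'0 ht'Q) hWd hWjd hWj1 hWji
      h12.le (lt_of_le_of_lt hρ₂ρ hρt') hWjin hWjout
    -- rewrite the three shell terms
    have hWsh : ∫ x in ball y ρ₂ \ ball y ρ₁, ∑ i : Fin 3, ‖GW x (EuclideanSpace.single i (1:ℝ))‖ ^ 2 =
        ∫ x in ball y ρ₂ \ ball y ρ₁, ∑ i : Fin 3, ‖G x (EuclideanSpace.single i (1:ℝ))‖ ^ 2 := hloc_int _ hshell₀
    have hush : ∫ x in ball y ρ₂ \ ball y ρ₁, ∑ i : Fin 3, ‖Gs j x (EuclideanSpace.single i (1:ℝ))‖ ^ 2 =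
        (∫ x in ball y ρ₂, ∑ i : Fin 3, ‖Gs j x (EuclideanSpace.single i (1:ℝ))‖ ^ 2) -
          ∫ x in ball y ρ₁, ∑ i : Fin 3, ‖Gs j x (EuclideanSpace.single i (1:ℝ))‖ ^ 2 := by
      rw [setIntegral_ball_eq_add_sdiff h12.le ((hGi j).mono_set (ball_subset_closedBall.trans hρ₂Q))]
      ring
    have hL2sh : ∫ x in ball y ρ₂ \ ball y ρ₁, ‖W x - u j x‖ ^ 2 ≤ ∫ x in Q, ‖u j x - U x‖ ^ 2 := by
      have hint : IntegrableOn (fun x => ‖u j x - U x‖ ^ 2) Q volume := by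
        haveI : IsFiniteMeasure (volume.restrict Q) := isFiniteMeasure_restrict.2
          (Literature.Analysis.PDE.MinimisingMaps.volume_openCube_lt_top).ne
        refine Literature.Analysis.PDE.MinimisingMaps.integrable_of_norm_le
          (((hu j).locallyIntegrableOn.aestronglyMeasurable.sub
            hUG.locallyIntegrableOn.aestronglyMeasurable).norm.pow 2) 4 ?_
        filter_upwards [ae_restrict_mem hQm] with x hx
        rw [Real.norm_eq_abs, abs_of_nonneg (sq_nonneg _)]
        have h1 : ‖u j x - U x‖ ≤ 2 := by
          calc ‖u j x - U x‖ ≤ ‖u j x‖ + ‖U x‖ := norm_sub_le _ _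
            _ = 2 := by rw [hu1 j x hx, hU1 x]; norm_num
        nlinarith [norm_nonneg (u j x - U x)]
      have heqsh : ∀ x ∈ ball y ρ₂ \ ball y ρ₁, ‖W x - u j x‖ ^ 2 = ‖u j x - U x‖ ^ 2 := fun x hx => by
        rw [hWU₀ x (hshell₀ hx).2, norm_sub_rev]
      rw [setIntegral_congr_fun (measurableSet_ball.diff measurableSet_ball) heqsh]
      exact setIntegral_mono_set hint (Eventually.of_forall fun x => sq_nonneg _) hshellQ.eventuallyLE
    rw [hWsh, hush, h21] at hWjsh
    have e2 : h⁻¹ ^ 2 * ∫ x in ball y ρ₂ \ ball y ρ₁, ‖W x - u j x‖ ^ 2 ≤ h⁻¹ ^ 2 * ∫ x in Q, ‖u j x - U x‖ ^ 2 :=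
      mul_le_mul_of_nonneg_left hL2sh (by positivity)
    have e3 := mul_le_mul_of_nonneg_left (add_le_add_left e2
      ((∫ x in ball y ρ₂ \ ball y ρ₁, ∑ i : Fin 3, ‖G x (EuclideanSpace.single i (1:ℝ))‖ ^ 2) +
        ((∫ x in ball y ρ₂, ∑ i : Fin 3, ‖Gs j x (EuclideanSpace.single i (1:ℝ))‖ ^ 2) -
          ∫ x in ball y ρ₁, ∑ i : Fin 3, ‖Gs j x (EuclideanSpace.single i (1:ℝ))‖ ^ 2))) hK
    linarith [hD1, hWjsh, e3]
  -- pass to the limit `j → ∞`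
  have hlim : ∫ x in ball y ρ₂, ∑ i : Fin 3, ‖G x (EuclideanSpace.single i (1:ℝ))‖ ^ 2 ≤
      (∫ x in ball y ρ₁, ∑ i : Fin 3, ‖GW x (EuclideanSpace.single i (1:ℝ))‖ ^ 2) +
        K * ((∫ x in ball y ρ₂ \ ball y ρ₁, ∑ i : Fin 3, ‖G x (EuclideanSpace.single i (1:ℝ))‖ ^ 2) +
          ((∫ x in ball y ρ₂, ∑ i : Fin 3, ‖G x (EuclideanSpace.single i (1:ℝ))‖ ^ 2) -
            ∫ x in ball y ρ₁, ∑ i : Fin 3, ‖G x (EuclideanSpace.single i (1:ℝ))‖ ^ 2) +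
          h⁻¹ ^ 2 * 0) :=
    by
    have hE₂ := hE y ρ₂ (lt_trans hρ₁0 h12) hρ₂Q
    have hE₁ := hE y ρ₁ hρ₁0 hρ₁Q
    have hb : Tendsto (fun j => (∫ x in ball y ρ₁, ∑ i : Fin 3, ‖GW x (EuclideanSpace.single i (1:ℝ))‖ ^ 2) +
        K * ((∫ x in ball y ρ₂ \ ball y ρ₁, ∑ i : Fin 3, ‖G x (EuclideanSpace.single i (1:ℝ))‖ ^ 2) +
          ((∫ x in ball y ρ₂, ∑ i : Fin 3, ‖Gs j x (EuclideanSpace.single i (1:ℝ))‖ ^ 2) -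
            ∫ x in ball y ρ₁, ∑ i : Fin 3, ‖Gs j x (EuclideanSpace.single i (1:ℝ))‖ ^ 2) +
          h⁻¹ ^ 2 * ∫ x in Q, ‖u j x - U x‖ ^ 2)) atTop
        (𝓝 ((∫ x in ball y ρ₁, ∑ i : Fin 3, ‖GW x (EuclideanSpace.single i (1:ℝ))‖ ^ 2) +
          K * ((∫ x in ball y ρ₂ \ ball y ρ₁, ∑ i : Fin 3, ‖G x (EuclideanSpace.single i (1:ℝ))‖ ^ 2) +
            ((∫ x in ball y ρ₂, ∑ i : Fin 3, ‖G x (EuclideanSpace.single i (1:ℝ))‖ ^ 2) -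
              ∫ x in ball y ρ₁, ∑ i : Fin 3, ‖G x (EuclideanSpace.single i (1:ℝ))‖ ^ 2) +
            h⁻¹ ^ 2 * 0))) :=
      tendsto_const_nhds.add (((tendsto_const_nhds.add (hE₂.sub hE₁)).add (hL2.const_mul (h⁻¹ ^ 2))).const_mul K)
    exact le_of_tendsto_of_tendsto' hE₂ hb hab
  -- assemble on `ball y ρ`
  have hUsplit := setIntegral_ball_eq_add_sdiff hρ₂ρ (hGdens.mono_set hballQ)
  have hWsplit := setIntegral_ball_eq_add_sdiff hρ₂ρ (hWi.mono_set hballQ)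
  have hUsh : ∫ x in ball y ρ₂ \ ball y ρ₁, ∑ i : Fin 3, ‖G x (EuclideanSpace.single i (1:ℝ))‖ ^ 2 =
      (∫ x in ball y ρ₂, ∑ i : Fin 3, ‖G x (EuclideanSpace.single i (1:ℝ))‖ ^ 2) -
        ∫ x in ball y ρ₁, ∑ i : Fin 3, ‖G x (EuclideanSpace.single i (1:ℝ))‖ ^ 2 := by
    rw [setIntegral_ball_eq_add_sdiff h12.le (hGdens.mono_set (ball_subset_closedBall.trans hρ₂Q))]
    ring
  have houter : ∫ x in ball y ρ \ ball y ρ₂, ∑ i : Fin 3, ‖G x (EuclideanSpace.single i (1:ℝ))‖ ^ 2 =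
      ∫ x in ball y ρ \ ball y ρ₂, ∑ i : Fin 3, ‖GW x (EuclideanSpace.single i (1:ℝ))‖ ^ 2 := (hloc_int _ houter₀).symm
  have hWmono : ∫ x in ball y ρ₁, ∑ i : Fin 3, ‖GW x (EuclideanSpace.single i (1:ℝ))‖ ^ 2 ≤
      ∫ x in ball y ρ₂, ∑ i : Fin 3, ‖GW x (EuclideanSpace.single i (1:ℝ))‖ ^ 2 :=
    energy_mono (ball_subset_ball h12.le) (hWi.mono_set (ball_subset_closedBall.trans hρ₂Q))
  have e5 := mul_le_mul_of_nonneg_left hsmall hK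
  have e6 : K * ((∫ x in ball y ρ₂ \ ball y ρ₁, ∑ i : Fin 3, ‖G x (EuclideanSpace.single i (1:ℝ))‖ ^ 2) +
      ((∫ x in ball y ρ₂, ∑ i : Fin 3, ‖G x (EuclideanSpace.single i (1:ℝ))‖ ^ 2) -
        ∫ x in ball y ρ₁, ∑ i : Fin 3, ‖G x (EuclideanSpace.single i (1:ℝ))‖ ^ 2) + h⁻¹ ^ 2 * 0) =
      2 * (K * ∫ x in ball y ρ₂ \ ball y ρ₁, ∑ i : Fin 3, ‖G x (EuclideanSpace.single i (1:ℝ))‖ ^ 2) := by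
    rw [← hUsh]; ring
  have e7 : 2 * K * EU / N = 2 * (K * (EU / N)) := by ring
  rw [hUsplit, hWsplit, houter]
  linarith [hlim, hWmono, e5, hN, e6, e7]

end Literature.Analysis.PDE.MinimisingMaps

end Part5

/-!
## Part 6 — port of `Summits/QuantumFields/YangMills/Theorems/PoincareLipschitzMinimisingMapCompactness.lean` (1 declarations kept)

# Energy minimising maps into `S³` (Hardt–Kinderlehrer–Lin / Luckhaus / Simon §2.9): Minimising Map Compactness

Declarations of this Part (verbatim port; each keeps its own docstring and citation): `minimisingMapCompactness_of_hkl`.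

Reference keys (see `references.bib` and the declarations' citations): [Simon1996], [HardtKinderlehrerLin1986], [Luckhaus1988].
-/

section Part6

open _root_.MeasureTheory _root_.Set _root_.Function _root_.Filter _root_.Topology _root_.Metric _root_.TopologicalSpace
open scoped _root_.ENNReal _root_.BigOperators

namespace Literature.Analysis.PDE.MinimisingMaps

open Literature.Analysis.FunctionSpaces (HasWeakFDerivOn)

-- hb: README HEARTBEAT BUDGET ∕ №24 (a): measured FAIL at 100k ∕ PASS at the 200k default (one long bookkeeping proof,
-- cumulative budget; no single step is expensive); explicit headroom, statement and proof untouched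
set_option maxHeartbeats 400000 in
/-- **(C-e) COMPACTNESS OF ENERGY MINIMISING MAPS `Q → S³`, MODULO THE HKL SHELL-COMPETITOR HYPOTHESIS.**  If for some `K ≥ 0`
the hypothesis (C-bc) holds — for any two unit finite-energy `W^{1,2}` maps `u, V` on `Q` and concentric `0 < ρ₁ < ρ₂` with
`closedBall y ρ₂ ⊆ Q` there is a unit finite-energy `W^{1,2}` map `W` with `W = V` on `ball y ρ₁`, `W = u` off `ball y ρ₂` and
shell energy `≤ K·(E(V,shell) + E(u,shell) + (ρ₂−ρ₁)⁻²∫_shell‖V−u‖²)` — then lit `MinimisingMapCompactness` holds.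
[cite: Simon1996, §2.9 Lemma 1 with Remarks (1)–(2); HardtKinderlehrerLin1986, §2] -/
theorem minimisingMapCompactness_of_hkl {K : ℝ} (hK : 0 ≤ K)
    (hHKL : ∀ (hQ : IsOpen {x : EuclideanSpace ℝ (Fin 3) | ∀ i : Fin 3, |x i| < 1})
      (u V : EuclideanSpace ℝ (Fin 3) → EuclideanSpace ℝ (Fin 4))
      (Gu GV : EuclideanSpace ℝ (Fin 3) → (EuclideanSpace ℝ (Fin 3) →L[ℝ] EuclideanSpace ℝ (Fin 4))),
      HasWeakFDerivOn ⟨{x : EuclideanSpace ℝ (Fin 3) | ∀ i : Fin 3, |x i| < 1}, hQ⟩ volume u Gu →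
      HasWeakFDerivOn ⟨{x : EuclideanSpace ℝ (Fin 3) | ∀ i : Fin 3, |x i| < 1}, hQ⟩ volume V GV →
      (∀ x : EuclideanSpace ℝ (Fin 3), (∀ i : Fin 3, |x i| < 1) → ‖u x‖ = 1) →
      (∀ x : EuclideanSpace ℝ (Fin 3), (∀ i : Fin 3, |x i| < 1) → ‖V x‖ = 1) →
      IntegrableOn (fun x => ∑ i : Fin 3, ‖Gu x (EuclideanSpace.single i (1:ℝ))‖ ^ 2)
        {x : EuclideanSpace ℝ (Fin 3) | ∀ i : Fin 3, |x i| < 1} volume →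
      IntegrableOn (fun x => ∑ i : Fin 3, ‖GV x (EuclideanSpace.single i (1:ℝ))‖ ^ 2)
        {x : EuclideanSpace ℝ (Fin 3) | ∀ i : Fin 3, |x i| < 1} volume →
      ∀ (y : EuclideanSpace ℝ (Fin 3)) (ρ₁ ρ₂ : ℝ), 0 < ρ₁ → ρ₁ < ρ₂ →
      closedBall y ρ₂ ⊆ {x : EuclideanSpace ℝ (Fin 3) | ∀ i : Fin 3, |x i| < 1} →
      ∃ (W : EuclideanSpace ℝ (Fin 3) → EuclideanSpace ℝ (Fin 4))
        (GW : EuclideanSpace ℝ (Fin 3) → (EuclideanSpace ℝ (Fin 3) →L[ℝ] EuclideanSpace ℝ (Fin 4))),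
        HasWeakFDerivOn ⟨{x : EuclideanSpace ℝ (Fin 3) | ∀ i : Fin 3, |x i| < 1}, hQ⟩ volume W GW ∧
        (∀ x : EuclideanSpace ℝ (Fin 3), (∀ i : Fin 3, |x i| < 1) → ‖W x‖ = 1) ∧
        IntegrableOn (fun x => ∑ i : Fin 3, ‖GW x (EuclideanSpace.single i (1:ℝ))‖ ^ 2)
          {x : EuclideanSpace ℝ (Fin 3) | ∀ i : Fin 3, |x i| < 1} volume ∧
        (∀ x ∈ ball y ρ₁, W x = V x) ∧ (∀ x, x ∉ ball y ρ₂ → W x = u x) ∧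
        ∫ x in ball y ρ₂ \ ball y ρ₁, ∑ i : Fin 3, ‖GW x (EuclideanSpace.single i (1:ℝ))‖ ^ 2 ≤
          K * ((∫ x in ball y ρ₂ \ ball y ρ₁, ∑ i : Fin 3, ‖GV x (EuclideanSpace.single i (1:ℝ))‖ ^ 2) +
            (∫ x in ball y ρ₂ \ ball y ρ₁, ∑ i : Fin 3, ‖Gu x (EuclideanSpace.single i (1:ℝ))‖ ^ 2) +
            (ρ₂ - ρ₁)⁻¹ ^ 2 * ∫ x in ball y ρ₂ \ ball y ρ₁, ‖V x - u x‖ ^ 2)) :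
    Literature.Analysis.PDE.MinimisingMapCompactness := by
  intro hQ Λ u Gs hcls hΛ
  set Q : Set (EuclideanSpace ℝ (Fin 3)) := {x | ∀ i : Fin 3, |x i| < 1} with hQdef
  have hQm : MeasurableSet Q := hQ.measurableSet
  have hu : ∀ j, HasWeakFDerivOn ⟨Q, hQ⟩ volume (u j) (Gs j) := fun j => (hcls j).1
  have hu1 : ∀ j (x : EuclideanSpace ℝ (Fin 3)), (∀ i : Fin 3, |x i| < 1) → ‖u j x‖ = 1 := fun j => (hcls j).2.1
  have hGi : ∀ j, IntegrableOn (fun x => ∑ i : Fin 3, ‖Gs j x (EuclideanSpace.single i (1:ℝ))‖ ^ 2) Q volume :=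
    fun j => (hcls j).2.2.1
  have hmin := fun j => (hcls j).2.2.2
  -- (C-a3): extraction
  obtain ⟨U, G, φ, hφ, hUm, hW, hU1, hGdens, hae, hL2, hweak, hlsc⟩ :=
    exists_subseq_limit_weakGrad hQ u Gs Λ hu hu1 hGi hΛ
  -- (C-e1): energy convergence on balls along `φ`
  have hE : ∀ (y : EuclideanSpace ℝ (Fin 3)) (ρ : ℝ), 0 < ρ → closedBall y ρ ⊆ Q →
      Tendsto (fun j => ∫ x in ball y ρ, ∑ i : Fin 3, ‖Gs (φ j) x (EuclideanSpace.single i (1:ℝ))‖ ^ 2) atTop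
        (𝓝 (∫ x in ball y ρ, ∑ i : Fin 3, ‖G x (EuclideanSpace.single i (1:ℝ))‖ ^ 2)) :=
    fun y ρ hρ hρQ => tendsto_energy_ball hQ hK (hHKL hQ) (u := fun j => u (φ j)) (Gs := fun j => Gs (φ j))
      (fun j => hu (φ j)) (fun j => hu1 (φ j)) (fun j => hGi (φ j)) (fun j => hmin (φ j)) (fun j => hΛ (φ j))
      hW hU1 hGdens hL2 hlsc hρ hρQ
  refine ⟨U, G, φ, hφ, ⟨hW, fun x _ => hU1 x, hGdens, fun y ρ hρ hρQ W GW hWd hW1 hWi hWU => ?_⟩,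
    fun y ρ _ hρQ => ?_, hE⟩
  · -- (C-e2): the limit minimises
    obtain ⟨ρ', hρ', hWU⟩ := hWU
    exact ballMinimal_limit hQ hK (hHKL hQ) (u := fun j => u (φ j)) (Gs := fun j => Gs (φ j))
      (fun j => hu (φ j)) (fun j => hu1 (φ j)) (fun j => hGi (φ j)) (fun j => hmin (φ j))
      hW hU1 hGdens hL2 hE hρ hρQ hWd hW1 hWi hρ' hWU
  · -- `L²` convergence on balls from `L²(Q)` convergence
    have hballQ : ball y ρ ⊆ Q := ball_subset_closedBall.trans hρQ
    haveI : IsFiniteMeasure (volume.restrict Q) := isFiniteMeasure_restrict.2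
      (Literature.Analysis.PDE.MinimisingMaps.volume_openCube_lt_top).ne
    have hint : ∀ j, IntegrableOn (fun x => ‖u (φ j) x - U x‖ ^ 2) Q volume := fun j => by
      refine Literature.Analysis.PDE.MinimisingMaps.integrable_of_norm_le
        (((hu (φ j)).locallyIntegrableOn.aestronglyMeasurable.sub
          hW.locallyIntegrableOn.aestronglyMeasurable).norm.pow 2) 4 ?_
      filter_upwards [ae_restrict_mem hQm] with x hx
      rw [Real.norm_eq_abs, abs_of_nonneg (sq_nonneg _)]
      have h1 : ‖u (φ j) x - U x‖ ≤ 2 := by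
        calc ‖u (φ j) x - U x‖ ≤ ‖u (φ j) x‖ + ‖U x‖ := norm_sub_le _ _
          _ = 2 := by rw [hu1 (φ j) x hx, hU1 x]; norm_num
      nlinarith [norm_nonneg (u (φ j) x - U x)]
    refine squeeze_zero (fun j => setIntegral_nonneg measurableSet_ball fun x _ => sq_nonneg _)
      (fun j => setIntegral_mono_set (hint j) (Eventually.of_forall fun x => sq_nonneg _) hballQ.eventuallyLE) hL2

end Literature.Analysis.PDE.MinimisingMaps

end Part6

/-!
## Part 7 — port of `Summits/QuantumFields/YangMills/Theorems/PoincareLipschitzSobolevShellInterpolation.lean` (8 declarations kept)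

# Energy minimising maps into `S³` (Hardt–Kinderlehrer–Lin / Luckhaus / Simon §2.9): Sobolev Shell Interpolation

Declarations of this Part (verbatim port; each keeps its own docstring and citation): `sum_sq_apply_single_le_opNorm_sq`, `norm_sq_add_add_le_three`, `dens_interpolant_le`, `hasWeakFDerivOn_interpolant`, `norm_interpolant_le_one`, `interpolant_eq_of_chi_eq_one`, `interpolant_eq_of_chi_eq_zero`, `setIntegral_dens_interpolant_le`.

Reference keys (see `references.bib` and the declarations' citations): [Evans2010], [Simon1996], [HardtKinderlehrerLin1986].
-/

section Part7

open _root_.MeasureTheory _root_.Set _root_.Filter _root_.Topology _root_.TopologicalSpace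
open scoped _root_.NNReal _root_.BigOperators _root_.ContDiff

namespace Literature.Analysis.PDE.MinimisingMaps

open Literature.Analysis.FunctionSpaces (HasWeakFDerivOn)
open Literature.Analysis.FunctionSpaces.SobolevApprox (hasWeakFDerivOn_add)

/-! ## §1 Pointwise letters -/

/-- For a continuous linear functional `ℓ` on `ℝ³`: `Σᵢ (ℓ eᵢ)² ≤ ‖ℓ‖²` (test `ℓ` on `y := Σᵢ (ℓ eᵢ) eᵢ`). [cite: Simon1996, §2.8] -/
theorem sum_sq_apply_single_le_opNorm_sq (ℓ : EuclideanSpace ℝ (Fin 3) →L[ℝ] ℝ) :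
    ∑ i : Fin 3, (ℓ (EuclideanSpace.single i (1:ℝ))) ^ 2 ≤ ‖ℓ‖ ^ 2 := by
  set c : Fin 3 → ℝ := fun i => ℓ (EuclideanSpace.single i (1:ℝ)) with hc
  set y : EuclideanSpace ℝ (Fin 3) := ∑ i : Fin 3, c i • EuclideanSpace.single i (1:ℝ) with hy
  have hyi : ∀ i : Fin 3, y i = c i := by
    intro i
    simp only [hy, WithLp.ofLp_sum, WithLp.ofLp_smul, Finset.sum_apply, Pi.smul_apply, PiLp.single_apply,
      smul_eq_mul, mul_ite, mul_one, mul_zero, Finset.sum_ite_eq, Finset.mem_univ, if_true]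
  have hS0 : 0 ≤ ∑ i : Fin 3, c i ^ 2 := Finset.sum_nonneg fun i _ => sq_nonneg _
  have hnormy : ‖y‖ = Real.sqrt (∑ i : Fin 3, c i ^ 2) := by
    rw [EuclideanSpace.norm_eq]
    congr 1
    exact Finset.sum_congr rfl fun i _ => by rw [hyi, Real.norm_eq_abs, sq_abs]
  have hℓy : ℓ y = ∑ i : Fin 3, c i ^ 2 := by
    simp only [hy, map_sum, map_smul, smul_eq_mul, hc]
    exact Finset.sum_congr rfl fun i _ => by ring
  have hle : ∑ i : Fin 3, c i ^ 2 ≤ ‖ℓ‖ * Real.sqrt (∑ i : Fin 3, c i ^ 2) := by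
    have h := ℓ.le_opNorm y
    rw [hℓy, Real.norm_eq_abs, abs_of_nonneg hS0, hnormy] at h
    exact h
  by_cases hS : ∑ i : Fin 3, c i ^ 2 = 0
  · rw [show (∑ i : Fin 3, (ℓ (EuclideanSpace.single i (1:ℝ))) ^ 2) = ∑ i : Fin 3, c i ^ 2 from rfl, hS]
    positivity
  · have hpos : 0 < Real.sqrt (∑ i : Fin 3, c i ^ 2) := Real.sqrt_pos.2 (lt_of_le_of_ne hS0 (Ne.symm hS))
    have hsq : Real.sqrt (∑ i : Fin 3, c i ^ 2) * Real.sqrt (∑ i : Fin 3, c i ^ 2) = ∑ i : Fin 3, c i ^ 2 :=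
      Real.mul_self_sqrt hS0
    have h1 : Real.sqrt (∑ i : Fin 3, c i ^ 2) ≤ ‖ℓ‖ := by
      have h2 : Real.sqrt (∑ i : Fin 3, c i ^ 2) * Real.sqrt (∑ i : Fin 3, c i ^ 2) ≤ ‖ℓ‖ * Real.sqrt (∑ i : Fin 3, c i ^ 2) := by
        rw [hsq]; exact hle
      exact le_of_mul_le_mul_right h2 hpos
    calc ∑ i : Fin 3, (ℓ (EuclideanSpace.single i (1:ℝ))) ^ 2 = ∑ i : Fin 3, c i ^ 2 := rfl
      _ = Real.sqrt (∑ i : Fin 3, c i ^ 2) ^ 2 := by rw [sq, hsq]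
      _ ≤ ‖ℓ‖ ^ 2 := pow_le_pow_left₀ hpos.le h1 2

/-- `‖a + b + c‖² ≤ 3(‖a‖² + ‖b‖² + ‖c‖²)`. [cite: Simon1996, §2.8] -/
theorem norm_sq_add_add_le_three {F : Type*} [NormedAddCommGroup F] (a b c : F) :
    ‖a + b + c‖ ^ 2 ≤ 3 * (‖a‖ ^ 2 + ‖b‖ ^ 2 + ‖c‖ ^ 2) := by
  have h := norm_add₃_le (a := a) (b := b) (c := c)
  nlinarith [norm_nonneg (a + b + c), norm_nonneg a, norm_nonneg b, norm_nonneg c,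
    sq_nonneg (‖a‖ - ‖b‖), sq_nonneg (‖b‖ - ‖c‖), sq_nonneg (‖a‖ - ‖c‖)]

/-- **THE POINTWISE ENERGY ROW OF THE INTERPOLANT.**  With `0 ≤ χ x ≤ 1`, `‖fderiv ℝ χ x‖ ≤ L` and
`Gw x = χ x • Gv x + (1 − χ x) • Gu x + (fderiv ℝ χ x).smulRight (v x − u x)`:
`Σᵢ ‖Gw x eᵢ‖² ≤ 3·(Σᵢ ‖Gv x eᵢ‖² + Σᵢ ‖Gu x eᵢ‖² + L²·‖v x − u x‖²)` — for EVERY `x`. [cite: Simon1996, §2.8] -/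
theorem dens_interpolant_le {u v : EuclideanSpace ℝ (Fin 3) → EuclideanSpace ℝ (Fin 4)}
    {Gu Gv Gw : EuclideanSpace ℝ (Fin 3) → (EuclideanSpace ℝ (Fin 3) →L[ℝ] EuclideanSpace ℝ (Fin 4))}
    {χ : EuclideanSpace ℝ (Fin 3) → ℝ} {L : ℝ} (hχ01 : ∀ x, 0 ≤ χ x ∧ χ x ≤ 1) (hχL : ∀ x, ‖fderiv ℝ χ x‖ ≤ L)
    (hGw : ∀ x, Gw x = χ x • Gv x + (1 - χ x) • Gu x + (fderiv ℝ χ x).smulRight (v x - u x)) (x : EuclideanSpace ℝ (Fin 3)) :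
    ∑ i : Fin 3, ‖Gw x (EuclideanSpace.single i (1:ℝ))‖ ^ 2 ≤
      3 * (∑ i : Fin 3, ‖Gv x (EuclideanSpace.single i (1:ℝ))‖ ^ 2 + ∑ i : Fin 3, ‖Gu x (EuclideanSpace.single i (1:ℝ))‖ ^ 2 +
        L ^ 2 * ‖v x - u x‖ ^ 2) := by
  have hL0 : 0 ≤ L := le_trans (norm_nonneg _) (hχL x)
  have hχ0 := (hχ01 x).1
  have hχ1 := (hχ01 x).2
  -- per direction
  have hdir : ∀ i : Fin 3, ‖Gw x (EuclideanSpace.single i (1:ℝ))‖ ^ 2 ≤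
      3 * (‖Gv x (EuclideanSpace.single i (1:ℝ))‖ ^ 2 + ‖Gu x (EuclideanSpace.single i (1:ℝ))‖ ^ 2 +
        (fderiv ℝ χ x (EuclideanSpace.single i (1:ℝ))) ^ 2 * ‖v x - u x‖ ^ 2) := by
    intro i
    have happ : Gw x (EuclideanSpace.single i (1:ℝ)) =
        χ x • Gv x (EuclideanSpace.single i (1:ℝ)) + (1 - χ x) • Gu x (EuclideanSpace.single i (1:ℝ)) +
          (fderiv ℝ χ x (EuclideanSpace.single i (1:ℝ))) • (v x - u x) := by
      rw [hGw x]
      simp [ContinuousLinearMap.smulRight_apply]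
    rw [happ]
    refine (norm_sq_add_add_le_three _ _ _).trans ?_
    have h1 : ‖χ x • Gv x (EuclideanSpace.single i (1:ℝ))‖ ^ 2 ≤ ‖Gv x (EuclideanSpace.single i (1:ℝ))‖ ^ 2 := by
      rw [norm_smul, Real.norm_eq_abs, abs_of_nonneg hχ0, mul_pow]
      have : χ x ^ 2 ≤ 1 := by nlinarith
      nlinarith [sq_nonneg ‖Gv x (EuclideanSpace.single i (1:ℝ))‖]
    have h2 : ‖(1 - χ x) • Gu x (EuclideanSpace.single i (1:ℝ))‖ ^ 2 ≤ ‖Gu x (EuclideanSpace.single i (1:ℝ))‖ ^ 2 := by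
      rw [norm_smul, Real.norm_eq_abs, abs_of_nonneg (by linarith), mul_pow]
      have : (1 - χ x) ^ 2 ≤ 1 := by nlinarith
      nlinarith [sq_nonneg ‖Gu x (EuclideanSpace.single i (1:ℝ))‖]
    have h3 : ‖(fderiv ℝ χ x (EuclideanSpace.single i (1:ℝ))) • (v x - u x)‖ ^ 2 =
        (fderiv ℝ χ x (EuclideanSpace.single i (1:ℝ))) ^ 2 * ‖v x - u x‖ ^ 2 := by
      rw [norm_smul, Real.norm_eq_abs, mul_pow, sq_abs]
    linarith
  -- the cut-off row `Σᵢ (∂ᵢχ)² ≤ ‖∇χ‖² ≤ L²`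
  have hχsum : ∑ i : Fin 3, (fderiv ℝ χ x (EuclideanSpace.single i (1:ℝ))) ^ 2 ≤ L ^ 2 :=
    (sum_sq_apply_single_le_opNorm_sq (fderiv ℝ χ x)).trans (pow_le_pow_left₀ (norm_nonneg _) (hχL x) 2)
  have hvu0 : 0 ≤ ‖v x - u x‖ ^ 2 := sq_nonneg _
  calc ∑ i : Fin 3, ‖Gw x (EuclideanSpace.single i (1:ℝ))‖ ^ 2
      ≤ ∑ i : Fin 3, 3 * (‖Gv x (EuclideanSpace.single i (1:ℝ))‖ ^ 2 + ‖Gu x (EuclideanSpace.single i (1:ℝ))‖ ^ 2 +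
          (fderiv ℝ χ x (EuclideanSpace.single i (1:ℝ))) ^ 2 * ‖v x - u x‖ ^ 2) := Finset.sum_le_sum fun i _ => hdir i
    _ = 3 * (∑ i : Fin 3, ‖Gv x (EuclideanSpace.single i (1:ℝ))‖ ^ 2 + ∑ i : Fin 3, ‖Gu x (EuclideanSpace.single i (1:ℝ))‖ ^ 2 +
          (∑ i : Fin 3, (fderiv ℝ χ x (EuclideanSpace.single i (1:ℝ))) ^ 2) * ‖v x - u x‖ ^ 2) := by
        rw [← Finset.mul_sum, Finset.sum_add_distrib, Finset.sum_add_distrib, Finset.sum_mul]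
    _ ≤ 3 * (∑ i : Fin 3, ‖Gv x (EuclideanSpace.single i (1:ℝ))‖ ^ 2 + ∑ i : Fin 3, ‖Gu x (EuclideanSpace.single i (1:ℝ))‖ ^ 2 +
          L ^ 2 * ‖v x - u x‖ ^ 2) := by
        have := mul_le_mul_of_nonneg_right hχsum hvu0
        linarith

/-! ## §2 The interpolant is Sobolev and sub-unit -/

/-- **(i) THE INTERPOLANT IS SOBOLEV with the product-rule gradient**: `HasWeakFDerivOn Ω volume w Gw` for `w = χ•v + (1−χ)•u`,
`Gw = χ•Gv + (1−χ)•Gu + (∇χ) ⊗ (v − u)` (lit `HasWeakFDerivOn.smul_contDiff` on each summand + `SobolevApprox.hasWeakFDerivOn_add`). [cite: Simon1996, §2.8] -/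
theorem hasWeakFDerivOn_interpolant {Ω : Opens (EuclideanSpace ℝ (Fin 3))}
    {u v w : EuclideanSpace ℝ (Fin 3) → EuclideanSpace ℝ (Fin 4)}
    {Gu Gv Gw : EuclideanSpace ℝ (Fin 3) → (EuclideanSpace ℝ (Fin 3) →L[ℝ] EuclideanSpace ℝ (Fin 4))}
    (hu : HasWeakFDerivOn Ω volume u Gu) (hv : HasWeakFDerivOn Ω volume v Gv)
    {χ : EuclideanSpace ℝ (Fin 3) → ℝ} (hχ : ContDiff ℝ ∞ χ)
    (hw : ∀ x, w x = χ x • v x + (1 - χ x) • u x)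
    (hGw : ∀ x, Gw x = χ x • Gv x + (1 - χ x) • Gu x + (fderiv ℝ χ x).smulRight (v x - u x)) :
    HasWeakFDerivOn Ω volume w Gw := by
  have hχ' : ContDiff ℝ ∞ (fun x => 1 - χ x) := contDiff_const.sub hχ
  have h1 := hv.smul_contDiff hχ
  have h2 := hu.smul_contDiff hχ'
  have h12 := hasWeakFDerivOn_add h1 h2
  have ef : ((fun x => χ x • v x) + fun x => (1 - χ x) • u x) = w := by
    funext x
    rw [Pi.add_apply, hw x]
  have eg : ((fun x => (fderiv ℝ χ x).smulRight (v x) + χ x • Gv x) +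
      fun x => (fderiv ℝ (fun x => 1 - χ x) x).smulRight (u x) + (1 - χ x) • Gu x) = Gw := by
    funext x
    rw [Pi.add_apply, hGw x, fderiv_const_sub]
    ext y
    simp [ContinuousLinearMap.smulRight_apply, smul_sub, sub_smul]
    abel
  rw [ef, eg] at h12
  exact h12

/-- **(ii) the interpolant is sub-unit**: `‖w x‖ ≤ 1` wherever `‖u x‖ = ‖v x‖ = 1` and `0 ≤ χ x ≤ 1`. [cite: Simon1996, §2.8] -/
theorem norm_interpolant_le_one {u v w : EuclideanSpace ℝ (Fin 3) → EuclideanSpace ℝ (Fin 4)}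
    {χ : EuclideanSpace ℝ (Fin 3) → ℝ} (hχ01 : ∀ x, 0 ≤ χ x ∧ χ x ≤ 1)
    (hw : ∀ x, w x = χ x • v x + (1 - χ x) • u x) {x : EuclideanSpace ℝ (Fin 3)}
    (hu1 : ‖u x‖ = 1) (hv1 : ‖v x‖ = 1) : ‖w x‖ ≤ 1 := by
  rw [hw x]
  have hχ0 := (hχ01 x).1
  have hχ1 := (hχ01 x).2
  calc ‖χ x • v x + (1 - χ x) • u x‖ ≤ ‖χ x • v x‖ + ‖(1 - χ x) • u x‖ := norm_add_le _ _
    _ = χ x + (1 - χ x) := by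
        rw [norm_smul, norm_smul, Real.norm_eq_abs, Real.norm_eq_abs, abs_of_nonneg hχ0, abs_of_nonneg (by linarith),
          hv1, hu1, mul_one, mul_one]
    _ = 1 := by ring

/-- **(iv-a)** where `χ = 1` the interpolant is `v`. [cite: Simon1996, §2.8] -/
theorem interpolant_eq_of_chi_eq_one {u v w : EuclideanSpace ℝ (Fin 3) → EuclideanSpace ℝ (Fin 4)}
    {χ : EuclideanSpace ℝ (Fin 3) → ℝ} (hw : ∀ x, w x = χ x • v x + (1 - χ x) • u x) {x : EuclideanSpace ℝ (Fin 3)}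
    (hx : χ x = 1) : w x = v x := by
  rw [hw x, hx]; simp

/-- **(iv-b)** where `χ = 0` the interpolant is `u`. [cite: Simon1996, §2.8] -/
theorem interpolant_eq_of_chi_eq_zero {u v w : EuclideanSpace ℝ (Fin 3) → EuclideanSpace ℝ (Fin 4)}
    {χ : EuclideanSpace ℝ (Fin 3) → ℝ} (hw : ∀ x, w x = χ x • v x + (1 - χ x) • u x) {x : EuclideanSpace ℝ (Fin 3)}
    (hx : χ x = 0) : w x = u x := by
  rw [hw x, hx]; simp

/-! ## §3 The integrated energy row on finite-volume measurable pieces of `Ω` -/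

/-- **(iii) THE SHELL ENERGY ROW.**  For measurable `S ⊆ Ω` of finite volume: `dens Gw` is integrable on `S` and
`∫_S dens Gw ≤ 3·(∫_S dens Gv + ∫_S dens Gu + L²·∫_S ‖v − u‖²)`. [folklore] [cite: Simon1996, §2.8] -/
theorem setIntegral_dens_interpolant_le {Ω : Opens (EuclideanSpace ℝ (Fin 3))}
    {u v w : EuclideanSpace ℝ (Fin 3) → EuclideanSpace ℝ (Fin 4)}
    {Gu Gv Gw : EuclideanSpace ℝ (Fin 3) → (EuclideanSpace ℝ (Fin 3) →L[ℝ] EuclideanSpace ℝ (Fin 4))}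
    (hu : HasWeakFDerivOn Ω volume u Gu) (hv : HasWeakFDerivOn Ω volume v Gv)
    (hu1 : ∀ x ∈ (Ω : Set (EuclideanSpace ℝ (Fin 3))), ‖u x‖ = 1) (hv1 : ∀ x ∈ (Ω : Set (EuclideanSpace ℝ (Fin 3))), ‖v x‖ = 1)
    (hdu : IntegrableOn (fun x => ∑ i : Fin 3, ‖Gu x (EuclideanSpace.single i (1:ℝ))‖ ^ 2) (Ω : Set _) volume)
    (hdv : IntegrableOn (fun x => ∑ i : Fin 3, ‖Gv x (EuclideanSpace.single i (1:ℝ))‖ ^ 2) (Ω : Set _) volume)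
    {χ : EuclideanSpace ℝ (Fin 3) → ℝ} {L : ℝ} (hχ : ContDiff ℝ ∞ χ) (hχ01 : ∀ x, 0 ≤ χ x ∧ χ x ≤ 1) (hχL : ∀ x, ‖fderiv ℝ χ x‖ ≤ L)
    (hw : ∀ x, w x = χ x • v x + (1 - χ x) • u x)
    (hGw : ∀ x, Gw x = χ x • Gv x + (1 - χ x) • Gu x + (fderiv ℝ χ x).smulRight (v x - u x))
    {S : Set (EuclideanSpace ℝ (Fin 3))} (hS : MeasurableSet S) (hSΩ : S ⊆ (Ω : Set _)) (hSfin : volume S < ⊤) :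
    IntegrableOn (fun x => ∑ i : Fin 3, ‖Gw x (EuclideanSpace.single i (1:ℝ))‖ ^ 2) S volume ∧
    ∫ x in S, ∑ i : Fin 3, ‖Gw x (EuclideanSpace.single i (1:ℝ))‖ ^ 2 ≤
      3 * ((∫ x in S, ∑ i : Fin 3, ‖Gv x (EuclideanSpace.single i (1:ℝ))‖ ^ 2) +
        (∫ x in S, ∑ i : Fin 3, ‖Gu x (EuclideanSpace.single i (1:ℝ))‖ ^ 2) + L ^ 2 * ∫ x in S, ‖v x - u x‖ ^ 2) := by
  haveI : IsFiniteMeasure (volume.restrict S) := ⟨by rw [Measure.restrict_apply_univ]; exact hSfin⟩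
  have hle : volume.restrict S ≤ volume.restrict (Ω : Set _) := Measure.restrict_mono hSΩ le_rfl
  -- measurability of the pieces on `S`
  have hW := hasWeakFDerivOn_interpolant hu hv hχ hw hGw
  have hGwm : AEStronglyMeasurable Gw (volume.restrict S) := (hW.locallyIntegrableOn_deriv.aestronglyMeasurable).mono_measure hle
  have hum : AEStronglyMeasurable u (volume.restrict S) := (hu.locallyIntegrableOn.aestronglyMeasurable).mono_measure hle
  have hvm : AEStronglyMeasurable v (volume.restrict S) := (hv.locallyIntegrableOn.aestronglyMeasurable).mono_measure hle
  have hdensm : AEStronglyMeasurable (fun x => ∑ i : Fin 3, ‖Gw x (EuclideanSpace.single i (1:ℝ))‖ ^ 2) (volume.restrict S) := by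
    refine Finset.aestronglyMeasurable_fun_sum _ fun i _ => ?_
    have h1 : AEStronglyMeasurable (fun x => ‖Gw x (EuclideanSpace.single i (1:ℝ))‖ ^ 2) (volume.restrict S) :=
      ((hGwm.apply_continuousLinearMap (EuclideanSpace.single i (1:ℝ))).norm.pow 2)
    exact h1
  -- `‖v − u‖²` is integrable on `S` (bounded by `4`, finite volume)
  have hvum : AEStronglyMeasurable (fun x => ‖v x - u x‖ ^ 2) (volume.restrict S) := (hvm.sub hum).norm.pow 2
  have hvuint : IntegrableOn (fun x => ‖v x - u x‖ ^ 2) S volume := by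
    refine memLp_one_iff_integrable.1 (MemLp.of_bound hvum 4 ?_)
    refine (ae_restrict_iff' hS).mpr (ae_of_all _ fun x hx => ?_)
    rw [Real.norm_of_nonneg (by positivity)]
    have h := norm_sub_le (v x) (u x)
    rw [hv1 x (hSΩ hx), hu1 x (hSΩ hx)] at h
    nlinarith [norm_nonneg (v x - u x)]
  -- the dominating function
  have hdom : IntegrableOn (fun x => 3 * ((∑ i : Fin 3, ‖Gv x (EuclideanSpace.single i (1:ℝ))‖ ^ 2) +
      (∑ i : Fin 3, ‖Gu x (EuclideanSpace.single i (1:ℝ))‖ ^ 2) + L ^ 2 * ‖v x - u x‖ ^ 2)) S volume :=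
    (((hdv.mono_set hSΩ).add (hdu.mono_set hSΩ)).add (hvuint.const_mul (L ^ 2))).const_mul 3
  have hptw := dens_interpolant_le (u := u) (v := v) hχ01 hχL hGw
  have hint : IntegrableOn (fun x => ∑ i : Fin 3, ‖Gw x (EuclideanSpace.single i (1:ℝ))‖ ^ 2) S volume := by
    refine Integrable.mono' hdom hdensm (ae_of_all _ fun x => ?_)
    rw [Real.norm_of_nonneg (Finset.sum_nonneg fun i _ => by positivity)]
    exact hptw x
  refine ⟨hint, ?_⟩
  calc ∫ x in S, ∑ i : Fin 3, ‖Gw x (EuclideanSpace.single i (1:ℝ))‖ ^ 2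
      ≤ ∫ x in S, 3 * ((∑ i : Fin 3, ‖Gv x (EuclideanSpace.single i (1:ℝ))‖ ^ 2) +
          (∑ i : Fin 3, ‖Gu x (EuclideanSpace.single i (1:ℝ))‖ ^ 2) + L ^ 2 * ‖v x - u x‖ ^ 2) :=
        setIntegral_mono_on hint hdom hS fun x _ => hptw x
    _ = 3 * ((∫ x in S, ∑ i : Fin 3, ‖Gv x (EuclideanSpace.single i (1:ℝ))‖ ^ 2) +
          (∫ x in S, ∑ i : Fin 3, ‖Gu x (EuclideanSpace.single i (1:ℝ))‖ ^ 2) + L ^ 2 * ∫ x in S, ‖v x - u x‖ ^ 2) := by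
        have hAB : IntegrableOn (fun x => (∑ i : Fin 3, ‖Gv x (EuclideanSpace.single i (1:ℝ))‖ ^ 2) +
            (∑ i : Fin 3, ‖Gu x (EuclideanSpace.single i (1:ℝ))‖ ^ 2)) S volume := (hdv.mono_set hSΩ).add (hdu.mono_set hSΩ)
        have hC : IntegrableOn (fun x => L ^ 2 * ‖v x - u x‖ ^ 2) S volume := hvuint.const_mul (L ^ 2)
        have e1 : ∫ x in S, ((∑ i : Fin 3, ‖Gv x (EuclideanSpace.single i (1:ℝ))‖ ^ 2) +
            (∑ i : Fin 3, ‖Gu x (EuclideanSpace.single i (1:ℝ))‖ ^ 2) + L ^ 2 * ‖v x - u x‖ ^ 2) =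
            (∫ x in S, ((∑ i : Fin 3, ‖Gv x (EuclideanSpace.single i (1:ℝ))‖ ^ 2) +
              (∑ i : Fin 3, ‖Gu x (EuclideanSpace.single i (1:ℝ))‖ ^ 2))) + ∫ x in S, L ^ 2 * ‖v x - u x‖ ^ 2 :=
          integral_add hAB hC
        have e2 : ∫ x in S, ((∑ i : Fin 3, ‖Gv x (EuclideanSpace.single i (1:ℝ))‖ ^ 2) +
            (∑ i : Fin 3, ‖Gu x (EuclideanSpace.single i (1:ℝ))‖ ^ 2)) =
            (∫ x in S, ∑ i : Fin 3, ‖Gv x (EuclideanSpace.single i (1:ℝ))‖ ^ 2) +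
              ∫ x in S, ∑ i : Fin 3, ‖Gu x (EuclideanSpace.single i (1:ℝ))‖ ^ 2 :=
          integral_add (hdv.mono_set hSΩ) (hdu.mono_set hSΩ)
        have e3 : ∫ x in S, L ^ 2 * ‖v x - u x‖ ^ 2 = L ^ 2 * ∫ x in S, ‖v x - u x‖ ^ 2 := integral_const_mul _ _
        rw [integral_const_mul, e1, e2, e3]

end Literature.Analysis.PDE.MinimisingMaps

end Part7

/-!
## Part 8 — port of `Summits/QuantumFields/YangMills/Theorems/PoincareLipschitzSobolevShellInterpolationBalls.lean` (8 declarations kept)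

# Energy minimising maps into `S³` (Hardt–Kinderlehrer–Lin / Luckhaus / Simon §2.9): Sobolev Shell Interpolation Balls

Declarations of this Part (verbatim port; each keeps its own docstring and citation): `fderiv_eq_zero_of_chi_eq_one`, `fderiv_eq_zero_of_chi_eq_zero`, `interpolantGrad_eq_of_chi_eq_one`, `interpolantGrad_eq_of_chi_eq_zero`, `norm_interpolant_sub_left_le`, `norm_interpolant_sub_right_le`, `exists_ball_interpolant`, `exists_ball_interpolant_energy`.

Reference keys (see `references.bib` and the declarations' citations): [Simon1996], [HardtKinderlehrerLin1986], [Evans2010].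
-/

section Part8

open _root_.MeasureTheory _root_.Set _root_.Filter _root_.Topology _root_.TopologicalSpace _root_.Metric
open scoped _root_.NNReal _root_.BigOperators _root_.ContDiff

namespace Literature.Analysis.PDE.MinimisingMaps

open Literature.Analysis.FunctionSpaces (HasWeakFDerivOn)

/-! ## §1 Pointwise letters: the gradient of the interpolant on the two caps -/

/-- With `0 ≤ χ ≤ 1`, the point `x` with `χ x = 1` is a (global, hence local) maximum, so `fderiv ℝ χ x = 0` (no differentiability needed:
Mathlib's `fderiv` is `0` at a non-differentiable point as well). [cite: Simon1996, §2.8] -/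
theorem fderiv_eq_zero_of_chi_eq_one {χ : EuclideanSpace ℝ (Fin 3) → ℝ} (hχ01 : ∀ x, 0 ≤ χ x ∧ χ x ≤ 1)
    {x : EuclideanSpace ℝ (Fin 3)} (hx : χ x = 1) : fderiv ℝ χ x = 0 :=
  IsLocalMax.fderiv_eq_zero (Filter.Eventually.of_forall fun y => by rw [hx]; exact (hχ01 y).2)

/-- With `0 ≤ χ ≤ 1`, the point `x` with `χ x = 0` is a minimum, so `fderiv ℝ χ x = 0`. [cite: Simon1996, §2.8] -/
theorem fderiv_eq_zero_of_chi_eq_zero {χ : EuclideanSpace ℝ (Fin 3) → ℝ} (hχ01 : ∀ x, 0 ≤ χ x ∧ χ x ≤ 1)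
    {x : EuclideanSpace ℝ (Fin 3)} (hx : χ x = 0) : fderiv ℝ χ x = 0 :=
  IsLocalMin.fderiv_eq_zero (Filter.Eventually.of_forall fun y => by rw [hx]; exact (hχ01 y).1)

/-- **where `χ = 1` the interpolant's gradient is `Gv` — at EVERY such point.** [cite: Simon1996, §2.8] -/
theorem interpolantGrad_eq_of_chi_eq_one {u v : EuclideanSpace ℝ (Fin 3) → EuclideanSpace ℝ (Fin 4)}
    {Gu Gv Gw : EuclideanSpace ℝ (Fin 3) → (EuclideanSpace ℝ (Fin 3) →L[ℝ] EuclideanSpace ℝ (Fin 4))}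
    {χ : EuclideanSpace ℝ (Fin 3) → ℝ} (hχ01 : ∀ x, 0 ≤ χ x ∧ χ x ≤ 1)
    (hGw : ∀ x, Gw x = χ x • Gv x + (1 - χ x) • Gu x + (fderiv ℝ χ x).smulRight (v x - u x))
    {x : EuclideanSpace ℝ (Fin 3)} (hx : χ x = 1) : Gw x = Gv x := by
  rw [hGw x, fderiv_eq_zero_of_chi_eq_one hχ01 hx, hx]
  ext1 z
  simp

/-- **where `χ = 0` the interpolant's gradient is `Gu` — at EVERY such point.** [cite: Simon1996, §2.8] -/
theorem interpolantGrad_eq_of_chi_eq_zero {u v : EuclideanSpace ℝ (Fin 3) → EuclideanSpace ℝ (Fin 4)}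
    {Gu Gv Gw : EuclideanSpace ℝ (Fin 3) → (EuclideanSpace ℝ (Fin 3) →L[ℝ] EuclideanSpace ℝ (Fin 4))}
    {χ : EuclideanSpace ℝ (Fin 3) → ℝ} (hχ01 : ∀ x, 0 ≤ χ x ∧ χ x ≤ 1)
    (hGw : ∀ x, Gw x = χ x • Gv x + (1 - χ x) • Gu x + (fderiv ℝ χ x).smulRight (v x - u x))
    {x : EuclideanSpace ℝ (Fin 3)} (hx : χ x = 0) : Gw x = Gu x := by
  rw [hGw x, fderiv_eq_zero_of_chi_eq_zero hχ01 hx, hx]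
  ext1 z
  simp

/-- `‖w x − u x‖ ≤ ‖v x − u x‖` (`w − u = χ • (v − u)`, `0 ≤ χ ≤ 1`). [cite: Simon1996, §2.8] -/
theorem norm_interpolant_sub_left_le {u v w : EuclideanSpace ℝ (Fin 3) → EuclideanSpace ℝ (Fin 4)}
    {χ : EuclideanSpace ℝ (Fin 3) → ℝ} (hχ01 : ∀ x, 0 ≤ χ x ∧ χ x ≤ 1)
    (hw : ∀ x, w x = χ x • v x + (1 - χ x) • u x) (x : EuclideanSpace ℝ (Fin 3)) :
    ‖w x - u x‖ ≤ ‖v x - u x‖ := by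
  have h : w x - u x = χ x • (v x - u x) := by
    rw [hw x, smul_sub, sub_smul, one_smul]
    abel
  rw [h, norm_smul, Real.norm_eq_abs, abs_of_nonneg (hχ01 x).1]
  exact mul_le_of_le_one_left (norm_nonneg _) (hχ01 x).2

/-- `‖w x − v x‖ ≤ ‖v x − u x‖` (`w − v = (1 − χ) • (u − v)`). [cite: Simon1996, §2.8] -/
theorem norm_interpolant_sub_right_le {u v w : EuclideanSpace ℝ (Fin 3) → EuclideanSpace ℝ (Fin 4)}
    {χ : EuclideanSpace ℝ (Fin 3) → ℝ} (hχ01 : ∀ x, 0 ≤ χ x ∧ χ x ≤ 1)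
    (hw : ∀ x, w x = χ x • v x + (1 - χ x) • u x) (x : EuclideanSpace ℝ (Fin 3)) :
    ‖w x - v x‖ ≤ ‖v x - u x‖ := by
  have h : w x - v x = (1 - χ x) • (u x - v x) := by
    rw [hw x, smul_sub, sub_smul, one_smul, sub_smul, one_smul]
    abel
  rw [h, norm_smul, Real.norm_eq_abs, abs_of_nonneg (by linarith [(hχ01 x).2]), norm_sub_rev (u x)]
  exact mul_le_of_le_one_left (norm_nonneg _) (by linarith [(hχ01 x).1])

/-- **THE INTERPOLANT ACROSS TWO BALLS, `χ` EXPOSED.**  There is an absolute `M ≥ 0` such that for every open `Ω ⊆ ℝ³`, all Sobolev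
`u, v` on `Ω` with weak gradients `Gu, Gv`, every centre `y` and radii `0 < ρ₁ < ρ₂` there are `χ, w, Gw` with: the (C-c) defining rows
`w = χ•v + (1−χ)•u`, `Gw = χ•Gv + (1−χ)•Gu + (∇χ).smulRight (v − u)`; `ContDiff ℝ ∞ χ`, `0 ≤ χ ≤ 1`, `‖fderiv ℝ χ x‖ ≤ M/(ρ₂ − ρ₁)`;
`HasWeakFDerivOn Ω volume w Gw`; and the caps `w = v ∧ Gw = Gv` on `{dist x y ≤ ρ₁}`, `w = u ∧ Gw = Gu` on `{ρ₂ ≤ dist x y}` (everywhere).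
Every (C-c) row applies to these `χ, w, Gw` by name with `L := M/(ρ₂ − ρ₁)`. [folklore] [cite: Simon1996, §2.8] -/
theorem exists_ball_interpolant : ∃ M : ℝ, 0 ≤ M ∧
    ∀ (Ω : Opens (EuclideanSpace ℝ (Fin 3))) (u v : EuclideanSpace ℝ (Fin 3) → EuclideanSpace ℝ (Fin 4))
      (Gu Gv : EuclideanSpace ℝ (Fin 3) → (EuclideanSpace ℝ (Fin 3) →L[ℝ] EuclideanSpace ℝ (Fin 4))),
      HasWeakFDerivOn Ω volume u Gu → HasWeakFDerivOn Ω volume v Gv →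
      ∀ (y : EuclideanSpace ℝ (Fin 3)) (ρ₁ ρ₂ : ℝ), 0 < ρ₁ → ρ₁ < ρ₂ →
      ∃ (χ : EuclideanSpace ℝ (Fin 3) → ℝ) (w : EuclideanSpace ℝ (Fin 3) → EuclideanSpace ℝ (Fin 4))
        (Gw : EuclideanSpace ℝ (Fin 3) → (EuclideanSpace ℝ (Fin 3) →L[ℝ] EuclideanSpace ℝ (Fin 4))),
        ContDiff ℝ ∞ χ ∧ (∀ x, 0 ≤ χ x ∧ χ x ≤ 1) ∧ (∀ x, ‖fderiv ℝ χ x‖ ≤ M / (ρ₂ - ρ₁)) ∧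
        (∀ x, w x = χ x • v x + (1 - χ x) • u x) ∧
        (∀ x, Gw x = χ x • Gv x + (1 - χ x) • Gu x + (fderiv ℝ χ x).smulRight (v x - u x)) ∧
        HasWeakFDerivOn Ω volume w Gw ∧
        (∀ x, dist x y ≤ ρ₁ → w x = v x ∧ Gw x = Gv x) ∧
        (∀ x, ρ₂ ≤ dist x y → w x = u x ∧ Gw x = Gu x) := by
  obtain ⟨M, hM0, hrad⟩ :=
    Literature.Analysis.Calculus.exists_radial_cutoff_gradient_le (E := EuclideanSpace ℝ (Fin 3))
  refine ⟨M, hM0, fun Ω u v Gu Gv hu hv y ρ₁ ρ₂ h1 h12 => ?_⟩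
  obtain ⟨χ, hχs, hχ0, hχ1, hone, hzero, -, hgrad⟩ := hrad y ρ₁ ρ₂ h1 h12
  have hχ01 : ∀ x, 0 ≤ χ x ∧ χ x ≤ 1 := fun x => ⟨hχ0 x, hχ1 x⟩
  set w : EuclideanSpace ℝ (Fin 3) → EuclideanSpace ℝ (Fin 4) := fun x => χ x • v x + (1 - χ x) • u x with hwdef
  set Gw : EuclideanSpace ℝ (Fin 3) → (EuclideanSpace ℝ (Fin 3) →L[ℝ] EuclideanSpace ℝ (Fin 4)) :=
    fun x => χ x • Gv x + (1 - χ x) • Gu x + (fderiv ℝ χ x).smulRight (v x - u x) with hGwdef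
  have hw : ∀ x, w x = χ x • v x + (1 - χ x) • u x := fun _ => rfl
  have hGw : ∀ x, Gw x = χ x • Gv x + (1 - χ x) • Gu x + (fderiv ℝ χ x).smulRight (v x - u x) := fun _ => rfl
  refine ⟨χ, w, Gw, hχs, hχ01, hgrad, hw, hGw, hasWeakFDerivOn_interpolant hu hv hχs hw hGw,
    fun x hx => ⟨interpolant_eq_of_chi_eq_one hw (hone x hx), interpolantGrad_eq_of_chi_eq_one hχ01 hGw (hone x hx)⟩,
    fun x hx => ⟨interpolant_eq_of_chi_eq_zero hw (hzero x hx), interpolantGrad_eq_of_chi_eq_zero hχ01 hGw (hzero x hx)⟩⟩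

/-- **THE INTERPOLANT ACROSS TWO BALLS, WITH THE ENERGY ROWS** (`χ` hidden).  One absolute `M ≥ 0`; for unit Sobolev `u, v` on `Ω` with
integrable densities, every `y` and `0 < ρ₁ < ρ₂`: some `w, Gw` with `HasWeakFDerivOn Ω volume w Gw`, `‖w‖ ≤ 1` on `Ω`, the caps
`w = v ∧ Gw = Gv` on `{dist x y ≤ ρ₁}` and `w = u ∧ Gw = Gu` on `{ρ₂ ≤ dist x y}`, `‖w − u‖ ≤ ‖v − u‖` and `‖w − v‖ ≤ ‖v − u‖` pointwise,
the pointwise energy row `dens Gw ≤ 3(dens Gv + dens Gu + (M/(ρ₂−ρ₁))²‖v − u‖²)`, and on every finite-volume measurable `S ⊆ Ω`: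
`dens Gw` integrable on `S` with `∫_S dens Gw ≤ 3(∫_S dens Gv + ∫_S dens Gu + (M/(ρ₂−ρ₁))²·∫_S ‖v − u‖²)`.
[folklore] [cite: Simon1996, §2.8] [cite: HardtKinderlehrerLin1986, §2] -/
theorem exists_ball_interpolant_energy : ∃ M : ℝ, 0 ≤ M ∧
    ∀ (Ω : Opens (EuclideanSpace ℝ (Fin 3))) (u v : EuclideanSpace ℝ (Fin 3) → EuclideanSpace ℝ (Fin 4))
      (Gu Gv : EuclideanSpace ℝ (Fin 3) → (EuclideanSpace ℝ (Fin 3) →L[ℝ] EuclideanSpace ℝ (Fin 4))),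
      HasWeakFDerivOn Ω volume u Gu → HasWeakFDerivOn Ω volume v Gv →
      (∀ x ∈ (Ω : Set (EuclideanSpace ℝ (Fin 3))), ‖u x‖ = 1) → (∀ x ∈ (Ω : Set (EuclideanSpace ℝ (Fin 3))), ‖v x‖ = 1) →
      IntegrableOn (fun x => ∑ i : Fin 3, ‖Gu x (EuclideanSpace.single i (1:ℝ))‖ ^ 2) (Ω : Set _) volume →
      IntegrableOn (fun x => ∑ i : Fin 3, ‖Gv x (EuclideanSpace.single i (1:ℝ))‖ ^ 2) (Ω : Set _) volume →
      ∀ (y : EuclideanSpace ℝ (Fin 3)) (ρ₁ ρ₂ : ℝ), 0 < ρ₁ → ρ₁ < ρ₂ →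
      ∃ (w : EuclideanSpace ℝ (Fin 3) → EuclideanSpace ℝ (Fin 4))
        (Gw : EuclideanSpace ℝ (Fin 3) → (EuclideanSpace ℝ (Fin 3) →L[ℝ] EuclideanSpace ℝ (Fin 4))),
        HasWeakFDerivOn Ω volume w Gw ∧
        (∀ x ∈ (Ω : Set (EuclideanSpace ℝ (Fin 3))), ‖w x‖ ≤ 1) ∧
        (∀ x, dist x y ≤ ρ₁ → w x = v x ∧ Gw x = Gv x) ∧
        (∀ x, ρ₂ ≤ dist x y → w x = u x ∧ Gw x = Gu x) ∧
        (∀ x, ‖w x - u x‖ ≤ ‖v x - u x‖ ∧ ‖w x - v x‖ ≤ ‖v x - u x‖) ∧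
        (∀ x, ∑ i : Fin 3, ‖Gw x (EuclideanSpace.single i (1:ℝ))‖ ^ 2 ≤
          3 * (∑ i : Fin 3, ‖Gv x (EuclideanSpace.single i (1:ℝ))‖ ^ 2 + ∑ i : Fin 3, ‖Gu x (EuclideanSpace.single i (1:ℝ))‖ ^ 2 +
            (M / (ρ₂ - ρ₁)) ^ 2 * ‖v x - u x‖ ^ 2)) ∧
        ∀ S : Set (EuclideanSpace ℝ (Fin 3)), MeasurableSet S → S ⊆ (Ω : Set _) → volume S < ⊤ →
          IntegrableOn (fun x => ∑ i : Fin 3, ‖Gw x (EuclideanSpace.single i (1:ℝ))‖ ^ 2) S volume ∧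
          ∫ x in S, ∑ i : Fin 3, ‖Gw x (EuclideanSpace.single i (1:ℝ))‖ ^ 2 ≤
            3 * ((∫ x in S, ∑ i : Fin 3, ‖Gv x (EuclideanSpace.single i (1:ℝ))‖ ^ 2) +
              (∫ x in S, ∑ i : Fin 3, ‖Gu x (EuclideanSpace.single i (1:ℝ))‖ ^ 2) +
              (M / (ρ₂ - ρ₁)) ^ 2 * ∫ x in S, ‖v x - u x‖ ^ 2) := by
  obtain ⟨M, hM0, hball⟩ := exists_ball_interpolant
  refine ⟨M, hM0, fun Ω u v Gu Gv hu hv hu1 hv1 hdu hdv y ρ₁ ρ₂ h1 h12 => ?_⟩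
  obtain ⟨χ, w, Gw, hχs, hχ01, hgrad, hw, hGw, hW, hin, hout⟩ := hball Ω u v Gu Gv hu hv y ρ₁ ρ₂ h1 h12
  refine ⟨w, Gw, hW, fun x hx => norm_interpolant_le_one hχ01 hw (hu1 x hx) (hv1 x hx), hin, hout,
    fun x => ⟨norm_interpolant_sub_left_le hχ01 hw x, norm_interpolant_sub_right_le hχ01 hw x⟩,
    fun x => dens_interpolant_le hχ01 hgrad hGw x, fun S hS hSΩ hSfin => ?_⟩
  exact setIntegral_dens_interpolant_le hu hv hu1 hv1 hdu hdv hχs hχ01 hgrad hw hGw hS hSΩ hSfin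

end Literature.Analysis.PDE.MinimisingMaps

end Part8

/-!
## Part 9 — port of `Summits/QuantumFields/YangMills/Theorems/PoincareLipschitzProjectionAveraging.lean` (5 declarations kept)

# Energy minimising maps into `S³` (Hardt–Kinderlehrer–Lin / Luckhaus / Simon §2.9): Projection Averaging

Declarations of this Part (verbatim port; each keeps its own docstring and citation): `integrableOn_inv_norm_sq_ball`, `preimage_sub_ball`, `integrableOn_inv_norm_sub_sq_ball`, `setIntegral_inv_norm_sub_sq_eq`, `setIntegral_inv_norm_sub_sq_le`.

Reference keys (see `references.bib` and the declarations' citations): [HardtKinderlehrerLin1986].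
-/

section Part9

open _root_.MeasureTheory _root_.Metric _root_.Set
open scoped _root_.BigOperators

namespace Literature.Analysis.PDE.MinimisingMaps

/-! ## §1 Integrability of `‖·‖⁻²` on balls of `ℝ⁴` and the translated bound -/

/-- `x ↦ (‖x‖²)⁻¹` is integrable on every ball about the origin of `ℝ⁴` (`2 < 4 = dim`). [folklore]
[cite: HardtKinderlehrerLin1986, §2] -/
theorem integrableOn_inv_norm_sq_ball (r : ℝ) :
    IntegrableOn (fun x : EuclideanSpace ℝ (Fin 4) => (‖x‖ ^ 2)⁻¹) (ball 0 r) volume := by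
  refine integrableOn_ball_of_norm_le_rpow (E := EuclideanSpace ℝ (Fin 4)) (μ := volume)
    (by rw [finrank_euclideanSpace_fin]; norm_num) (C := 1) (α := 2)
    (by rw [finrank_euclideanSpace_fin]; norm_num) (Filter.Eventually.of_forall fun x => ?_) ?_
  · rw [Real.norm_of_nonneg (by positivity), one_mul, Real.rpow_neg (norm_nonneg _), Real.rpow_two]
  · exact ((continuous_norm.pow 2).measurable.inv).aestronglyMeasurable

/-- The translate `p ↦ p − q` pulls the ball about `0` back to the ball about `q`. [cite: HardtKinderlehrerLin1986, §2] -/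
theorem preimage_sub_ball (q : EuclideanSpace ℝ (Fin 4)) (r : ℝ) :
    (fun p : EuclideanSpace ℝ (Fin 4) => p - q) ⁻¹' (ball 0 r) = ball q r := by
  ext p
  simp [dist_eq_norm]

/-- `p ↦ (‖q − p‖²)⁻¹` is integrable on every ball about `q` (translation invariance of Lebesgue measure). [folklore]
[cite: HardtKinderlehrerLin1986, §2] -/
theorem integrableOn_inv_norm_sub_sq_ball (q : EuclideanSpace ℝ (Fin 4)) (r : ℝ) :
    IntegrableOn (fun p : EuclideanSpace ℝ (Fin 4) => (‖q - p‖ ^ 2)⁻¹) (ball q r) volume := by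
  have hmp : MeasurePreserving (fun p : EuclideanSpace ℝ (Fin 4) => p - q) volume volume :=
    measurePreserving_sub_right volume q
  have hemb : MeasurableEmbedding (fun p : EuclideanSpace ℝ (Fin 4) => p - q) :=
    (MeasurableEquiv.subRight q).measurableEmbedding
  have h := (hmp.integrableOn_comp_preimage hemb).mpr (integrableOn_inv_norm_sq_ball r)
  rw [preimage_sub_ball] at h
  refine h.congr_fun (fun p _ => ?_) measurableSet_ball
  simp only [Function.comp_apply, norm_sub_rev]

/-- The translated integral equals the central one: `∫_{B_r(q)} (‖q − p‖²)⁻¹ dp = ∫_{B_r(0)} (‖x‖²)⁻¹ dx`. [folklore]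
[cite: HardtKinderlehrerLin1986, §2] -/
theorem setIntegral_inv_norm_sub_sq_eq (q : EuclideanSpace ℝ (Fin 4)) (r : ℝ) :
    ∫ p in ball q r, (‖q - p‖ ^ 2)⁻¹ = ∫ x in ball (0 : EuclideanSpace ℝ (Fin 4)) r, (‖x‖ ^ 2)⁻¹ := by
  have hmp : MeasurePreserving (fun p : EuclideanSpace ℝ (Fin 4) => p - q) volume volume :=
    measurePreserving_sub_right volume q
  have hemb : MeasurableEmbedding (fun p : EuclideanSpace ℝ (Fin 4) => p - q) :=
    (MeasurableEquiv.subRight q).measurableEmbedding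
  have h := hmp.setIntegral_preimage_emb hemb (fun x : EuclideanSpace ℝ (Fin 4) => (‖x‖ ^ 2)⁻¹) (ball 0 r)
  rw [preimage_sub_ball] at h
  rw [← h]
  refine setIntegral_congr_fun measurableSet_ball fun p _ => ?_
  simp only [norm_sub_rev]

/-- THE UNIFORM BOUND: for `‖q‖ ≤ 1`, `∫_{B_{1∕2}(0)} (‖q − p‖²)⁻¹ dp ≤ I₀ := ∫_{B_2(0)} (‖x‖²)⁻¹ dx` (since `B_{1∕2}(0) ⊆ B_2(q)` and the
integrand is nonnegative). [cite: HardtKinderlehrerLin1986, §2] -/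
theorem setIntegral_inv_norm_sub_sq_le (q : EuclideanSpace ℝ (Fin 4)) (hq : ‖q‖ ≤ 1) :
    ∫ p in ball (0 : EuclideanSpace ℝ (Fin 4)) (1 / 2), (‖q - p‖ ^ 2)⁻¹ ≤
      ∫ x in ball (0 : EuclideanSpace ℝ (Fin 4)) 2, (‖x‖ ^ 2)⁻¹ := by
  rw [← setIntegral_inv_norm_sub_sq_eq q 2]
  refine setIntegral_mono_set (integrableOn_inv_norm_sub_sq_ball q 2) ?_ ?_
  · exact Filter.Eventually.of_forall fun p => by positivity
  · refine ae_of_all _ fun p hp => ?_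
    change p ∈ ball (0 : EuclideanSpace ℝ (Fin 4)) (1 / 2) at hp
    change p ∈ ball q 2
    rw [mem_ball_zero_iff] at hp
    rw [mem_ball, dist_eq_norm]
    calc ‖p - q‖ ≤ ‖p‖ + ‖q‖ := norm_sub_le p q
      _ < 1 / 2 + 1 := by linarith
      _ ≤ 2 := by norm_num

/-! ## §2 The averaged centre -/

end Literature.Analysis.PDE.MinimisingMaps

end Part9

/-!
## Part 10 — port of `Summits/QuantumFields/YangMills/Theorems/PoincareLipschitzProjectionAveragingContinuum.lean` (6 declarations kept)

# Energy minimising maps into `S³` (Hardt–Kinderlehrer–Lin / Luckhaus / Simon §2.9): Projection Averaging Continuum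

Declarations of this Part (verbatim port; each keeps its own docstring and citation): `integrableOn_inv_norm_sub_sq_halfBall`, `setLIntegral_inv_norm_sub_sq_le`, `aemeasurable_kernel`, `exists_centre_weightedIntegral_le_explicit`, `averagingConst_nonneg`, `exists_centre_weightedIntegral_le_of_countable`.

Reference keys (see `references.bib` and the declarations' citations): [HardtKinderlehrerLin1986].
-/

section Part10

open _root_.MeasureTheory _root_.Metric _root_.Set _root_.Function
open scoped _root_.BigOperators _root_.ENNReal

namespace Literature.Analysis.PDE.MinimisingMaps

/-! ## §1 The uniform inner bound in `ℝ≥0∞` form and measurability of the kernel -/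

/-- For `‖q‖ ≤ 1`: `p ↦ (‖q − p‖²)⁻¹` is integrable on `B_{1∕2}(0) ⊂ ℝ⁴` (it lies inside `B_2(q)`). [cite: HardtKinderlehrerLin1986, §2] -/
theorem integrableOn_inv_norm_sub_sq_halfBall (q : EuclideanSpace ℝ (Fin 4)) (hq : ‖q‖ ≤ 1) :
    IntegrableOn (fun p : EuclideanSpace ℝ (Fin 4) => (‖q - p‖ ^ 2)⁻¹) (ball 0 (1 / 2)) volume := by
  refine (integrableOn_inv_norm_sub_sq_ball q 2).mono_set fun p hp => ?_
  rw [mem_ball_zero_iff] at hp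
  rw [mem_ball, dist_eq_norm]
  calc ‖p - q‖ ≤ ‖p‖ + ‖q‖ := norm_sub_le _ _
    _ < 1 / 2 + 1 := by linarith
    _ ≤ 2 := by norm_num

/-- The H-2 uniform bound in `ℝ≥0∞` currency: for `‖q‖ ≤ 1`,
`∫⁻_{B_{1∕2}(0)} ofReal((‖q − p‖²)⁻¹) dp ≤ ofReal(I₀)`, `I₀ := ∫_{B_2(0)} (‖x‖²)⁻¹ dx`. [cite: HardtKinderlehrerLin1986, §2] -/
theorem setLIntegral_inv_norm_sub_sq_le (q : EuclideanSpace ℝ (Fin 4)) (hq : ‖q‖ ≤ 1) :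
    ∫⁻ p in ball (0 : EuclideanSpace ℝ (Fin 4)) (1 / 2), ENNReal.ofReal ((‖q - p‖ ^ 2)⁻¹) ≤
      ENNReal.ofReal (∫ x in ball (0 : EuclideanSpace ℝ (Fin 4)) 2, (‖x‖ ^ 2)⁻¹) := by
  rw [← ofReal_integral_eq_lintegral_ofReal (integrableOn_inv_norm_sub_sq_halfBall q hq)
    (Filter.Eventually.of_forall fun p => by positivity)]
  exact ENNReal.ofReal_le_ofReal (setIntegral_inv_norm_sub_sq_le q hq)

/-- Measurability of the kernel `(p, x) ↦ ofReal(c x)·ofReal((‖q x − p‖²)⁻¹)` on a product `ν × μ'` from a.e.-measurability of `c`, `q`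
with respect to `μ'`. [cite: HardtKinderlehrerLin1986, §2] -/
theorem aemeasurable_kernel {X : Type*} [MeasurableSpace X] {μ' : Measure X} [SFinite μ']
    (ν : Measure (EuclideanSpace ℝ (Fin 4))) {c : X → ℝ} {q : X → EuclideanSpace ℝ (Fin 4)}
    (hc : AEMeasurable c μ') (hq : AEMeasurable q μ') :
    AEMeasurable (uncurry fun (p : EuclideanSpace ℝ (Fin 4)) (x : X) =>
      ENNReal.ofReal (c x) * ENNReal.ofReal ((‖q x - p‖ ^ 2)⁻¹)) (ν.prod μ') := by
  have h1 : AEMeasurable (fun z : EuclideanSpace ℝ (Fin 4) × X => c z.2) (ν.prod μ') := hc.comp_snd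
  have h2 : AEMeasurable (fun z : EuclideanSpace ℝ (Fin 4) × X => q z.2) (ν.prod μ') := hq.comp_snd
  have h3 : AEMeasurable (fun z : EuclideanSpace ℝ (Fin 4) × X => z.1) (ν.prod μ') := measurable_fst.aemeasurable
  have h4 : AEMeasurable (fun z : EuclideanSpace ℝ (Fin 4) × X => (‖q z.2 - z.1‖ ^ 2)⁻¹) (ν.prod μ') :=
    ((h2.sub h3).norm.pow_const 2).inv
  exact h1.ennreal_ofReal.mul h4.ennreal_ofReal

/-! ## §2 The averaged centre, continuum form -/

/-- **HARDT–KINDERLEHRER–LIN AVERAGING, CONTINUUM FORM, EXPLICIT CONSTANT.**  Let `(X, μ)` be an s-finite measure space, `S ⊆ X`,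
`c : X → ℝ` integrable on `S` and a.e. nonnegative there, `q : X → ℝ⁴` a.e.-strongly measurable with `‖q‖ ≤ 1` a.e. on `S`, and `N ⊂ ℝ⁴`
Lebesgue-null.  Then some centre `p` with `‖p‖ < ½`, `p ∉ N`, makes `x ↦ c x·(‖q x − p‖²)⁻¹` integrable on `S` with
`∫_S c·(‖q − p‖²)⁻¹ ∂μ ≤ K₀·∫_S c ∂μ`, `K₀ := (∫_{B_2(0)} (‖x‖²)⁻¹ dx) ∕ |B_{1∕2}(0)|` — some centre of `B_{1∕2} ∖ N` does at least as well as the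
average, and the average is bounded by Tonelli and `∫_{B_{1∕2}} ‖q − p‖⁻² dp ≤ I₀`. [cite: HardtKinderlehrerLin1986, §2] -/
theorem exists_centre_weightedIntegral_le_explicit {X : Type*} [MeasurableSpace X] (μ : Measure X) [SFinite μ]
    (S : Set X) (c : X → ℝ) (q : X → EuclideanSpace ℝ (Fin 4)) (N : Set (EuclideanSpace ℝ (Fin 4)))
    (hc : IntegrableOn c S μ) (hc0 : 0 ≤ᵐ[μ.restrict S] c) (hq : AEStronglyMeasurable q (μ.restrict S))
    (hq1 : ∀ᵐ x ∂(μ.restrict S), ‖q x‖ ≤ 1) (hN : volume N = 0) :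
    ∃ p : EuclideanSpace ℝ (Fin 4), ‖p‖ < 1 / 2 ∧ p ∉ N ∧
      IntegrableOn (fun x => c x * (‖q x - p‖ ^ 2)⁻¹) S μ ∧
      ∫ x in S, c x * (‖q x - p‖ ^ 2)⁻¹ ∂μ ≤
        (∫ x in ball (0 : EuclideanSpace ℝ (Fin 4)) 2, (‖x‖ ^ 2)⁻¹) / (volume (ball (0 : EuclideanSpace ℝ (Fin 4)) (1 / 2))).toReal *
          ∫ x in S, c x ∂μ := by
  set I₀ : ℝ := ∫ x in ball (0 : EuclideanSpace ℝ (Fin 4)) 2, (‖x‖ ^ 2)⁻¹ with hI₀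
  set B : Set (EuclideanSpace ℝ (Fin 4)) := ball 0 (1 / 2) with hB
  have hBpos : 0 < volume B := measure_ball_pos volume (0 : EuclideanSpace ℝ (Fin 4)) (by norm_num)
  have hBtop : volume B < ⊤ := measure_ball_lt_top
  have hV0 : 0 < (volume B).toReal := ENNReal.toReal_pos hBpos.ne' hBtop.ne
  have hI₀0 : 0 ≤ I₀ := setIntegral_nonneg measurableSet_ball fun x _ => by positivity
  have hCint : 0 ≤ ∫ x in S, c x ∂μ := setIntegral_nonneg_of_ae_restrict hc0
  -- the averaging set: the ball minus the null exceptional set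
  set s : Set (EuclideanSpace ℝ (Fin 4)) := B \ N with hs
  have hsvol : volume s = volume B := measure_sdiff_null hN
  have hs0 : volume s ≠ 0 := by rw [hsvol]; exact hBpos.ne'
  have hstop : volume s ≠ ⊤ := by rw [hsvol]; exact hBtop.ne
  have hsB : s ⊆ B := fun x hx => hx.1
  -- the measures and the kernel
  set μS : Measure X := μ.restrict S with hμS
  set ν : Measure (EuclideanSpace ℝ (Fin 4)) := volume.restrict s with hν
  set k : EuclideanSpace ℝ (Fin 4) → X → ℝ≥0∞ :=
    fun p x => ENNReal.ofReal (c x) * ENNReal.ofReal ((‖q x - p‖ ^ 2)⁻¹) with hk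
  have hcm : AEMeasurable c μS := hc.aestronglyMeasurable.aemeasurable
  have hqm : AEMeasurable q μS := hq.aemeasurable
  have hkm : AEMeasurable (uncurry k) (ν.prod μS) := aemeasurable_kernel ν hcm hqm
  -- Φ(p) := ∫⁻ k p x dμS is a.e.-measurable in p
  set Φ : EuclideanSpace ℝ (Fin 4) → ℝ≥0∞ := fun p => ∫⁻ x, k p x ∂μS with hΦ
  have hΦm : AEMeasurable Φ ν := hkm.lintegral_prod_right'
  -- Tonelli and the uniform inner bound: ∫⁻ Φ dν ≤ ofReal I₀ * ofReal (∫_S c)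
  have hinner : ∀ᵐ x ∂μS, ∫⁻ p, k p x ∂ν ≤ ENNReal.ofReal (c x) * ENNReal.ofReal I₀ := by
    filter_upwards [hq1] with x hx
    rw [hk]
    dsimp only
    rw [lintegral_const_mul' _ _ ENNReal.ofReal_ne_top]
    have hAC : ∫⁻ p, ENNReal.ofReal ((‖q x - p‖ ^ 2)⁻¹) ∂ν ≤ ENNReal.ofReal I₀ :=
      calc ∫⁻ p, ENNReal.ofReal ((‖q x - p‖ ^ 2)⁻¹) ∂ν
          ≤ ∫⁻ p in B, ENNReal.ofReal ((‖q x - p‖ ^ 2)⁻¹) := lintegral_mono' (Measure.restrict_mono hsB le_rfl) le_rfl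
        _ ≤ ENNReal.ofReal I₀ := setLIntegral_inv_norm_sub_sq_le (q x) hx
    exact mul_le_mul_of_nonneg_left hAC (zero_le)
  have hTon : ∫⁻ p, Φ p ∂ν ≤ ENNReal.ofReal I₀ * ENNReal.ofReal (∫ x in S, c x ∂μ) := by
    calc ∫⁻ p, Φ p ∂ν = ∫⁻ p, ∫⁻ x, k p x ∂μS ∂ν := rfl
      _ = ∫⁻ x, ∫⁻ p, k p x ∂ν ∂μS := lintegral_lintegral_swap hkm
      _ ≤ ∫⁻ x, ENNReal.ofReal (c x) * ENNReal.ofReal I₀ ∂μS := lintegral_mono_ae hinner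
      _ = (∫⁻ x, ENNReal.ofReal (c x) ∂μS) * ENNReal.ofReal I₀ := lintegral_mul_const'' _ hcm.ennreal_ofReal
      _ = ENNReal.ofReal (∫ x in S, c x ∂μ) * ENNReal.ofReal I₀ := by
          rw [ofReal_integral_eq_lintegral_ofReal hc hc0]
      _ = ENNReal.ofReal I₀ * ENNReal.ofReal (∫ x in S, c x ∂μ) := mul_comm _ _
  have hTon_top : ∫⁻ p, Φ p ∂ν ≠ ⊤ :=
    ne_top_of_le_ne_top (ENNReal.mul_ne_top ENNReal.ofReal_ne_top ENNReal.ofReal_ne_top) hTon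
  -- some centre of `s` is below the average
  obtain ⟨p, hps, hple⟩ := exists_le_setLAverage (μ := volume) (f := Φ) hs0 hstop hΦm
  have hΦp : Φ p ≤ (ENNReal.ofReal I₀ * ENNReal.ofReal (∫ x in S, c x ∂μ)) / volume B := by
    calc Φ p ≤ ⨍⁻ a in s, Φ a ∂volume := hple
      _ = (∫⁻ a in s, Φ a ∂volume) / volume s := setLAverage_eq _ _ _
      _ ≤ (ENNReal.ofReal I₀ * ENNReal.ofReal (∫ x in S, c x ∂μ)) / volume B := by
          rw [hsvol]; exact ENNReal.div_le_div_right hTon _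
  have hRHS_top : (ENNReal.ofReal I₀ * ENNReal.ofReal (∫ x in S, c x ∂μ)) / volume B ≠ ⊤ :=
    ENNReal.div_ne_top (ENNReal.mul_ne_top ENNReal.ofReal_ne_top ENNReal.ofReal_ne_top) hBpos.ne'
  have hΦp_top : Φ p < ⊤ := lt_of_le_of_lt hΦp hRHS_top.lt_top
  -- the real integrand at the chosen centre
  set g : X → ℝ := fun x => c x * (‖q x - p‖ ^ 2)⁻¹ with hg
  have hg0 : 0 ≤ᵐ[μS] g := by
    filter_upwards [hc0] with x hx
    exact mul_nonneg hx (by positivity)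
  have hgm : AEStronglyMeasurable g μS := by
    have h1 : AEMeasurable (fun x => (‖q x - p‖ ^ 2)⁻¹) μS := ((hqm.sub_const p).norm.pow_const 2).inv
    exact (hcm.mul h1).aestronglyMeasurable
  have hg_ofReal : ∀ᵐ x ∂μS, ENNReal.ofReal (g x) = k p x := by
    filter_upwards [hc0] with x hx
    rw [hg, hk]
    dsimp only
    rw [ENNReal.ofReal_mul hx]
  have hlint_g : ∫⁻ x, ENNReal.ofReal (g x) ∂μS = Φ p := lintegral_congr_ae hg_ofReal
  have hgint : Integrable g μS := by
    refine ⟨hgm, ?_⟩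
    rw [hasFiniteIntegral_iff_ofReal hg0, hlint_g]
    exact hΦp_top
  refine ⟨p, ?_, hps.2, hgint, ?_⟩
  · have := hsB hps; rwa [hB, mem_ball_zero_iff] at this
  · -- `∫ g = toReal (Φ p) ≤ toReal (ofReal I₀ * ofReal ∫c / |B|) = I₀ / |B| * ∫ c`
    have hint_eq : ∫ x in S, g x ∂μ = (Φ p).toReal := by
      rw [← hlint_g]; exact integral_eq_lintegral_of_nonneg_ae hg0 hgm
    calc ∫ x in S, c x * (‖q x - p‖ ^ 2)⁻¹ ∂μ = (Φ p).toReal := hint_eq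
      _ ≤ ((ENNReal.ofReal I₀ * ENNReal.ofReal (∫ x in S, c x ∂μ)) / volume B).toReal :=
          ENNReal.toReal_mono hRHS_top hΦp
      _ = I₀ * (∫ x in S, c x ∂μ) / (volume B).toReal := by
          rw [ENNReal.toReal_div, ENNReal.toReal_mul, ENNReal.toReal_ofReal hI₀0, ENNReal.toReal_ofReal hCint]
      _ = I₀ / (volume B).toReal * ∫ x in S, c x ∂μ := by ring

/-- The explicit constant `K₀ = I₀ ∕ |B_{1∕2}(0)|` is nonnegative. [cite: HardtKinderlehrerLin1986, §2] -/
theorem averagingConst_nonneg :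
    0 ≤ (∫ x in ball (0 : EuclideanSpace ℝ (Fin 4)) 2, (‖x‖ ^ 2)⁻¹) /
      (volume (ball (0 : EuclideanSpace ℝ (Fin 4)) (1 / 2))).toReal :=
  div_nonneg (setIntegral_nonneg measurableSet_ball fun x _ => by positivity) ENNReal.toReal_nonneg

/-- The countable-exceptional-set form (a countable set is Lebesgue-null): same conclusion with `N.Countable` in place of `volume N = 0`.
[cite: HardtKinderlehrerLin1986, §2] -/
theorem exists_centre_weightedIntegral_le_of_countable {X : Type*} [MeasurableSpace X] (μ : Measure X) [SFinite μ]
    (S : Set X) (c : X → ℝ) (q : X → EuclideanSpace ℝ (Fin 4)) (N : Set (EuclideanSpace ℝ (Fin 4)))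
    (hc : IntegrableOn c S μ) (hc0 : 0 ≤ᵐ[μ.restrict S] c) (hq : AEStronglyMeasurable q (μ.restrict S))
    (hq1 : ∀ᵐ x ∂(μ.restrict S), ‖q x‖ ≤ 1) (hN : N.Countable) :
    ∃ p : EuclideanSpace ℝ (Fin 4), ‖p‖ < 1 / 2 ∧ p ∉ N ∧
      IntegrableOn (fun x => c x * (‖q x - p‖ ^ 2)⁻¹) S μ ∧
      ∫ x in S, c x * (‖q x - p‖ ^ 2)⁻¹ ∂μ ≤
        (∫ x in ball (0 : EuclideanSpace ℝ (Fin 4)) 2, (‖x‖ ^ 2)⁻¹) / (volume (ball (0 : EuclideanSpace ℝ (Fin 4)) (1 / 2))).toReal *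
          ∫ x in S, c x ∂μ :=
  exists_centre_weightedIntegral_le_explicit μ S c q N hc hc0 hq hq1 (hN.measure_zero volume)

end Literature.Analysis.PDE.MinimisingMaps

end Part10

/-!
## Part 11 — port of `Summits/QuantumFields/YangMills/Theorems/PoincareLipschitzSphereRayProjection.lean` (10 declarations kept)

# Energy minimising maps into `S³` (Hardt–Kinderlehrer–Lin / Luckhaus / Simon §2.9): Sphere Ray Projection

Declarations of this Part (verbatim port; each keeps its own docstring and citation): `sqrt_sq_add_sub_sqrt_sq_add_le`, `root_nonneg`, `root_le_two`, `abs_root_sub_root_le`, `norm_add_root_smul_eq_one`, `norm_normalize_sub_normalize_le`, `norm_sphere_point_sub_le`, `norm_rayProj_eq_one`, `rayProj_eq_self_of_norm_eq_one`, `norm_rayProj_sub_rayProj_le`.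

Reference keys (see `references.bib` and the declarations' citations): [HardtKinderlehrerLin1986].
-/

section Part11

open scoped _root_.InnerProductSpace
open RealInnerProductSpace

namespace Literature.Analysis.PDE.MinimisingMaps

variable {V : Type*} [NormedAddCommGroup V] [InnerProductSpace ℝ V]

/-! ## §1 The positive root `s(p,e) = −⟪p,e⟫ + √(⟪p,e⟫² + (1 − ‖p‖²))` -/

/-- `x ↦ √(x² + c)` is 1-Lipschitz (`c > 0`): `|√(x²+c) − √(x′²+c)| ≤ |x − x′|`. [cite: HardtKinderlehrerLin1986, §2] -/
theorem sqrt_sq_add_sub_sqrt_sq_add_le {x x' c : ℝ} (hc : 0 < c) :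
    |Real.sqrt (x ^ 2 + c) - Real.sqrt (x' ^ 2 + c)| ≤ |x - x'| := by
  set u := Real.sqrt (x ^ 2 + c) with hu
  set v := Real.sqrt (x' ^ 2 + c) with hv
  have hx0 : 0 ≤ x ^ 2 + c := by positivity
  have hx0' : 0 ≤ x' ^ 2 + c := by positivity
  have hu0 : 0 < u := Real.sqrt_pos.mpr (by positivity)
  have hv0 : 0 < v := Real.sqrt_pos.mpr (by positivity)
  have hu2 : u ^ 2 = x ^ 2 + c := by rw [hu, Real.sq_sqrt hx0]
  have hv2 : v ^ 2 = x' ^ 2 + c := by rw [hv, Real.sq_sqrt hx0']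
  have hxu : |x| ≤ u := by
    rw [← Real.sqrt_sq_eq_abs, hu]; exact Real.sqrt_le_sqrt (by linarith)
  have hxv : |x'| ≤ v := by
    rw [← Real.sqrt_sq_eq_abs, hv]; exact Real.sqrt_le_sqrt (by linarith)
  -- `(u − v)(u + v) = (x − x′)(x + x′)` and `|x + x′| ≤ u + v`
  have hkey : (u - v) * (u + v) = (x - x') * (x + x') := by nlinarith [hu2, hv2]
  have hsum : |x + x'| ≤ u + v := (abs_add_le x x').trans (add_le_add hxu hxv)
  have hpos : 0 < u + v := by linarith
  have h1 : |u - v| * (u + v) = |x - x'| * |x + x'| := by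
    rw [← abs_of_pos hpos, ← abs_mul, hkey, abs_mul]
  have h2 : |u - v| * (u + v) ≤ |x - x'| * (u + v) := by
    rw [h1]; exact mul_le_mul_of_nonneg_left hsum (abs_nonneg _)
  exact le_of_mul_le_mul_right h2 hpos

/-- The root is nonnegative: `0 ≤ −⟪p,e⟫ + √(⟪p,e⟫² + (1 − ‖p‖²))` for `‖p‖ ≤ 1`. [cite: HardtKinderlehrerLin1986, §2] -/
theorem root_nonneg (p e : V) (hp : ‖p‖ ≤ 1) :
    0 ≤ -⟪p, e⟫ + Real.sqrt (⟪p, e⟫ ^ 2 + (1 - ‖p‖ ^ 2)) := by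
  have hc : 0 ≤ 1 - ‖p‖ ^ 2 := by nlinarith [norm_nonneg p]
  have h1 : |⟪p, e⟫| ≤ Real.sqrt (⟪p, e⟫ ^ 2 + (1 - ‖p‖ ^ 2)) := by
    rw [← Real.sqrt_sq_eq_abs]; exact Real.sqrt_le_sqrt (by linarith)
  linarith [le_abs_self ⟪p, e⟫]

/-- The root is at most `2` on unit directions for `‖p‖ ≤ ½`. [cite: HardtKinderlehrerLin1986, §2] -/
theorem root_le_two (p e : V) (hp : ‖p‖ ≤ 1 / 2) (he : ‖e‖ = 1) :
    -⟪p, e⟫ + Real.sqrt (⟪p, e⟫ ^ 2 + (1 - ‖p‖ ^ 2)) ≤ 2 := by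
  have hB : |⟪p, e⟫| ≤ 1 / 2 := by
    calc |⟪p, e⟫| ≤ ‖p‖ * ‖e‖ := abs_real_inner_le_norm p e
      _ ≤ 1 / 2 * 1 := mul_le_mul hp he.le (norm_nonneg _) (by norm_num)
      _ = 1 / 2 := by ring
  have hB2 : ⟪p, e⟫ ^ 2 ≤ 1 / 4 := by
    have := abs_le.mp hB; nlinarith [this.1, this.2]
  have hs : Real.sqrt (⟪p, e⟫ ^ 2 + (1 - ‖p‖ ^ 2)) ≤ 3 / 2 := by
    rw [Real.sqrt_le_left (by norm_num)]
    nlinarith [norm_nonneg p]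
  linarith [neg_le_abs ⟪p, e⟫, le_abs_self ⟪p, e⟫, abs_le.mp hB]

/-- `s(p,·)` is 1-Lipschitz for `‖p‖ ≤ ½`: `|s(p,e) − s(p,e′)| ≤ ‖e − e′‖` (any `e, e′`). [cite: HardtKinderlehrerLin1986, §2] -/
theorem abs_root_sub_root_le (p e e' : V) (hp : ‖p‖ ≤ 1 / 2) :
    |(-⟪p, e⟫ + Real.sqrt (⟪p, e⟫ ^ 2 + (1 - ‖p‖ ^ 2))) -
      (-⟪p, e'⟫ + Real.sqrt (⟪p, e'⟫ ^ 2 + (1 - ‖p‖ ^ 2)))| ≤ ‖e - e'‖ := by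
  have hc : 0 < 1 - ‖p‖ ^ 2 := by nlinarith [norm_nonneg p]
  have hB : |⟪p, e⟫ - ⟪p, e'⟫| ≤ 1 / 2 * ‖e - e'‖ := by
    rw [← inner_sub_right]
    calc |⟪p, e - e'⟫| ≤ ‖p‖ * ‖e - e'‖ := abs_real_inner_le_norm p _
      _ ≤ 1 / 2 * ‖e - e'‖ := mul_le_mul_of_nonneg_right hp (norm_nonneg _)
  have hS := sqrt_sq_add_sub_sqrt_sq_add_le (x := ⟪p, e⟫) (x' := ⟪p, e'⟫) hc
  calc |(-⟪p, e⟫ + Real.sqrt (⟪p, e⟫ ^ 2 + (1 - ‖p‖ ^ 2))) -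
        (-⟪p, e'⟫ + Real.sqrt (⟪p, e'⟫ ^ 2 + (1 - ‖p‖ ^ 2)))|
      = |-(⟪p, e⟫ - ⟪p, e'⟫) +
          (Real.sqrt (⟪p, e⟫ ^ 2 + (1 - ‖p‖ ^ 2)) - Real.sqrt (⟪p, e'⟫ ^ 2 + (1 - ‖p‖ ^ 2)))| := by ring_nf
    _ ≤ |-(⟪p, e⟫ - ⟪p, e'⟫)| +
          |Real.sqrt (⟪p, e⟫ ^ 2 + (1 - ‖p‖ ^ 2)) - Real.sqrt (⟪p, e'⟫ ^ 2 + (1 - ‖p‖ ^ 2))| := abs_add_le _ _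
    _ ≤ 1 / 2 * ‖e - e'‖ + |⟪p, e⟫ - ⟪p, e'⟫| := by rw [abs_neg]; exact add_le_add hB hS
    _ ≤ 1 / 2 * ‖e - e'‖ + 1 / 2 * ‖e - e'‖ := by linarith
    _ = ‖e - e'‖ := by ring

/-- THE ROOT PROPERTY: on a unit direction `e`, `p + s(p,e)·e` lies on the unit sphere (`‖p‖ ≤ 1`). [cite: HardtKinderlehrerLin1986, §2] -/
theorem norm_add_root_smul_eq_one (p e : V) (hp : ‖p‖ ≤ 1) (he : ‖e‖ = 1) :
    ‖p + (-⟪p, e⟫ + Real.sqrt (⟪p, e⟫ ^ 2 + (1 - ‖p‖ ^ 2))) • e‖ = 1 := by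
  set B := ⟪p, e⟫ with hB
  set σ := -B + Real.sqrt (B ^ 2 + (1 - ‖p‖ ^ 2)) with hσ
  have hc : 0 ≤ B ^ 2 + (1 - ‖p‖ ^ 2) := by nlinarith [norm_nonneg p]
  have hsq : Real.sqrt (B ^ 2 + (1 - ‖p‖ ^ 2)) ^ 2 = B ^ 2 + (1 - ‖p‖ ^ 2) := Real.sq_sqrt hc
  -- `σ² + 2σB + ‖p‖² − 1 = 0`
  have hquad : σ ^ 2 + 2 * σ * B + ‖p‖ ^ 2 = 1 := by
    rw [hσ]; nlinarith [hsq]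
  have h2 : ‖p + σ • e‖ ^ 2 = 1 := by
    rw [norm_add_sq_real, norm_smul, he, mul_one, Real.norm_eq_abs, sq_abs, inner_smul_right, ← hB]
    nlinarith [hquad]
  have h0 : 0 ≤ ‖p + σ • e‖ := norm_nonneg _
  nlinarith [h2, h0]

/-! ## §2 Normalisation is `2∕‖u‖`-Lipschitz; the sphere point is `3`-Lipschitz in the direction -/

/-- `‖û − v̂‖ ≤ 2‖u − v‖∕‖u‖` for nonzero `u, v` (`û = ‖u‖⁻¹u`): `û − v̂ = (u − v)∕‖u‖ + v(‖v‖ − ‖u‖)∕(‖u‖‖v‖)` — valid whichever of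
`u, v` is longer. [cite: HardtKinderlehrerLin1986, §2] -/
theorem norm_normalize_sub_normalize_le (u v : V) (hu : u ≠ 0) (hv : v ≠ 0) :
    ‖‖u‖⁻¹ • u - ‖v‖⁻¹ • v‖ ≤ 2 * ‖u - v‖ / ‖u‖ := by
  have hu0 : 0 < ‖u‖ := norm_pos_iff.mpr hu
  have hv0 : 0 < ‖v‖ := norm_pos_iff.mpr hv
  have hsplit : ‖u‖⁻¹ • u - ‖v‖⁻¹ • v = ‖u‖⁻¹ • (u - v) + (‖u‖⁻¹ - ‖v‖⁻¹) • v := by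
    rw [smul_sub, sub_smul]; abel
  have h1 : ‖‖u‖⁻¹ • (u - v)‖ = ‖u - v‖ / ‖u‖ := by
    rw [norm_smul, Real.norm_eq_abs, abs_of_pos (inv_pos.mpr hu0), inv_mul_eq_div]
  have h2 : ‖(‖u‖⁻¹ - ‖v‖⁻¹) • v‖ ≤ ‖u - v‖ / ‖u‖ := by
    rw [norm_smul, Real.norm_eq_abs]
    have hdiff : |‖u‖⁻¹ - ‖v‖⁻¹| * ‖v‖ = |‖v‖ - ‖u‖| / ‖u‖ := by
      rw [inv_sub_inv hu0.ne' hv0.ne', abs_div, abs_of_pos (mul_pos hu0 hv0)]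
      field_simp
    rw [hdiff]
    exact div_le_div_of_nonneg_right ((abs_norm_sub_norm_le v u).trans (by rw [norm_sub_rev])) hu0.le
  calc ‖‖u‖⁻¹ • u - ‖v‖⁻¹ • v‖ = ‖‖u‖⁻¹ • (u - v) + (‖u‖⁻¹ - ‖v‖⁻¹) • v‖ := by rw [hsplit]
    _ ≤ ‖‖u‖⁻¹ • (u - v)‖ + ‖(‖u‖⁻¹ - ‖v‖⁻¹) • v‖ := norm_add_le _ _
    _ ≤ ‖u - v‖ / ‖u‖ + ‖u - v‖ / ‖u‖ := by rw [h1]; exact add_le_add le_rfl h2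
    _ = 2 * ‖u - v‖ / ‖u‖ := by ring

/-- The sphere point `e ↦ p + s(p,e)·e` is 3-Lipschitz on unit directions (`‖p‖ ≤ ½`): `s ≤ 2` carries `e − e′`, and `s` is 1-Lipschitz.
[cite: HardtKinderlehrerLin1986, §2] -/
theorem norm_sphere_point_sub_le (p e e' : V) (hp : ‖p‖ ≤ 1 / 2) (he : ‖e‖ = 1) (he' : ‖e'‖ = 1) :
    ‖(p + (-⟪p, e⟫ + Real.sqrt (⟪p, e⟫ ^ 2 + (1 - ‖p‖ ^ 2))) • e) -
      (p + (-⟪p, e'⟫ + Real.sqrt (⟪p, e'⟫ ^ 2 + (1 - ‖p‖ ^ 2))) • e')‖ ≤ 3 * ‖e - e'‖ := by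
  set σ := -⟪p, e⟫ + Real.sqrt (⟪p, e⟫ ^ 2 + (1 - ‖p‖ ^ 2)) with hσ
  set σ' := -⟪p, e'⟫ + Real.sqrt (⟪p, e'⟫ ^ 2 + (1 - ‖p‖ ^ 2)) with hσ'
  have hp1 : ‖p‖ ≤ 1 := hp.trans (by norm_num)
  have hσ0 : 0 ≤ σ := root_nonneg p e hp1
  have hσ2 : σ ≤ 2 := root_le_two p e hp he
  have hdiff : |σ - σ'| ≤ ‖e - e'‖ := abs_root_sub_root_le p e e' hp
  have hsplit : (p + σ • e) - (p + σ' • e') = σ • (e - e') + (σ - σ') • e' := by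
    rw [smul_sub, sub_smul]; abel
  calc ‖(p + σ • e) - (p + σ' • e')‖ = ‖σ • (e - e') + (σ - σ') • e'‖ := by rw [hsplit]
    _ ≤ ‖σ • (e - e')‖ + ‖(σ - σ') • e'‖ := norm_add_le _ _
    _ = |σ| * ‖e - e'‖ + |σ - σ'| * 1 := by rw [norm_smul, norm_smul, Real.norm_eq_abs, Real.norm_eq_abs, he']
    _ ≤ 2 * ‖e - e'‖ + ‖e - e'‖ * 1 := by
        rw [abs_of_nonneg hσ0]
        exact add_le_add (mul_le_mul_of_nonneg_right hσ2 (norm_nonneg _)) (mul_le_mul_of_nonneg_right hdiff zero_le_one)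
    _ = 3 * ‖e - e'‖ := by ring

/-! ## §3 The ray projection: on the sphere, fixes the sphere, `6∕‖y − p‖`-Lipschitz -/

/-- The ray projection `π_p(y) = p + s(p, e_y)·e_y`, `e_y = ‖y−p‖⁻¹(y−p)`, lands on the unit sphere (`‖p‖ ≤ ½`, `y ≠ p`).
[cite: HardtKinderlehrerLin1986, §2] -/
theorem norm_rayProj_eq_one (p y : V) (hp : ‖p‖ ≤ 1 / 2) (hy : y ≠ p) :
    ‖p + (-⟪p, ‖y - p‖⁻¹ • (y - p)⟫ + Real.sqrt (⟪p, ‖y - p‖⁻¹ • (y - p)⟫ ^ 2 + (1 - ‖p‖ ^ 2))) •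
        (‖y - p‖⁻¹ • (y - p))‖ = 1 := by
  have hyp : y - p ≠ 0 := sub_ne_zero.mpr hy
  have he : ‖‖y - p‖⁻¹ • (y - p)‖ = 1 := by
    rw [norm_smul, Real.norm_eq_abs, abs_of_pos (inv_pos.mpr (norm_pos_iff.mpr hyp)),
      inv_mul_cancel₀ (norm_ne_zero_iff.mpr hyp)]
  exact norm_add_root_smul_eq_one p _ (hp.trans (by norm_num)) he

/-- The ray projection FIXES THE SPHERE: `‖y‖ = 1 ⇒ π_p(y) = y` (`‖p‖ ≤ ½`): with `d = ‖y − p‖ ≥ ½`,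
`√(⟪p,e_y⟫² + 1 − ‖p‖²) = d + ⟪p,e_y⟫` since `‖y − p‖² + 2⟪p, y − p⟫ = 1 − ‖p‖²`. [cite: HardtKinderlehrerLin1986, §2] -/
theorem rayProj_eq_self_of_norm_eq_one (p y : V) (hp : ‖p‖ ≤ 1 / 2) (hy : ‖y‖ = 1) :
    p + (-⟪p, ‖y - p‖⁻¹ • (y - p)⟫ + Real.sqrt (⟪p, ‖y - p‖⁻¹ • (y - p)⟫ ^ 2 + (1 - ‖p‖ ^ 2))) •
        (‖y - p‖⁻¹ • (y - p)) = y := by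
  set d := ‖y - p‖ with hd
  have hd0 : 1 / 2 ≤ d := by
    have := norm_sub_norm_le y p
    rw [hd]; linarith [norm_sub_rev y p, abs_norm_sub_norm_le y p, norm_nonneg (y - p),
      (le_abs_self (‖y‖ - ‖p‖)).trans (abs_norm_sub_norm_le y p)]
  have hdpos : 0 < d := by linarith
  have hyp : y - p ≠ 0 := by
    intro h; rw [hd, h, norm_zero] at hdpos; exact lt_irrefl _ hdpos
  -- `⟪p, e⟫ = ⟪p, y − p⟫ ∕ d`
  have hB : ⟪p, d⁻¹ • (y - p)⟫ = d⁻¹ * ⟪p, y - p⟫ := by rw [inner_smul_right]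
  -- the key identity `‖y − p‖² + 2⟪p, y − p⟫ = 1 − ‖p‖²`
  have hkey : d ^ 2 + 2 * ⟪p, y - p⟫ = 1 - ‖p‖ ^ 2 := by
    have h1 : d ^ 2 = ‖y‖ ^ 2 - 2 * ⟪y, p⟫ + ‖p‖ ^ 2 := by rw [hd]; exact norm_sub_sq_real y p
    rw [real_inner_comm p y] at h1
    rw [inner_sub_right, real_inner_self_eq_norm_sq, h1, hy]
    ring
  -- the square root equals `d + ⟪p, e⟫`
  have hBabs : |d⁻¹ * ⟪p, y - p⟫| ≤ 1 / 2 := by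
    rw [← hB]
    calc |⟪p, d⁻¹ • (y - p)⟫| ≤ ‖p‖ * ‖d⁻¹ • (y - p)‖ := abs_real_inner_le_norm _ _
      _ = ‖p‖ * 1 := by
          rw [norm_smul, Real.norm_eq_abs, abs_of_pos (inv_pos.mpr hdpos), ← hd, inv_mul_cancel₀ hdpos.ne']
      _ ≤ 1 / 2 := by linarith
  have hnonneg : 0 ≤ d + d⁻¹ * ⟪p, y - p⟫ := by
    linarith [neg_abs_le (d⁻¹ * ⟪p, y - p⟫)]
  have hsqrt : Real.sqrt ((d⁻¹ * ⟪p, y - p⟫) ^ 2 + (1 - ‖p‖ ^ 2)) = d + d⁻¹ * ⟪p, y - p⟫ := by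
    rw [Real.sqrt_eq_iff_mul_self_eq (by nlinarith [norm_nonneg p, hp]) hnonneg]
    have hdd : d * d⁻¹ = 1 := mul_inv_cancel₀ hdpos.ne'
    nlinarith [hkey, hdd]
  rw [hB, hsqrt]
  have hcoef : -(d⁻¹ * ⟪p, y - p⟫) + (d + d⁻¹ * ⟪p, y - p⟫) = d := by ring
  rw [hcoef, smul_smul, mul_inv_cancel₀ hdpos.ne', one_smul]
  abel

/-- **THE RAY PROJECTION IS `6∕‖y − p‖`-LIPSCHITZ** (`‖p‖ ≤ ½`, `y, z ≠ p`):
`‖π_p(y) − π_p(z)‖ ≤ 3‖e_y − e_z‖ ≤ 6‖y − z‖∕‖y − p‖` — the Hardt–Kinderlehrer–Lin kernel bound `|Dπ_p(y)| ≲ 1∕|y − p|` in finite-difference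
form, with no smallness and no calculus. [cite: HardtKinderlehrerLin1986, §2] -/
theorem norm_rayProj_sub_rayProj_le (p y z : V) (hp : ‖p‖ ≤ 1 / 2) (hy : y ≠ p) (hz : z ≠ p) :
    ‖(p + (-⟪p, ‖y - p‖⁻¹ • (y - p)⟫ + Real.sqrt (⟪p, ‖y - p‖⁻¹ • (y - p)⟫ ^ 2 + (1 - ‖p‖ ^ 2))) •
          (‖y - p‖⁻¹ • (y - p))) -
      (p + (-⟪p, ‖z - p‖⁻¹ • (z - p)⟫ + Real.sqrt (⟪p, ‖z - p‖⁻¹ • (z - p)⟫ ^ 2 + (1 - ‖p‖ ^ 2))) •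
          (‖z - p‖⁻¹ • (z - p)))‖ ≤ 6 * ‖y - z‖ / ‖y - p‖ := by
  have hyp : y - p ≠ 0 := sub_ne_zero.mpr hy
  have hzp : z - p ≠ 0 := sub_ne_zero.mpr hz
  have hunit : ∀ w : V, w ≠ 0 → ‖‖w‖⁻¹ • w‖ = 1 := fun w hw => by
    rw [norm_smul, Real.norm_eq_abs, abs_of_pos (inv_pos.mpr (norm_pos_iff.mpr hw)),
      inv_mul_cancel₀ (norm_ne_zero_iff.mpr hw)]
  have h1 := norm_sphere_point_sub_le p (‖y - p‖⁻¹ • (y - p)) (‖z - p‖⁻¹ • (z - p)) hp (hunit _ hyp) (hunit _ hzp)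
  have h2 := norm_normalize_sub_normalize_le (y - p) (z - p) hyp hzp
  have h3 : ‖(y - p) - (z - p)‖ = ‖y - z‖ := by congr 1; abel
  rw [h3] at h2
  have hyp0 : 0 < ‖y - p‖ := norm_pos_iff.mpr hyp
  calc _ ≤ 3 * ‖‖y - p‖⁻¹ • (y - p) - ‖z - p‖⁻¹ • (z - p)‖ := h1
    _ ≤ 3 * (2 * ‖y - z‖ / ‖y - p‖) := mul_le_mul_of_nonneg_left h2 (by norm_num)
    _ = 6 * ‖y - z‖ / ‖y - p‖ := by ring

end Literature.Analysis.PDE.MinimisingMaps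

end Part11

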